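import Mathlib
import Summits.Schanuel.Schanuel.Theses.RigidCore
import Summits.Schanuel.Schanuel.Theorems.RoyCriterionRankOne
import Summits.Schanuel.Schanuel.Theorems.AclSubsetLogFreeCore.Negative.ExpAclField
import Summits.Schanuel.Schanuel.Theorems.AclSubsetLogFreeCore.Negative.AclSubsetLogFreeCoreIffReal
import Summits.Schanuel.Schanuel.Theorems.AclSubsetLogFreeCore.Negative.LogFreeCoreCountable
import Summits.Schanuel.Schanuel.Theorems.AclSubsetLogFreeCore.Negative.BranchParity
import Literature.ModelTheory.ExponentialFields.DefinabilityParams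
import Literature.NumberTheory.Transcendental.LindemannWeierstrassProofs
import Literature.NumberTheory.Transcendental.KirbyWeakSchanuelAx
import Literature.NumberTheory.Transcendental.SchanuelEclEmptyProofs
import Literature.NumberTheory.Transcendental.RankOneGridTrdeg
import Literature.NumberTheory.Transcendental.GammaFields
import Literature.NumberTheory.Transcendental.ZilberFieldExistenceProofs
import Literature.NumberTheory.Transcendental.AxSchanuelTwoGerms
import Literature.NumberTheory.Transcendental.ZilberFieldCCP
import Literature.NumberTheory.Transcendental.KernelTranslatesRankTwoSectors

/-!
# Disproof work file for crux `RigidCore.MinimalCounterexampleInAcl` (item stmt-Schanuel-0969) — gen 4 (extends gen 3)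

Standing adversary file (cdisprove).  Findings, all PROVED unless marked `sorry` (none at present):

* §0 read-back: `crux_iff` — the crux says: every FIRST-FAILURE counterexample `x ∈ ℂⁿ` to Schanuel
  (`IsFirstFailure x`: `x` ℚ-linearly independent, `trdeg ℚ(x, eˣ) < n`, `SchanuelRank r` for all
  `r < n`) has all coordinates in `expAcl = acl^{ℂ_exp}(∅)` (union of the FINITE `∅`-definable subsets
  of `(ℂ,+,·,−,0,1,exp)`; the sibling crux library's `expAcl`, verbatim the crux's `∃ s, …`).  No junk:
  the `exp` symbol is `Complex.exp` (`expRing_exp_apply`, rfl), `SchanuelRank` is the summit slice.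
* §1 `of_schanuel`, `antecedent_iff_not_schanuel`: the crux is IMPLIED BY Schanuel and its antecedent
  is satisfiable iff Schanuel FAILS — a refutation needs an explicit Schanuel counterexample (none is
  known), so the crux is irrefutable by present knowledge; everything below is load-bearing /
  tightness / strengthening analysis for the provers.
* §2 `schanuelRank_one`, `two_le_of_isFirstFailure`: ranks 0, 1 are theorems (Hermite–Lindemann, tree),
  so a first failure has `n ≥ 2`; `CruxRankTwo` is the first open case and needs no inductive input.
* §3 TIGHTNESS `IsFirstFailure.trdeg_eq`: at a first failure the defect is EXACTLY one,
  `trdeg ℚ(x, eˣ) = n − 1` (lower bound from `SchanuelRank (n-1)` on a sub-tuple).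
* §4 LOAD-BEARING hypotheses: `not_withoutTrdeg` (drop `trdeg < n`: FALSE by counting — `expAcl` is
  countable, `countable_expAcl`); `withoutLinIndep_mem` / `not_schanuel_of_withoutLinIndep` (drop linear
  independence: the statement then puts EVERY `c` with `trdeg ℚ(c,e^c) ≤ 2` … precisely: it refutes
  `SchanuelRank 2`, hence Schanuel — so the LI-free version is FALSE in the expected world while the crux
  is TRUE there); `withLe_mem_of_exp_algebraic` (`≤` for `<`: forces every logarithm of every algebraic
  number, all branches, into `acl(∅)` — decides Mycielski-type questions, not refutable);
  `withoutFirstFailure_defectLeOne` (§4b; drop `∀ r < n, SchanuelRank r`: the statement then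
  implies the open transcendence statement `DefectLeOne`, by padding with a generic coordinate).
* §5 `IsFirstFailure.mem_ecl`: Kirby 2010 Prop. 7.2 in first-failure form, PROVED from the tree's
  `kirby_relative_schanuel_complex_holds`: every coordinate of a first failure lies in `ecl ∅`; so the
  OPEN content of the crux is exactly `ecl ∅ ∋ x i ⟹ x i ∈ acl(∅)` (definable isolation).
* §6 TARGETS — the registered skeleton `Lines/span-growth-dichotomy.lean` (stubs `stub_matePredim`,
  `stub_spanGrowthStep`, `stub_locusDefectBounded`, `stub_finiteRankCase`, `stub_isolationFree`):
  every stub carries a Schanuel-contradicting hypothesis, hence is implied by Schanuel and NOT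
  refutable (`stubs_vacuous_of_schanuel`); what IS checkable: `finiteRankCase_false_without_firstFailure`
  (the finite-rank sparsity stub is FALSE for a general ℚ-linearly independent tuple: `x = (2πi)`,
  `n = 1`, has infinitely many locus mates `2πik`, all inside `span{2πi}` — the hypothesis `trdeg < n`
  of `IsFirstFailure` is load-bearing for Stub M and for `BranchFiniteness`), `self_mem_locusMates`,
  `locusMates_twoPiTuple` (the mates of `(2πi)` are exactly `(2πik)`, `k ≠ 0`).
* §7 BRIDGE to the skeleton's `GammaField.predim ⊥ (span x')`: `predim_bot_span_range`,
  `predim_le_neg_one_iff` (for LI `x'`: `δ(⟨x'⟩/0) ≤ −1 ↔ trdeg ℚ(x', e^{x'}) < n`, i.e. Stub T2's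
  hypotheses say "`x'` is a rank-`n` Schanuel counterexample" — `not_schanuelRank_of_predim_le_neg_one`),
  TIGHTNESS `IsFirstFailure.predim_eq` (`δ = −1` exactly) and `neg_one_le_predim_of_ranks_below`
  (no LI `n`-tuple has `δ < −1` at a first-failure rank: each mate pays exactly one unit).
* §8 **DEFINABLE ISOLATION IS FREE — Stub I (`stub_isolationFree`) PROVED** (`isolationFree`): if the
  locus mates of an LI `x` are finitely many then every `x i` lies in a finite `∅`-definable set
  (`definable_linearIndependent`: ℚ-linear independence is ONE `∅`-formula since `ℤ` is `∅`-definable,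
  KMO; `definable_locusCondition`: Hilbert basis + `definableFun_expPoly`; `definable_locusMates`;
  projection).  Hence `crux_of_firstFailureSparsity`: **(S*) follows from "a first failure has only
  finitely many locus mates"** — the open content of the crux is pure unlikely-intersection FINITENESS
  (Stubs D + M), with no model theory left in it; `cruxRankTwo_of_sparsity` at `n = 2`.
* §9 `uniformVersion_iff_schanuel`, `uniform_at_rank_iff`: the UNIFORM strengthening (one finite
  `∅`-definable set per rank catching all first failures of that rank) is EQUIVALENT to Schanuel —
  first failures come in infinite families `k • x` (`IsFirstFailure.zsmul`), so no uniformity in `x`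
  is available to a proof.
* §10 **RANK-2 ANATOMY** `cruxRankTwo_iff_sectors : CruxRankTwo ↔ LogSectorTwo ∧ ExpSectorTwo`: at the
  first open rank the crux splits into the LOG sector (both `e^{xᵢ}` algebraic: two algebraically
  DEPENDENT logarithms of algebraic numbers; mates finite by Baker — the route's B1 / Theorem L supports
  — hence closable now via `isolationFree`) and the EXP sector `ExpSectorTwo`: "a transcendental
  exponential of a rank-2 first failure is `∅`-algebraic" — the `x`'s then come for free
  (`mem_expAcl_of_transcendental_exp_mem`, via `expAcl_relAlgClosed`); dually
  `not_mem_expAcl_of_exp_not_mem`: a rank-2 refutation = a rank-2 Schanuel counterexample with a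
  transcendental exponential provably outside `acl^{ℂ_exp}(∅)`.
* §11 **`stub_mateFirstFailure` of the PICKED line PROVED** (also `StubsProved3.lean` in this directory,
  `Negative/MateTrdeg.lean` p73989): `mate_trdeg_lt'` (a mate of a counterexample tuple is a
  counterexample tuple — relations pull algebraic independence back, `algebraicIndependent_of_relations`),
  `mate_relations_symm` (the relation ideals of `(x,eˣ)` and `(x',e^{x'})` COINCIDE: prime ideals
  `P ⊆ P'` with quotients of equal trdeg `n − 1`; lifted independent sub-family + transported relation),
  `IsFirstFailure.of_mem_locusMates`, `locusMates_symm`, `locusMates_eq_of_mem` (the mate family of a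
  first failure is ONE locus class); `stub_matePredim_holds` / `matePredim_eq` (Stub T1 of
  `span-growth-dichotomy`, with equality).  Stubs 1–2 of the picked line = §8 (`StubsProved12.lean`);
  stub 6 `stub_endgame` is TRUE with a complete plan (`CDISPROVE-stub_endgame-plan.md`).
* §12 `IsFirstFailure.conj` (first failures come in conjugate pairs; `trdeg_adjoin_conj`), `crux_at_conj_iff`,
  and the `dcl` strengthening `WithDcl`: `withDcl_forces_real` (pointwise-definable first failures would
  all be REAL, since `dcl(∅) ⊆ ℝ`), `crux_of_withDcl`.
* §13 **`stub_endgame` of the PICKED line PROVED** (`stub_endgame_holds`, verbatim; every rank; only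
  `SchanuelRank m`, `m < n`): kernel frame, spreading map `ψ : ℚ[X,Y] → ℂ[T]` killing `rel x`, shifted
  variables + independent constants independent, pull-back count `n = r + m ≤ trdeg < n`.  Census of the
  picked line: stubs 1, 2, 3, 6 PROVED (here AND, independently and first, by the lead:
  `Theorems/RigidCoreMinimalCounterexampleInAcl{LinearIndependentDefinable,LocusDefinable,MateFirstFailure,Endgame}.lean`);
  residue = 4 `stub_branchFiniteness_rankTwo`
  (HL/Baker sector), 5 `stub_sweepToSubspace_higherRank` (AG structure lemma; needs the spreading
  inequality, cf. `CDISPROVE-stub_endgame-plan.md`), 7 `stub_expImageFinite_offLog` (= the crux's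
  arithmetic core; at `n = 2` it is `ExpSectorTwo` / SparsityTwo).

* §14 (gen 4) **KERNEL TRANSLATES ON THE LOCUS ARE FINITE ONCE `x` IS ALGEBRAIC OVER `ℚ[eˣ]`**
  (`translates_finite_of_isAlgebraic`, any rank, NO linear-independence / first-failure hypothesis:
  an algebraic dependence of `x i` over `ℚ[y]`, `y = eˣ`, is a ℚ-relation of `(x, y)` and pins every
  point of the frozen fibre `W_y` to finitely many `i`-th coordinates, `exists_polynomial_of_isAlgebraic_exp`).
  Hence **`stub_branchFiniteness_rankTwo` OFF THE LOG SECTOR IS PROVED** in the stronger LI-free form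
  (`branchFiniteness_rankTwo_offLog`, `stub_branchFiniteness_rankTwo_offLog` verbatim shape), and
  `stub4_iff_logSector : Stub4 ↔ Stub4Log` — the registered stub 4 IS its log-sector case (two
  algebraically dependent logarithms of algebraic numbers); in the independent case `(x₁, x₂, 2πi)`
  ℚ-LI that case is an INSTANCE of the route support `TwoLogsBranchRelationFinite` (stmt-0975, Baker)
  applied to the relation `F` of `x` (`stub4Log_indep_of_twoLogs`, `exists_relation_of_trdeg_lt_two`);
  residue of stub 4 = the degenerate sub-case `2πi ∈ span_ℚ(x₁, x₂)` (HL + Galois stability, drefute-g2 (b)).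
  At rank `n`: translates are finite whenever `trdeg ℚ(eˣ) = n − 1`; the sweep / structure lemma of
  stub 5 is needed exactly when `trdeg ℚ(eˣ) ≤ n − 2` (positive-dimensional frozen fibre).
* §15 (gen 4) INSTANCE AUDIT at rank 2: the classical candidate first failures satisfy the crux's
  CONCLUSION unconditionally — `(1, πi)` [a first failure iff `e ⊥̸ π`], `(πi, πα)` with `α ∈ ℚ̄`
  [iff `π ⊥̸ e^{πα}`], `(1, e)` [iff `e ⊥̸ e^e`] (`conclusion_at_one_piI`, `conclusion_at_piI_piMul`,
  `conclusion_at_one_e`; `I_mem_expAcl`, `mem_expAcl_of_isAlgebraic`), and generally every first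
  failure inside the log-free core `C_EAⁿ` (`conclusion_of_mem_logFreeCore`, = support 0972 in the
  sibling library).  So the famous open independence problems are NOT where (S*) can fail: its
  content sits at first failures with a coordinate in `ecl(∅) ∖ C_EA` (branches of `log α`, `log 2`,
  fixed points …).  Reformulation for planners: crux ∧ (A) ⟹ (S**) "first failures ⊂ C_EAⁿ"
  (`firstFailure_mem_logFreeCore_of_crux_and_A`) ⟹ crux (`crux_of_firstFailures_in_core`), and
  (S**) ∧ (R) ⟹ Schanuel with no (A) at all (`schanuel_of_firstFailures_in_core_of_R`).

* §16 (gen 4) **NO ANALYTIC ARC OF `𝒵_W` THROUGH A FIRST FAILURE — PROVED** (companion workfile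
  `DisproofNoArc.lean` in this directory — split off for the 200 kB cap; also proposed as
  `Negative/{ArcTaylorPoint,ArcFrame,NoAnalyticArc}.lean`): for a first failure `x`, germs `Γᵢ` analytic
  at `0` with `Γ(0) = x` (or a mate) along which every ℚ-relation of `(x, eˣ)` vanishes near `0` are
  CONSTANT — Ax 1971 Thm 3 in `(ℂ⸨X⸩, d/dX)` (tree `Ax1971.add_rank_le_trdeg_of_field`) on an integer
  frame adapted to the relation space of the arc, kernel comparison at the Taylor point, `SchanuelRank m`
  on `κ = q·x`, matroid count `r + 1 ≤ trdeg_ℂ ≤ r − 1` (`DisproofNoArc.firstFailure_no_analytic_arc`,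
  `…mate_no_analytic_arc_of_symm`, `…not_exists_nonconstant_arc`, `…line_not_in_locus`).  Superseded in
  strength by §17, independent in method.
* §17 (gen 4) **A FIRST FAILURE IS A NON-DEGENERATE KHOVANSKII POINT OF ITS OWN LOCUS ⟹ FIRST FAILURES
  AND ALL THEIR MATES ARE ISOLATED POINTS OF `𝒵_W`, EVERY RANK — PROVED** (`IsFirstFailure.khovanskii_point`:
  `∃ g₁..gₙ ∈ relIdeal x, det((∂/∂Xⱼ + Yⱼ∂/∂Yⱼ)gᵢ)(x,eˣ) ≠ 0`, via the tree's `khovanskii_dichotomy` in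
  `ℚ(x,eˣ)` — the alternative non-zero E-derivation is killed by `ax_schanuel_holds` WITH its rank term
  + `SchanuelRank m` + `trdeg_add_le_of_le_subring`: `n + 1 ≤ trdeg < n`; `IsFirstFailure.isolated`
  (inverse function theorem, tree `hasStrictFDerivAt_khovanskiiMap`): `∀ᶠ z in 𝓝[≠] x`, some relation of
  `x` fails at `(z, eᶻ)`; `IsFirstFailure.mate_isolated`, `IsFirstFailure.locusMates_discrete`
  (`locusMates x` is DISCRETE), `IsFirstFailure.not_linearIndependent_of_accumulation` (the
  non-isolated points of `𝒵_W` are ℚ-linearly DEPENDENT), `IsFirstFailure.tendsto_mates_limit_dependent`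
  (a convergent sequence of mates has a ℚ-dependent limit); development in sub-namespace `Khov`, also
  proposed as `Negative/{KhovanskiiPoint,FirstFailureIsolated}.lean`).  Kirby's Prop 7.2 read
  POINTWISE.  **Upshot for the provers: the crux's finiteness residue (stub 7 / `ExpSectorTwo` /
  SparsityTwo-on-first-failure-curves) has NO local content at generic points — mates can only escape to
  infinity or accumulate on the rational hyperplanes `{q·z = 0} ∩ 𝒵_W`.**  §17b sharpens this:
  `relations_symm_of_trdeg` / `IsFirstFailure.linearIndependent_of_trdeg` (points of `𝒵_W` with
  `trdeg ℚ(z,eᶻ) ≥ n − 1` are mates) ⟹ `IsFirstFailure.trdeg_lt_of_accumulation` (**accumulation points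
  of `𝒵_W` have defect ≥ 2**: `trdeg ℚ(z,eᶻ) < n − 1`) ⟹ at rank 2, by Hermite–Lindemann,
  `IsFirstFailure.accumulation_eq_zero_of_rank_two` / `…tendsto_mates_rank_two`: **the only possible
  finite accumulation point of the mates of a rank-2 first failure is the ORIGIN** — `ExpSectorTwo` ⟺
  (mates bounded in `ℂ²`) ∧ (no accumulation at `0`, void unless `(0;1,1) ∈ W`).

* §18 (gen 4) **RANK 2: `𝒵_W ⊆ Z(m₀) × Z(m₁)` IS CLOSED DISCRETE; BOUNDED SETS OF MATES ARE FINITE;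
  `locusMates x` FINITE ⟺ BOUNDED** (`RankTwo.exists_coord_expPoly`: each coordinate of every point of
  `𝒵_W` is a zero of a fixed non-zero exponential polynomial `mᵢ(e^s,s)`, `mᵢ ∈ ℚ[T,S]`, since
  `trdeg ℚ(xᵢ,e^{xᵢ}) ≤ 1`; `RankTwo.exists_rat_expPoly_ne_zero` (HL at a good rational point) +
  identity theorem ⟹ `RankTwo.expPoly_zeros_finite`; `RankTwo.locusPts_bounded_finite` (needs only
  `trdeg < 2` — no LI, no `SchanuelRank`); `IsFirstFailure.locusMates_bounded_finite`,
  `IsFirstFailure.locusMates_finite_iff_bounded`, `cruxRankTwo_of_bounded`,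
  `IsFirstFailure.exists_large_mate_of_infinite`; and at ANY rank for E-SPECIAL tuples — every `xᵢ`
  algebraically dependent with `e^{xᵢ}`, e.g. the log sector — `RankTwo.locusPts_bounded_finite_of_special`).
  **So at the first open rank the whole residue of the
  crux (`ExpSectorTwo` / stub 7 / SparsityTwo on first-failure curves) is ONE statement: the mates
  `(s₀,s₁) ∈ Z(m₀) × Z(m₁)` of a rank-2 first failure are BOUNDED in `ℂ²`** — an escape-to-infinity
  question about common zeros of exponential polynomials (Pólya–Dickson asymptotics of `Z(mᵢ)` along
  finitely many logarithmic strips is the natural next input for ideators).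

* §19 (gen 4) **GROWTH: THE ESCAPE IS VERTICAL** (companion workfile `DisproofRankTwo.lean`, rc 0, 0 sorry;
  it also carries the §18 development): for a non-zero `m ∈ ℚ[T,S]`, large zeros `s` of `m(e^s,s)` satisfy
  `max(‖e^s‖, ‖e^{−s}‖) ≤ max 1 (C(1+‖s‖)^D)` (Cauchy bound + leading/trailing coefficient dominance,
  Pólya), hence `|Re s| = O(log ‖s‖)` and zeros with `|Im s| ≤ T` are bounded
  (`DisproofRankTwo.norm_exp_le_of_expPoly_eq_zero`, `…norm_exp_neg_le…`, `…abs_re_le…`,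
  `…norm_lt_of_expPoly_eq_zero_of_im_le`).  For the crux at rank 2: `locusPts_finite_of_im_bounded` —
  **locus points with bounded imaginary parts are FINITE; infinitely many mates of a rank-2 first failure
  force VERTICAL ESCAPE `|Im x'ᵢ| → ∞` with `|Re x'ᵢ| = O(log|x'ᵢ|)` and `‖e^{±x'ᵢ}‖` polynomially
  bounded (`exp_coord_polynomially_bounded`)** — kernel translates `x + 2πik` are the prototype (stubs
  4–5, the lead); the residue of stub 7 at rank 2 is NON-TRANSLATE VERTICAL ESCAPE.

History: gen 1 (v1–v4) and gen 2 (v5–v11, 1650 lines: countable version TRUE, uniform version ⇔ SC,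
`crux_of_realsDefinable`, `ecl_subset_expAcl_iff_khovanskiiIsolation`, quasiminimality closes the
ℝ-route) exist only as item evidence files that are not mounted in later jails; this gen-3 file
re-proves the load-bearing core and is the first PUBLISHED copy (`Cruxes/…/Disproof.lean`).
-/

noncomputable section

set_option linter.dupNamespace false

open Complex Set
open FirstOrder FirstOrder.Language
open Literature.NumberTheory.Transcendental
open Literature.ModelTheory.ExponentialFields
open Summit.Schanuel.Schanuel.Theorems.AclSubsetLogFreeCore.Negative

namespace Summit.Schanuel.Schanuel.Cruxes.MinimalCounterexampleInAcl.Disproof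

/-! ## §0 Vocabulary and read-back -/

/-- First-failure counterexample at rank `n` — the crux's hypothesis bundle (verbatim the skeleton's
`SpanGrowthDichotomy.IsFirstFailure` / `Sketch.IsFirstFailure`, so lines agree by `Iff.rfl`). -/
def IsFirstFailure {n : ℕ} (x : Fin n → ℂ) : Prop :=
  LinearIndependent ℚ x ∧
  Algebra.trdeg ℚ ↥(IntermediateField.adjoin ℚ (range x ∪ range (cexp ∘ x))) < (n : Cardinal) ∧
  ∀ r < n, SchanuelRank r

/-- The ℚ-locus mates of `x` (verbatim the skeleton's `locusMates`). -/
def locusMates {n : ℕ} (x : Fin n → ℂ) : Set (Fin n → ℂ) :=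
  {x' | LinearIndependent ℚ x' ∧
    ∀ p : MvPolynomial (Fin n ⊕ Fin n) ℚ,
      MvPolynomial.aeval (Sum.elim x (cexp ∘ x)) p = 0 →
      MvPolynomial.aeval (Sum.elim x' (cexp ∘ x')) p = 0}

/-- READ-BACK: the crux is "every coordinate of a first failure lies in `expAcl = acl^{ℂ_exp}(∅)`". -/
theorem crux_iff :
    Summit.Schanuel.Schanuel.Theses.RigidCore.MinimalCounterexampleInAcl ↔
      ∀ (n : ℕ) (x : Fin n → ℂ), IsFirstFailure x → ∀ i, x i ∈ expAcl := by
  constructor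
  · intro h n x hx i
    exact h n x hx.1 hx.2.1 hx.2.2 i
  · intro h n x hli htr hrank i
    exact h n x ⟨hli, htr, hrank⟩ i

/-- The summit statement is the conjunction of its rank slices (by `Iff.rfl`). -/
theorem schanuel_iff_forall_rank : _root_.Schanuel ↔ ∀ n, SchanuelRank n := Iff.rfl

/-! ## §1 The crux is implied by Schanuel; its antecedent is satisfiable iff Schanuel fails -/

/-- A first failure at rank `n` violates `SchanuelRank n`. -/
theorem IsFirstFailure.not_schanuelRank {n : ℕ} {x : Fin n → ℂ} (hx : IsFirstFailure x) :
    ¬ SchanuelRank n := fun h => (not_le.2 hx.2.1) (h x hx.1)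

/-- A first failure refutes Schanuel. -/
theorem IsFirstFailure.not_schanuel {n : ℕ} {x : Fin n → ℂ} (hx : IsFirstFailure x) :
    ¬ _root_.Schanuel := fun h => hx.not_schanuelRank (h n)

/-- The crux is IMPLIED BY Schanuel's conjecture (its antecedent is then empty). -/
theorem of_schanuel (h : _root_.Schanuel) :
    Summit.Schanuel.Schanuel.Theses.RigidCore.MinimalCounterexampleInAcl :=
  crux_iff.2 fun _ _ hx _ => (hx.not_schanuel h).elim

/-- Conversely a failure of Schanuel produces a FIRST failure (least failing rank). -/
theorem exists_isFirstFailure_of_not_schanuel (h : ¬ _root_.Schanuel) :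
    ∃ (n : ℕ) (x : Fin n → ℂ), IsFirstFailure x := by
  classical
  rw [schanuel_iff_forall_rank] at h
  push Not at h
  let n := Nat.find h
  have hn : ¬ SchanuelRank n := Nat.find_spec h
  have hmin : ∀ r < n, SchanuelRank r := fun r hr => by
    by_contra hr'
    exact Nat.find_min h hr hr'
  simp only [SchanuelRank, not_forall, not_le] at hn
  obtain ⟨x, hli, hlt⟩ := hn
  exact ⟨n, x, hli, hlt, hmin⟩

/-- The crux's antecedent is satisfiable iff Schanuel's conjecture is false: a refutation of the
crux needs an explicit counterexample to Schanuel (none is known). -/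
theorem antecedent_iff_not_schanuel :
    (∃ (n : ℕ) (x : Fin n → ℂ), IsFirstFailure x) ↔ ¬ _root_.Schanuel :=
  ⟨fun ⟨_, _, hx⟩ => hx.not_schanuel, exists_isFirstFailure_of_not_schanuel⟩

/-- Hence `¬ crux → ¬ Schanuel`: a disproof of the crux is at least as hard as disproving Schanuel. -/
theorem not_schanuel_of_not_crux
    (h : ¬ Summit.Schanuel.Schanuel.Theses.RigidCore.MinimalCounterexampleInAcl) :
    ¬ _root_.Schanuel := fun hS => h (of_schanuel hS)

/-! ## §2 Small ranks -/

/-- `SchanuelRank 1` is a theorem (Hermite–Lindemann, tree `transcendental_exp_holds`). -/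
theorem schanuelRank_one : SchanuelRank 1 :=
  Literature.Transcend.schanuelRank_one_of_transcendental_exp transcendental_exp_holds

/-- A first failure has rank `n ≥ 2` (rank 0: `trdeg < 0` impossible; rank 1: Hermite–Lindemann). -/
theorem two_le_of_isFirstFailure {n : ℕ} {x : Fin n → ℂ} (hx : IsFirstFailure x) : 2 ≤ n := by
  rcases Nat.lt_or_ge n 2 with h | h
  · interval_cases n
    · have h0 := hx.2.1
      simp at h0
    · exact (hx.not_schanuelRank schanuelRank_one).elim
  · exact h

/-- The first open case: the crux at rank 2 needs no inductive hypothesis (ranks 0, 1 are theorems). -/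
def CruxRankTwo : Prop :=
  ∀ x : Fin 2 → ℂ, LinearIndependent ℚ x →
    Algebra.trdeg ℚ ↥(IntermediateField.adjoin ℚ (range x ∪ range (cexp ∘ x))) < (2 : Cardinal) →
      ∀ i, x i ∈ expAcl

/-- `IsFirstFailure` at rank 2 is just "ℚ-linearly independent pair with `trdeg < 2`". -/
theorem isFirstFailure_two_iff (x : Fin 2 → ℂ) :
    IsFirstFailure x ↔ LinearIndependent ℚ x ∧
      Algebra.trdeg ℚ ↥(IntermediateField.adjoin ℚ (range x ∪ range (cexp ∘ x))) < (2 : Cardinal) := by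
  refine ⟨fun h => ⟨h.1, by exact_mod_cast h.2.1⟩, fun h => ⟨h.1, by exact_mod_cast h.2, ?_⟩⟩
  intro r hr
  interval_cases r
  · exact schanuelRank_zero
  · exact schanuelRank_one

/-- The crux restricted to rank 2 is `CruxRankTwo`. -/
theorem crux_rankTwo (h : Summit.Schanuel.Schanuel.Theses.RigidCore.MinimalCounterexampleInAcl) :
    CruxRankTwo := fun x hli htr i =>
  crux_iff.1 h 2 x ((isFirstFailure_two_iff x).2 ⟨hli, htr⟩) i

/-! ## §3 Tightness: the defect at a first failure is exactly one -/

/-- `trdeg ℚ(S) ≤ trdeg ℚ(T)` for `S ⊆ T`. [folklore] -/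
theorem trdeg_adjoin_mono {S T : Set ℂ} (h : S ⊆ T) :
    Algebra.trdeg ℚ ↥(IntermediateField.adjoin ℚ S) ≤ Algebra.trdeg ℚ ↥(IntermediateField.adjoin ℚ T) :=
  Literature.Barriers.Schanuel.trdeg_mono (IntermediateField.adjoin.mono ℚ _ _ h)

/-- Restricting a tuple along an injection keeps `range x ∪ range (exp ∘ x)` inside the original. -/
theorem range_union_subset_of_comp {n m : ℕ} (x : Fin n → ℂ) (e : Fin m → Fin n) :
    range (x ∘ e) ∪ range (cexp ∘ (x ∘ e)) ⊆ range x ∪ range (cexp ∘ x) := by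
  rintro a (⟨i, rfl⟩ | ⟨i, rfl⟩)
  · exact Or.inl ⟨e i, rfl⟩
  · exact Or.inr ⟨e i, rfl⟩

/-- LOWER BOUND from the ranks below: an LI `n`-tuple with `SchanuelRank r` for all `r < n` has
`trdeg ℚ(x, eˣ) ≥ n − 1` (apply `SchanuelRank (n-1)` to the first `n − 1` coordinates). -/
theorem pred_le_trdeg_of_ranks_below {n : ℕ} {x : Fin n → ℂ} (hli : LinearIndependent ℚ x)
    (hrank : ∀ r < n, SchanuelRank r) :
    ((n - 1 : ℕ) : Cardinal) ≤
      Algebra.trdeg ℚ ↥(IntermediateField.adjoin ℚ (range x ∪ range (cexp ∘ x))) := by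
  rcases Nat.eq_zero_or_pos n with rfl | hn
  · simp
  · have hr : SchanuelRank (n - 1) := hrank _ (Nat.sub_lt hn one_pos)
    let e : Fin (n - 1) → Fin n := Fin.castLE (Nat.sub_le n 1)
    have hli' : LinearIndependent ℚ (x ∘ e) := hli.comp e (Fin.castLE_injective _)
    exact (hr (x ∘ e) hli').trans (trdeg_adjoin_mono (range_union_subset_of_comp x e))

/-- TIGHTNESS: at a first failure the transcendence degree is EXACTLY `n − 1` (defect one). -/
theorem IsFirstFailure.trdeg_eq {n : ℕ} {x : Fin n → ℂ} (hx : IsFirstFailure x) :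
    Algebra.trdeg ℚ ↥(IntermediateField.adjoin ℚ (range x ∪ range (cexp ∘ x))) = ((n - 1 : ℕ) : Cardinal) := by
  refine le_antisymm ?_ (pred_le_trdeg_of_ranks_below hx.1 hx.2.2)
  have h2 := two_le_of_isFirstFailure hx
  have hlt := hx.2.1
  obtain ⟨m, rfl⟩ : ∃ m, n = m + 1 := ⟨n - 1, by omega⟩
  simp only [Nat.add_sub_cancel]
  obtain ⟨k, hk⟩ := Cardinal.lt_aleph0.1 (hlt.trans (Cardinal.natCast_lt_aleph0))
  rw [hk] at hlt ⊢
  have hkm : k < m + 1 := by exact_mod_cast hlt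
  exact_mod_cast Nat.lt_succ_iff.1 hkm

/-! ## §4 Load-bearing hypotheses -/

/-- The crux with the hypothesis `trdeg < n` DROPPED. -/
def WithoutTrdeg : Prop :=
  ∀ (n : ℕ) (x : Fin n → ℂ), LinearIndependent ℚ x → (∀ r < n, SchanuelRank r) →
    ∀ i, ∃ s : Set ℂ, s.Finite ∧ Set.Definable₁ (∅ : Set ℂ) Language.expRing s ∧ x i ∈ s

/-- The crux with LINEAR INDEPENDENCE dropped. -/
def WithoutLinIndep : Prop :=
  ∀ (n : ℕ) (x : Fin n → ℂ),
    Algebra.trdeg ℚ ↥(IntermediateField.adjoin ℚ (range x ∪ range (cexp ∘ x))) < (n : Cardinal) →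
    (∀ r < n, SchanuelRank r) →
    ∀ i, ∃ s : Set ℂ, s.Finite ∧ Set.Definable₁ (∅ : Set ℂ) Language.expRing s ∧ x i ∈ s

/-- The crux with `≤` in place of `<` (defect-zero tuples included). -/
def WithLe : Prop :=
  ∀ (n : ℕ) (x : Fin n → ℂ), LinearIndependent ℚ x →
    Algebra.trdeg ℚ ↥(IntermediateField.adjoin ℚ (range x ∪ range (cexp ∘ x))) ≤ (n : Cardinal) →
    (∀ r < n, SchanuelRank r) →
    ∀ i, ∃ s : Set ℂ, s.Finite ∧ Set.Definable₁ (∅ : Set ℂ) Language.expRing s ∧ x i ∈ s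

/-- The crux with the FIRST-FAILURE hypothesis `∀ r < n, SchanuelRank r` dropped (every counterexample,
not only first failures, would have coordinates in `acl(∅)`). -/
def WithoutFirstFailure : Prop :=
  ∀ (n : ℕ) (x : Fin n → ℂ), LinearIndependent ℚ x →
    Algebra.trdeg ℚ ↥(IntermediateField.adjoin ℚ (range x ∪ range (cexp ∘ x))) < (n : Cardinal) →
    ∀ i, ∃ s : Set ℂ, s.Finite ∧ Set.Definable₁ (∅ : Set ℂ) Language.expRing s ∧ x i ∈ s

/-- `expAcl ∪ {0}` (indeed any countable set) misses some complex number. -/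
theorem exists_not_mem_of_countable {s : Set ℂ} (hs : s.Countable) : ∃ c : ℂ, c ∉ s := by
  by_contra h
  push Not at h
  exact not_countable_univ_complex (hs.mono fun c _ => h c)

/-- A constant nonzero `1`-tuple is ℚ-linearly independent. -/
theorem linearIndependent_fin_one {c : ℂ} (hc : c ≠ 0) : LinearIndependent ℚ (fun _ : Fin 1 => c) :=
  linearIndependent_unique_iff (v := fun _ : Fin 1 => c) |>.2 hc

/-- **`trdeg < n` is load-bearing**: without it the statement is FALSE (counting: `n = 1`, `x = (c)` with
`c ∉ expAcl ∪ {0}` — `expAcl` is countable, `ℂ` is not; `SchanuelRank 0` is trivial). -/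
theorem not_withoutTrdeg : ¬ WithoutTrdeg := by
  intro h
  obtain ⟨c, hc⟩ := exists_not_mem_of_countable (countable_expAcl.insert 0)
  simp only [mem_insert_iff, not_or] at hc
  have hrank : ∀ r < 1, SchanuelRank r := fun r hr => by
    interval_cases r; exact schanuelRank_zero
  exact hc.2 (h 1 (fun _ => c) (linearIndependent_fin_one hc.1) hrank 0)

/-- `trdeg ℚ(c, e^c) ≤ 2` for every `c` (two generators). -/
theorem trdeg_pair_le_two (c : ℂ) :
    Algebra.trdeg ℚ ↥(IntermediateField.adjoin ℚ ({c} ∪ {cexp c} : Set ℂ)) ≤ (2 : Cardinal) := by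
  refine (trdeg_adjoin_le_mk _).trans ?_
  refine (Cardinal.mk_union_le _ _).trans ?_
  simp only [Cardinal.mk_fintype, Fintype.card_unique, Nat.cast_one]
  norm_num

/-- The range data of a constant tuple. -/
theorem range_const_union {n : ℕ} [NeZero n] (c : ℂ) :
    range (fun _ : Fin n => c) ∪ range (cexp ∘ fun _ : Fin n => c) = ({c} ∪ {cexp c} : Set ℂ) := by
  ext a
  simp only [mem_union, mem_range, Function.comp_apply, exists_const, mem_singleton_iff]
  constructor
  · rintro (rfl | rfl) <;> simp
  · rintro (rfl | rfl) <;> simp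

/-- **Linear independence is load-bearing, I**: WITHOUT it, the constant triple `(c, c, c)` has
`trdeg ℚ(c, e^c) ≤ 2 < 3`, so — granted `SchanuelRank 2` — EVERY complex number would lie in the
countable set `expAcl`: the LI-free version contradicts `SchanuelRank 2`. -/
theorem not_schanuelRank_two_of_withoutLinIndep (h : WithoutLinIndep) : ¬ SchanuelRank 2 := by
  intro h2
  obtain ⟨c, hc⟩ := exists_not_mem_of_countable countable_expAcl
  have hrank : ∀ r < 3, SchanuelRank r := fun r hr => by
    interval_cases r
    · exact schanuelRank_zero
    · exact schanuelRank_one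
    · exact h2
  have htr : Algebra.trdeg ℚ ↥(IntermediateField.adjoin ℚ
      (range (fun _ : Fin 3 => c) ∪ range (cexp ∘ fun _ : Fin 3 => c))) < (3 : Cardinal) := by
    rw [range_const_union]
    exact (trdeg_pair_le_two c).trans_lt (by norm_num)
  exact hc (h 3 (fun _ => c) (by exact_mod_cast htr) hrank 0)

/-- **Linear independence is load-bearing, II** (unconditional form): the LI-free version REFUTES
Schanuel's conjecture — whereas the crux itself is implied by it (`of_schanuel`). -/
theorem not_schanuel_of_withoutLinIndep (h : WithoutLinIndep) : ¬ _root_.Schanuel :=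
  fun hS => not_schanuelRank_two_of_withoutLinIndep h (hS 2)

/-- `trdeg ℚ(c, e^c) ≤ 1` when `e^c` is algebraic. -/
theorem trdeg_pair_le_one_of_exp_algebraic {c : ℂ} (hc : IsAlgebraic ℚ (cexp c)) :
    Algebra.trdeg ℚ ↥(IntermediateField.adjoin ℚ ({c} ∪ {cexp c} : Set ℂ)) ≤ (1 : Cardinal) := by
  refine (trdeg_adjoin_union_le (K := ℚ) ({c} : Set ℂ) {cexp c}).trans ?_
  have h1 : Algebra.trdeg ℚ ↥(IntermediateField.adjoin ℚ ({c} : Set ℂ)) ≤ 1 := by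
    have h := trdeg_adjoin_le_mk (F := ℚ) ({c} : Set ℂ)
    rwa [Cardinal.mk_singleton] at h
  have h0 : Algebra.trdeg ℚ ↥(IntermediateField.adjoin ℚ ({cexp c} : Set ℂ)) = 0 := by
    haveI : Algebra.IsAlgebraic ℚ ↥(IntermediateField.adjoin ℚ ({cexp c} : Set ℂ)) :=
      IntermediateField.isAlgebraic_adjoin_simple hc.isIntegral
    exact trdeg_eq_zero
  calc Algebra.trdeg ℚ ↥(IntermediateField.adjoin ℚ ({c} : Set ℂ)) +
        Algebra.trdeg ℚ ↥(IntermediateField.adjoin ℚ ({cexp c} : Set ℂ))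
        = Algebra.trdeg ℚ ↥(IntermediateField.adjoin ℚ ({c} : Set ℂ)) + 0 := by rw [h0]
    _ ≤ 1 := by rw [add_zero]; exact h1

/-- **`<` versus `≤`**: with `≤`, EVERY logarithm of EVERY nonzero algebraic number — all branches,
e.g. `log 2 + 2πik`, `iπ(2k+1)` — would lie in `acl^{ℂ_exp}(∅)` (rank 1: `x = (c)`, `e^c ∈ ℚ̄`,
`trdeg ℚ(c, e^c) ≤ 1`). Not refutable (no complex number is provably outside `acl(∅)`), but it
decides Mycielski-type questions the crux deliberately avoids; the strict `<` is what keeps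
defect-zero tuples out. -/
theorem withLe_mem_of_exp_algebraic (h : WithLe) {c : ℂ} (hc0 : c ≠ 0) (hc : IsAlgebraic ℚ (cexp c)) :
    c ∈ expAcl := by
  haveI : NeZero (1 : ℕ) := ⟨one_ne_zero⟩
  have hrank : ∀ r < 1, SchanuelRank r := fun r hr => by
    interval_cases r; exact schanuelRank_zero
  have htr : Algebra.trdeg ℚ ↥(IntermediateField.adjoin ℚ
      (range (fun _ : Fin 1 => c) ∪ range (cexp ∘ fun _ : Fin 1 => c))) ≤ (1 : Cardinal) := by
    rw [range_const_union]
    exact trdeg_pair_le_one_of_exp_algebraic hc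
  exact h 1 (fun _ => c) (linearIndependent_fin_one hc0) (by exact_mod_cast htr) hrank 0

/-- In particular `WithLe` puts every branch `log 2 + 2πik` of `log 2` into `acl(∅)`. -/
theorem withLe_log_two_branch_mem (h : WithLe) (k : ℤ) :
    (Real.log 2 : ℂ) + 2 * Real.pi * I * k ∈ expAcl := by
  have h1 : cexp (2 * ↑Real.pi * I * ↑k) = 1 := by
    rw [show (2 * ↑Real.pi * I * ↑k : ℂ) = k * (2 * Real.pi * I) by ring]
    exact Complex.exp_int_mul_two_pi_mul_I k
  have hexp : cexp ((Real.log 2 : ℂ) + 2 * Real.pi * I * k) = 2 := by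
    rw [Complex.exp_add, exp_log_two, h1, mul_one]
  refine withLe_mem_of_exp_algebraic h ?_ ?_
  · intro h0
    rw [h0, Complex.exp_zero] at hexp
    norm_num at hexp
  · rw [hexp]
    exact_mod_cast isAlgebraic_nat (R := ℚ) (A := ℂ) 2

/-- The crux itself is `WithoutFirstFailure` restricted to first failures; conversely the crux gives
`WithoutFirstFailure` only at the least failing rank.  `WithoutFirstFailure` is still implied by
Schanuel (vacuous), hence irrefutable; but it is STRONGER than the crux in the `¬SC` world: -/
theorem withoutFirstFailure_of_schanuel (hS : _root_.Schanuel) : WithoutFirstFailure :=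
  fun n x hli htr _ => ((not_le.2 htr) (hS n x hli)).elim


/-! ## §5 Kirby's Prop. 7.2 in first-failure form: first failures live in `ecl ∅` -/

open Submodule IntermediateField in
/-- **First failures lie in `ecl(∅)`** (Kirby 2010, Prop. 7.2, first-failure form), PROVED from the
tree's relative Schanuel theorem over `ecl ∅` (`kirby_relative_schanuel_complex_holds`, Ax's theorem)
and the ranks below `n`.  Argument (Kirby p. 11, as architected in `SchanuelEclEmptyProofs`): with
`E = ecl ∅`, `V = ⟨x⟩_ℚ`, `W = V ∩ E` (dim `k`), `U` a complement (dim `m`, `k + m = n`): if some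
`x i ∉ E` then `k < n`, so `SchanuelRank k` gives `k ≤ trdeg ℚ(ȳ, e^ȳ)` for a (denominator-cleared)
basis `ȳ` of `W`, Kirby gives `m ≤ trdeg_{ℚ(E)} ℚ(E)(z̄, e^z̄) ≤ trdeg_{ℚ(ȳ,e^ȳ)}(… z̄, e^z̄)` for a
basis `z̄` of `U`, and the tower law yields `n ≤ trdeg ℚ(x, eˣ)`, contradicting `trdeg < n`.
So the OPEN content of the crux is exactly `x i ∈ ecl ∅ ⟹ x i ∈ acl^{ℂ_exp}(∅)`. -/
theorem IsFirstFailure.mem_ecl {n : ℕ} {x : Fin n → ℂ} (hxff : IsFirstFailure x) (i₀ : Fin n) :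
    x i₀ ∈ ecl (∅ : Set ℂ) := by
  by_contra hi₀
  have hx := hxff.1
  have hrel := kirby_relative_schanuel_complex_holds
  obtain ⟨⟨SE, hSE⟩, hexp⟩ := Kirby2010_ecl_isExpSubfield_holds ℂ ∅
  -- `E = ecl ∅` as a `ℚ`-subspace of `ℂ`
  let Eq : Submodule ℚ ℂ :=
    { carrier := ecl (∅ : Set ℂ)
      add_mem' := fun {a b} ha hb => by
        rw [← hSE] at ha hb ⊢; exact SE.add_mem ha hb
      zero_mem' := by rw [← hSE]; exact SE.zero_mem
      smul_mem' := fun q {a} ha => by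
        rw [← hSE] at ha ⊢
        rw [Rat.smul_def]
        exact SE.mul_mem (SubfieldClass.ratCast_mem SE q) ha }
  have hEq : (Eq : Set ℂ) = ecl (∅ : Set ℂ) := rfl
  have hspanE : span ℚ (ecl (∅ : Set ℂ)) = Eq := by rw [← hEq, span_eq]
  -- the `ℚ`-span `V` of `x̄`, `W = V ∩ E` and a complement `U` of `W` in `V`
  set V : Submodule ℚ ℂ := span ℚ (Set.range x) with hV
  haveI : FiniteDimensional ℚ V := FiniteDimensional.span_of_finite ℚ (Set.finite_range x)
  set W : Submodule ℚ ℂ := V ⊓ Eq with hW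
  obtain ⟨U', hU'⟩ := W.exists_isCompl
  set U : Submodule ℚ ℂ := V ⊓ U' with hU
  haveI : FiniteDimensional ℚ W := Submodule.finiteDimensional_of_le inf_le_left
  haveI : FiniteDimensional ℚ U := Submodule.finiteDimensional_of_le inf_le_left
  have hWU_sup : W ⊔ U = V := by
    rw [hU, inf_comm, ← sup_inf_assoc_of_le U' (inf_le_left : W ≤ V), hU'.sup_eq_top, top_inf_eq]
  have hWU_disj : Disjoint W U := hU'.disjoint.mono_right inf_le_right
  have hUE_disj : Disjoint U Eq := by
    rw [disjoint_def]
    intro a haU haE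
    exact (disjoint_def.mp hWU_disj) a ⟨inf_le_left (b := U') haU, haE⟩ haU
  -- dimensions
  set k := Module.finrank ℚ W
  set m := Module.finrank ℚ U
  have hVn : Module.finrank ℚ V = n := by rw [hV, finrank_span_eq_card hx, Fintype.card_fin]
  have hn : k + m = n := by
    have h1 := Submodule.finrank_sup_add_finrank_inf_eq W U
    rw [hWU_disj.eq_bot, finrank_bot, add_zero, hWU_sup] at h1
    rw [← h1, hVn]
  -- FIRST-FAILURE INPUT: `x i₀ ∉ E` forces `W < V`, hence `k < n`, hence `SchanuelRank k`
  have hklt : k < n := by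
    have hWV : W < V := by
      refine lt_of_le_of_ne inf_le_left fun hWV => hi₀ ?_
      have hxV : x i₀ ∈ V := subset_span ⟨i₀, rfl⟩
      rw [← hWV] at hxV
      exact hxV.2
    simpa [hVn] using Submodule.finrank_lt_finrank_of_lt hWV
  have hSRk : SchanuelRank k := hxff.2.2 k hklt
  -- bases
  let bW := Module.finBasis ℚ W
  let bU := Module.finBasis ℚ U
  let y : Fin k → ℂ := fun i => (bW i : ℂ)
  let z : Fin m → ℂ := fun j => (bU j : ℂ)
  have hy_mem : ∀ i, y i ∈ ecl (∅ : Set ℂ) := fun i => ((bW i).2 : (bW i : ℂ) ∈ V ⊓ Eq).2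
  have hy_V : ∀ i, y i ∈ V := fun i => ((bW i).2 : (bW i : ℂ) ∈ V ⊓ Eq).1
  have hz_U : ∀ j, z j ∈ U := fun j => (bU j).2
  have hz_V : ∀ j, z j ∈ V := fun j => inf_le_left (b := U') (hz_U j)
  have hy_li : LinearIndependent ℚ y := bW.linearIndependent.map' W.subtype W.ker_subtype
  have hz_li : LinearIndependent ℚ z := bU.linearIndependent.map' U.subtype U.ker_subtype
  -- clearing denominators
  choose Ny hNy hNy_mem using fun i => exists_nsmul_mem_span_int x (hy_V i)
  choose Nz hNz hNz_mem using fun j => exists_nsmul_mem_span_int x (hz_V j)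
  let cy : Fin k → ℚˣ := fun i => Units.mk0 (Ny i : ℚ) (Nat.cast_ne_zero.mpr (hNy i))
  let cz : Fin m → ℚˣ := fun j => Units.mk0 (Nz j : ℚ) (Nat.cast_ne_zero.mpr (hNz j))
  let y' : Fin k → ℂ := fun i => (Ny i : ℚ) • y i
  let z' : Fin m → ℂ := fun j => (Nz j : ℚ) • z j
  have hy'_eq : cy • y = y' := by
    funext i; simp only [Pi.smul_apply', cy, y', Units.smul_def, Units.val_mk0]
  have hz'_eq : cz • z = z' := by
    funext j; simp only [Pi.smul_apply', cz, z', Units.smul_def, Units.val_mk0]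
  have hy'_li : LinearIndependent ℚ y' := hy'_eq ▸ hy_li.units_smul cy
  have hz'_li : LinearIndependent ℚ z' := hz'_eq ▸ hz_li.units_smul cz
  have hy'_mem : ∀ i, y' i ∈ ecl (∅ : Set ℂ) := fun i => Eq.smul_mem _ (hy_mem i)
  have hz'_U : ∀ j, z' j ∈ U := fun j => U.smul_mem _ (hz_U j)
  have hz'_modE : LinearIndependent ℚ ((span ℚ (ecl (∅ : Set ℂ))).mkQ ∘ z') := by
    refine hz'_li.map ?_
    rw [ker_mkQ, hspanE]
    exact hUE_disj.mono_left (span_le.mpr (Set.range_subset_iff.mpr hz'_U))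
  -- the field-theoretic estimate
  set Sy := Set.range y' ∪ Set.range (Complex.exp ∘ y') with hSy
  set Sz := Set.range z' ∪ Set.range (Complex.exp ∘ z') with hSz
  set Ky := adjoin ℚ Sy with hKy
  set L := adjoin ℚ (ecl (∅ : Set ℂ)) with hL
  have hk : (k : Cardinal) ≤ Algebra.trdeg ℚ Ky := hSRk y' hy'_li
  have hm₀ : (m : Cardinal) ≤ Algebra.trdeg L (adjoin L Sz) := hrel m z' hz'_modE
  have hKyL : Ky ≤ L := by
    rw [hKy, adjoin_le_iff]
    rintro a (⟨i, rfl⟩ | ⟨i, rfl⟩)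
    · exact subset_adjoin ℚ _ (hy'_mem i)
    · exact subset_adjoin ℚ _ (hexp _ (hy'_mem i))
  have hm : (m : Cardinal) ≤ Algebra.trdeg Ky (adjoin Ky Sz) :=
    hm₀.trans (trdeg_adjoin_le_of_le hKyL Sz)
  have hkm : (k : Cardinal) + m ≤ Algebra.trdeg ℚ (adjoin ℚ (Sy ∪ Sz)) :=
    add_le_trdeg_adjoin_union Sy Sz hk hm
  -- comparison with `ℚ(x̄, e^{x̄})`
  set Kx := adjoin ℚ (Set.range x ∪ Set.range (Complex.exp ∘ x)) with hKx
  have hle : adjoin ℚ (Sy ∪ Sz) ≤ Kx := by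
    rw [adjoin_le_iff]
    rintro a ((⟨i, rfl⟩ | ⟨i, rfl⟩) | (⟨j, rfl⟩ | ⟨j, rfl⟩))
    · exact (mem_adjoin_of_mem_span_int x (hNy_mem i)).1
    · exact (mem_adjoin_of_mem_span_int x (hNy_mem i)).2
    · exact (mem_adjoin_of_mem_span_int x (hNz_mem j)).1
    · exact (mem_adjoin_of_mem_span_int x (hNz_mem j)).2
  have hfin : Algebra.trdeg ℚ (adjoin ℚ (Sy ∪ Sz)) ≤ Algebra.trdeg ℚ Kx :=
    trdeg_le_of_injective (IntermediateField.inclusion hle) (IntermediateField.inclusion_injective hle)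
  have hnle : (n : Cardinal) ≤ Algebra.trdeg ℚ Kx :=
    calc (n : Cardinal) = (k : Cardinal) + m := by rw [← hn, Nat.cast_add]
      _ ≤ Algebra.trdeg ℚ (adjoin ℚ (Sy ∪ Sz)) := hkm
      _ ≤ Algebra.trdeg ℚ Kx := hfin
  exact (not_le.2 hxff.2.1) hnle

/-- Hence the crux is EQUIVALENT to its restriction to first failures inside `ecl(∅)ⁿ`. -/
theorem crux_iff_eclVersion :
    Summit.Schanuel.Schanuel.Theses.RigidCore.MinimalCounterexampleInAcl ↔
      ∀ (n : ℕ) (x : Fin n → ℂ), IsFirstFailure x → (∀ i, x i ∈ ecl (∅ : Set ℂ)) →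
        ∀ i, x i ∈ expAcl := by
  rw [crux_iff]
  exact ⟨fun h n x hx _ => h n x hx, fun h n x hx => h n x hx fun i => hx.mem_ecl i⟩

/-- … and would FOLLOW from the purely model-theoretic inclusion `ecl ∅ ⊆ acl^{ℂ_exp}(∅)`
("every exponentially algebraic number is first-order algebraic over ∅"), with no transcendence
input at all.  (Gen 2 showed this inclusion ⇔ `KhovanskiiIsolation` and ⇐ `ℝ` being `∅`-definable
in `ℂ_exp`; both open.) -/
theorem crux_of_ecl_subset_expAcl (h : ecl (∅ : Set ℂ) ⊆ expAcl) :
    Summit.Schanuel.Schanuel.Theses.RigidCore.MinimalCounterexampleInAcl :=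
  crux_iff_eclVersion.2 fun _ _ _ hmem i => h (hmem i)

/-! ## §6 Targets: the registered skeleton `Lines/span-growth-dichotomy.lean` -/

/-- `x` is a locus mate of itself as soon as it is ℚ-linearly independent. -/
theorem self_mem_locusMates {n : ℕ} {x : Fin n → ℂ} (hx : LinearIndependent ℚ x) :
    x ∈ locusMates x :=
  ⟨hx, fun _ hp => hp⟩

/-- `2πi` is transcendental (Lindemann; copied from the tree's `transcendental_two_pi_I`). -/
theorem transcendental_two_pi_I' : Transcendental ℚ (2 * Real.pi * I : ℂ) := by
  intro h
  have hI : IsAlgebraic ℚ Complex.I := by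
    refine ⟨Polynomial.X ^ 2 + 1, Polynomial.Monic.ne_zero (by monicity!), ?_⟩
    simp
  have h2 : IsAlgebraic ℚ ((-2 : ℤ) : ℂ)⁻¹ := (isAlgebraic_int (-2)).inv
  have hpi : IsAlgebraic ℚ (Real.pi : ℂ) := by
    have e : (Real.pi : ℂ) = 2 * Real.pi * I * I * ((-2 : ℤ) : ℂ)⁻¹ := by
      rw [mul_assoc (2 * (Real.pi : ℂ)), Complex.I_mul_I]
      push_cast
      ring
    rw [e]
    exact (h.mul hI).mul h2
  exact transcendental_pi_holds
    ((isAlgebraic_algebraMap_iff (A := ℂ) Complex.ofReal_injective).mp hpi)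

/-- The WITNESS tuple for the stub-level load-bearing analysis: `n = 1`, `x = (2πi)`. It is
ℚ-linearly independent with `trdeg ℚ(2πi, 1) = 1 = n` (defect ZERO — not a first failure). -/
def twoPiTuple : Fin 1 → ℂ := fun _ => 2 * Real.pi * I

/-- Substituting `Y ↦ 1` turns a polynomial in `(X, Y)` into a one-variable polynomial. -/
def substY1 : MvPolynomial (Fin 1 ⊕ Fin 1) ℚ →ₐ[ℚ] Polynomial ℚ :=
  MvPolynomial.aeval (Sum.elim (fun _ => Polynomial.X) (fun _ => 1))

/-- On a tuple `(c)` with `e^c = 1`, evaluation factors through `substY1`. -/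
theorem aeval_eq_of_exp_eq_one {c : ℂ} (hc : cexp c = 1) (p : MvPolynomial (Fin 1 ⊕ Fin 1) ℚ) :
    MvPolynomial.aeval (Sum.elim (fun _ : Fin 1 => c) (cexp ∘ fun _ : Fin 1 => c)) p =
      Polynomial.aeval c (substY1 p) := by
  have key : (MvPolynomial.aeval (Sum.elim (fun _ : Fin 1 => c) (cexp ∘ fun _ : Fin 1 => c)) :
      MvPolynomial (Fin 1 ⊕ Fin 1) ℚ →ₐ[ℚ] ℂ) = (Polynomial.aeval c).comp substY1 := by
    refine MvPolynomial.algHom_ext fun i => ?_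
    rcases i with i | i
    · simp [substY1]
    · simp [substY1, hc]
  exact congrArg (fun f : MvPolynomial (Fin 1 ⊕ Fin 1) ℚ →ₐ[ℚ] ℂ => f p) key

/-- `e^{2πik} = 1`. -/
theorem cexp_two_pi_I_mul_int (k : ℤ) : cexp (2 * Real.pi * I * k) = 1 := by
  rw [show (2 * ↑Real.pi * I * ↑k : ℂ) = k * (2 * Real.pi * I) by ring]
  exact Complex.exp_int_mul_two_pi_mul_I k

/-- **The locus mates of `(2πi)` are exactly the nonzero kernel elements `(2πik)`, `k ≠ 0`**:
the ℚ-locus of `(2πi, 1)` is `{Y = 1}` (`2πi` is transcendental), and `{Y = 1} ∩ Γ_exp = 2πiℤ`. -/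
theorem locusMates_twoPiTuple :
    locusMates twoPiTuple = {x' | ∃ k : ℤ, k ≠ 0 ∧ x' = fun _ => 2 * Real.pi * I * k} := by
  ext x'
  constructor
  · rintro ⟨hli, hrel⟩
    have h1 : cexp (x' 0) = 1 := by
      have h := hrel (MvPolynomial.X (Sum.inr 0) - 1) (by simp [twoPiTuple])
      simpa [sub_eq_zero] using h
    obtain ⟨k, hk⟩ := Complex.exp_eq_one_iff.1 h1
    refine ⟨k, ?_, ?_⟩
    · rintro rfl
      simp only [Int.cast_zero, zero_mul] at hk
      exact hli.ne_zero 0 hk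
    · funext i
      rw [Subsingleton.elim i 0, hk]
      ring
  · rintro ⟨k, hk, rfl⟩
    refine ⟨linearIndependent_fin_one ?_, fun p hp => ?_⟩
    · have h2 : (2 * Real.pi * I : ℂ) ≠ 0 := two_pi_I_ne_zero
      exact mul_ne_zero h2 (Int.cast_ne_zero.2 hk)
    · have htwo : cexp (2 * Real.pi * I : ℂ) = 1 := by simp
      have h0 : Polynomial.aeval (2 * Real.pi * I : ℂ) (substY1 p) = 0 := by
        rw [← aeval_eq_of_exp_eq_one htwo]; exact hp
      have hp0 : substY1 p = 0 := by
        by_contra hne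
        exact transcendental_two_pi_I' ⟨substY1 p, hne, h0⟩
      rw [aeval_eq_of_exp_eq_one (cexp_two_pi_I_mul_int k), hp0, map_zero]

/-- All mates of `(2πi)` lie in the ONE-dimensional space `span{2πi}` … -/
theorem locusMates_twoPiTuple_subset_span :
    ∀ x' ∈ locusMates twoPiTuple,
      range x' ⊆ (Submodule.span ℚ (({2 * Real.pi * I} : Finset ℂ) : Set ℂ) : Set ℂ) := by
  intro x' hx'
  rw [locusMates_twoPiTuple] at hx'
  obtain ⟨k, -, rfl⟩ := hx'
  rintro a ⟨i, rfl⟩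
  rw [Finset.coe_singleton]
  have hk : (2 * ↑Real.pi * I * ↑k : ℂ) = (k : ℚ) • (2 * Real.pi * I : ℂ) := by
    rw [Rat.smul_def, Rat.cast_intCast]; ring
  rw [hk]
  exact Submodule.smul_mem _ _ (Submodule.subset_span rfl)

/-- … yet there are INFINITELY many of them. -/
theorem locusMates_twoPiTuple_infinite : (locusMates twoPiTuple).Infinite := by
  rw [locusMates_twoPiTuple]
  have hinj : Function.Injective (fun k : ℤ => (fun _ : Fin 1 => (2 * Real.pi * I * k : ℂ))) := by
    intro a b hab
    have h := congrFun hab 0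
    simp only [mul_eq_mul_left_iff, Int.cast_inj, two_pi_I_ne_zero, or_false] at h
    exact h
  have hinf : (Set.range fun k : {k : ℤ // k ≠ 0} => (fun _ : Fin 1 => (2 * Real.pi * I * (k : ℤ) : ℂ))).Infinite := by
    haveI : Infinite {k : ℤ // k ≠ 0} := Infinite.of_injective (fun n : ℕ => ⟨(n : ℤ) + 1, by omega⟩)
      (fun a b h => by simpa using congrArg Subtype.val h)
    exact Set.infinite_range_of_injective fun a b hab => Subtype.ext (hinj hab)
  refine hinf.mono ?_
  rintro x' ⟨⟨k, hk⟩, rfl⟩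
  exact ⟨k, hk, rfl⟩

/-- **Stub M (`stub_finiteRankCase`) is FALSE without the first-failure hypothesis** — precisely,
"mates confined to a finite-dimensional ℚ-space are finitely many" fails for the ℚ-linearly
independent, defect-ZERO tuple `(2πi)`: all its mates `(2πik)` sit in `span{2πi}` and there are
infinitely many.  So `trdeg < n` (via ISOLATION of the graph points on `W_x ∩ Γ`) is load-bearing in
Stub M: any proof must use that a first failure has `dim W_x < n` (here `dim W = 1 = n` and
`W ∩ Γ = 2πiℤ` is discrete but infinite).  The same witness kills the expired stub
`BranchFiniteness` without first failure (`k ↦ 2πi + 2πik`). -/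
theorem finiteRankCase_false_without_firstFailure :
    ¬ ∀ (n : ℕ) (x : Fin n → ℂ), LinearIndependent ℚ x → ∀ s : Finset ℂ,
        (∀ x' ∈ locusMates x, range x' ⊆ (Submodule.span ℚ (s : Set ℂ) : Set ℂ)) →
          (locusMates x).Finite := by
  intro h
  refine locusMates_twoPiTuple_infinite (h 1 twoPiTuple ?_ {2 * Real.pi * I}
    locusMates_twoPiTuple_subset_span)
  exact linearIndependent_fin_one two_pi_I_ne_zero

/-- Dually, Stub M is TRIVIALLY TRUE (vacuous) under Schanuel, like every stub of the line that
carries `IsFirstFailure x` or `δ(span x') ≤ −1` among its hypotheses: no stub of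
`span-growth-dichotomy` is refutable short of an explicit counterexample to Schanuel. -/
theorem isFirstFailure_elim_of_schanuel (hS : _root_.Schanuel) {n : ℕ} {x : Fin n → ℂ}
    (hx : IsFirstFailure x) {P : Prop} : P :=
  (hx.not_schanuel hS).elim


/-! ## §4b Dropping the first-failure hypothesis costs an open transcendence theorem -/

/-- "DEFECT AT MOST ONE at every rank": `trdeg ℚ(x, eˣ) ≥ n − 1` for every ℚ-linearly independent
`x ∈ ℂⁿ`.  OPEN (e.g. for `x = (1, iπ, iπ√2)` it asserts `trdeg(e, π, e^{iπ√2}) ≥ 2`, unknown);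
implied by Schanuel. -/
def DefectLeOne : Prop :=
  ∀ (n : ℕ) (x : Fin n → ℂ), LinearIndependent ℚ x →
    ((n - 1 : ℕ) : Cardinal) ≤ Algebra.trdeg ℚ ↥(IntermediateField.adjoin ℚ (range x ∪ range (cexp ∘ x)))

/-- The ℚ-span of finitely many complex numbers is countable. -/
theorem countable_span_range {n : ℕ} (x : Fin n → ℂ) :
    ((Submodule.span ℚ (range x) : Submodule ℚ ℂ) : Set ℂ).Countable := by
  have hsub : ((Submodule.span ℚ (range x) : Submodule ℚ ℂ) : Set ℂ) ⊆
      Set.range (fun q : Fin n → ℚ => ∑ i, q i • x i) := by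
    intro a ha
    obtain ⟨q, rfl⟩ := (Submodule.mem_span_range_iff_exists_fun ℚ).1 ha
    exact ⟨q, rfl⟩
  exact (Set.countable_range _).mono hsub

/-- Range bookkeeping for a padded tuple `(c, x)`. -/
theorem range_cons_union {n : ℕ} (c : ℂ) (x : Fin n → ℂ) :
    range (Fin.cons c x : Fin (n + 1) → ℂ) ∪ range (cexp ∘ (Fin.cons c x : Fin (n + 1) → ℂ)) =
      ({c} ∪ {cexp c}) ∪ (range x ∪ range (cexp ∘ x)) := by
  have h2 : (cexp ∘ (Fin.cons c x : Fin (n + 1) → ℂ)) = Fin.cons (cexp c) (cexp ∘ x) := by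
    funext i
    refine Fin.cases ?_ (fun j => ?_) i <;> simp
  rw [h2, Fin.range_cons, Fin.range_cons]
  ext a
  simp only [mem_union, mem_insert_iff, mem_singleton_iff]
  tauto

/-- **The first-failure hypothesis is load-bearing**: WITHOUT `∀ r < n, SchanuelRank r` the statement
(every Schanuel counterexample has all coordinates in `acl(∅)`) implies `DefectLeOne`, by PADDING: if
`trdeg ℚ(x, eˣ) ≤ n − 2` for some LI `x`, adjoin a coordinate `c ∉ acl(∅) ∪ ⟨x⟩_ℚ` (countable); then
`(c, x)` is LI with `trdeg ≤ n < n + 1`, a counterexample whose coordinate `c` is NOT in `acl(∅)`.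
So a proof of the crux that never uses the ranks below `n` would prove `DefectLeOne`. -/
theorem withoutFirstFailure_defectLeOne (h : WithoutFirstFailure) : DefectLeOne := by
  intro n x hli
  by_contra hlt
  rw [not_le] at hlt
  obtain ⟨k, hk⟩ := Cardinal.lt_aleph0.1 (hlt.trans Cardinal.natCast_lt_aleph0)
  have hkn : k < n - 1 := by rw [hk] at hlt; exact_mod_cast hlt
  obtain ⟨c, hc⟩ := exists_not_mem_of_countable (countable_expAcl.union (countable_span_range x))
  simp only [mem_union, not_or, SetLike.mem_coe] at hc
  have hli' : LinearIndependent ℚ (Fin.cons c x : Fin (n + 1) → ℂ) :=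
    LinearIndependent.finCons hli hc.2
  have htr : Algebra.trdeg ℚ ↥(IntermediateField.adjoin ℚ
      (range (Fin.cons c x : Fin (n + 1) → ℂ) ∪ range (cexp ∘ (Fin.cons c x : Fin (n + 1) → ℂ)))) <
        ((n + 1 : ℕ) : Cardinal) := by
    rw [range_cons_union]
    calc Algebra.trdeg ℚ ↥(IntermediateField.adjoin ℚ (({c} ∪ {cexp c}) ∪ (range x ∪ range (cexp ∘ x))))
          ≤ Algebra.trdeg ℚ ↥(IntermediateField.adjoin ℚ ({c} ∪ {cexp c} : Set ℂ)) +
            Algebra.trdeg ℚ ↥(IntermediateField.adjoin ℚ (range x ∪ range (cexp ∘ x))) :=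
            trdeg_adjoin_union_le _ _
      _ ≤ (2 : Cardinal) + (k : Cardinal) := add_le_add (trdeg_pair_le_two c) hk.le
      _ < ((n + 1 : ℕ) : Cardinal) := by norm_cast; omega
  have hmem := h (n + 1) (Fin.cons c x) hli' htr 0
  simp only [Fin.cons_zero] at hmem
  exact hc.1 hmem

/-- `DefectLeOne` is implied by Schanuel (defect zero). -/
theorem defectLeOne_of_schanuel (hS : _root_.Schanuel) : DefectLeOne := fun n x hli =>
  le_trans (by exact_mod_cast Nat.sub_le n 1) (hS n x hli)

/-! ## §7 Bridge to the skeleton's predimension vocabulary (`GammaField.predim ⊥ (span x')`) -/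

section Bridge
open GammaField

/-- `td(⟨x⟩_ℚ / 0)` is the rank of `x ∪ eˣ` in the algebraic matroid of `ℂ/ℚ`. -/
theorem td_bot_span_range {n : ℕ} (x : Fin n → ℂ) :
    td (⊥ : Submodule ℚ ℂ) (Submodule.span ℚ (range x)) =
      (algMatroid ℂ).eRk (range x ∪ range (cexp ∘ x)) := by
  refine le_antisymm ?_ ?_
  · have hsub : gens (Submodule.span ℚ (range x)) ⊆
        (algMatroid ℂ).closure (range x ∪ range (cexp ∘ x)) := by
      have h1 := gens_sup_span_subset_acl (⊥ : Submodule ℚ ℂ) (range x)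
      rw [bot_sup_eq] at h1
      refine h1.trans (acl_subset_acl_of_subset ?_)
      rintro a (ha | ha | ha)
      · have ha' : a ∈ (algMatroid ℂ).closure (gens (⊥ : Submodule ℚ ℂ)) := subset_acl _ ha
        rw [ZilberHomogeneity.closure_gens_bot] at ha'
        exact (algMatroid ℂ).closure_subset_closure (empty_subset _) ha'
      · exact subset_acl _ (Or.inl ha)
      · exact subset_acl _ (Or.inr (by rwa [range_comp]))
    rw [ZilberHomogeneity.td_bot, ← (algMatroid ℂ).eRk_closure_eq (range x ∪ range (cexp ∘ x))]
    exact (algMatroid ℂ).eRk_mono hsub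
  · rw [ZilberHomogeneity.td_bot]
    refine (algMatroid ℂ).eRk_mono ?_
    rintro a (⟨i, rfl⟩ | ⟨i, rfl⟩)
    · exact mem_gens_of_mem (Submodule.subset_span ⟨i, rfl⟩)
    · exact exp_mem_gens (Submodule.subset_span ⟨i, rfl⟩)

/-- The rank of the finite set `x ∪ eˣ` is finite. -/
theorem eRk_range_ne_top {n : ℕ} (x : Fin n → ℂ) :
    (algMatroid ℂ).eRk (range x ∪ range (cexp ∘ x)) ≠ ⊤ := by
  refine ne_top_of_le_ne_top ?_ ((algMatroid ℂ).eRk_le_encard _)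
  exact ((finite_range x).union (finite_range _)).encard_lt_top.ne

/-- **Bridge**: for ℚ-linearly independent `x`,
`δ(⟨x⟩_ℚ/0) = rk(x ∪ eˣ) − n` with `rk(x ∪ eˣ) = trdeg ℚ(x, eˣ)` (as a natural number). -/
theorem predim_bot_span_range {n : ℕ} {x : Fin n → ℂ} (hx : LinearIndependent ℚ x) :
    predim (⊥ : Submodule ℚ ℂ) (Submodule.span ℚ (range x)) =
      (((algMatroid ℂ).eRk (range x ∪ range (cexp ∘ x))).toNat : ℤ) - n := by
  rw [predim_def, td_bot_span_range,
    ldim_span_eq_of_linIndepOver (linIndepOver_bot_of_linearIndependent hx)]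

/-- `m ≤ trdeg ℚ(x, eˣ)` iff `m ≤ rk(x ∪ eˣ)` (tree: `natCast_le_eRk_of_le_trdeg` and converse). -/
theorem natCast_le_trdeg_iff {n : ℕ} (x : Fin n → ℂ) (m : ℕ) :
    (m : Cardinal) ≤ Algebra.trdeg ℚ ↥(IntermediateField.adjoin ℚ (range x ∪ range (cexp ∘ x))) ↔
      (m : ℕ∞) ≤ (algMatroid ℂ).eRk (range x ∪ range (cexp ∘ x)) :=
  ⟨ZilberHomogeneity.natCast_le_eRk_of_le_trdeg, le_trdeg_adjoin_of_natCast_le_eRk⟩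

/-- **The skeleton's hypothesis `δ(span x') ≤ −1` (Stubs T1/T2) is literally "`x'` is a Schanuel
counterexample at rank `n`"**: for LI `x'`, `predim ⊥ (span x') ≤ -1 ↔ trdeg ℚ(x', e^{x'}) < n`. -/
theorem predim_le_neg_one_iff {n : ℕ} {x : Fin n → ℂ} (hx : LinearIndependent ℚ x) :
    predim (⊥ : Submodule ℚ ℂ) (Submodule.span ℚ (range x)) ≤ -1 ↔
      Algebra.trdeg ℚ ↥(IntermediateField.adjoin ℚ (range x ∪ range (cexp ∘ x))) < (n : Cardinal) := by
  rw [predim_bot_span_range hx, ← not_le, natCast_le_trdeg_iff]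
  set r := (algMatroid ℂ).eRk (range x ∪ range (cexp ∘ x)) with hr
  have hr' : r = (r.toNat : ℕ∞) := (ENat.coe_toNat (eRk_range_ne_top x)).symm
  constructor
  · intro h hle
    rw [hr'] at hle
    have : n ≤ r.toNat := by exact_mod_cast hle
    omega
  · intro h
    have : ¬ n ≤ r.toNat := fun hle => h (by rw [hr']; exact_mod_cast hle)
    omega

/-- Hence Stub T2's standing hypotheses (`hli`, `hδ`) contradict `SchanuelRank n`: T2 — like T1, D, M, I —
is VACUOUSLY TRUE under Schanuel and cannot be refuted without an explicit Schanuel counterexample. -/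
theorem not_schanuelRank_of_predim_le_neg_one {n : ℕ} {x : Fin n → ℂ} (hx : LinearIndependent ℚ x)
    (hδ : predim (⊥ : Submodule ℚ ℂ) (Submodule.span ℚ (range x)) ≤ -1) : ¬ SchanuelRank n :=
  fun h => (not_le.2 ((predim_le_neg_one_iff hx).1 hδ)) (h x hx)

/-- A first failure has `δ(⟨x⟩/0) ≤ −1` (indeed `= −1`, below): Stub T1 at `x' = x`. -/
theorem IsFirstFailure.predim_le {n : ℕ} {x : Fin n → ℂ} (hx : IsFirstFailure x) :
    predim (⊥ : Submodule ℚ ℂ) (Submodule.span ℚ (range x)) ≤ -1 :=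
  (predim_le_neg_one_iff hx.1).2 hx.2.1

/-- **TIGHTNESS for Stub T1**: at a first-failure RANK `n` (all `SchanuelRank r`, `r < n`), NO
ℚ-linearly independent `n`-tuple has `δ < −1`; so every mate in `stub_matePredim` has `δ = −1`
EXACTLY (T2 gives `≤ −1` per span-new mate; never `≤ −2` from a single mate). -/
theorem neg_one_le_predim_of_ranks_below {n : ℕ} {x : Fin n → ℂ} (hx : LinearIndependent ℚ x)
    (hrank : ∀ r < n, SchanuelRank r) :
    -1 ≤ predim (⊥ : Submodule ℚ ℂ) (Submodule.span ℚ (range x)) := by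
  rw [predim_bot_span_range hx]
  have h := (natCast_le_trdeg_iff x (n - 1)).1 (pred_le_trdeg_of_ranks_below hx hrank)
  rw [(ENat.coe_toNat (eRk_range_ne_top x)).symm] at h
  have : n - 1 ≤ ((algMatroid ℂ).eRk (range x ∪ range (cexp ∘ x))).toNat := by exact_mod_cast h
  omega

/-- So at a first failure `δ(⟨x⟩_ℚ/0) = −1` on the nose. -/
theorem IsFirstFailure.predim_eq {n : ℕ} {x : Fin n → ℂ} (hx : IsFirstFailure x) :
    predim (⊥ : Submodule ℚ ℂ) (Submodule.span ℚ (range x)) = -1 :=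
  le_antisymm hx.predim_le (neg_one_le_predim_of_ranks_below hx.1 hx.2.2)

end Bridge

/-! ## §8 Definable isolation is FREE — Stub I proved; the crux follows from finiteness of mates -/

section IsolationFree

variable {α : Type*}

/-- Rational constants are `∅`-definable functions (`q` is the unique `y` with `den(q)·y = num(q)`). -/
theorem definableFun_ratCast' (q : ℚ) :
    (∅ : Set ℂ).DefinableFun Language.expRing (fun _ : α → ℂ => (q : ℂ)) := by
  have h : (∅ : Set ℂ).Definable Language.expRing
      {w : Option α → ℂ | (q.den : ℂ) * w none = (q.num : ℂ)} :=
    definable_setOf_eq_params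
      (definableFun_mul' (definableFun_natCast' q.den) (definableFun_proj_params none))
      (definableFun_intCast' q.num)
  unfold Set.DefinableFun
  convert h using 1
  ext w
  simp only [Function.tupleGraph, mem_setOf_eq]
  have hd : (q.den : ℂ) ≠ 0 := Nat.cast_ne_zero.2 q.den_nz
  rw [Rat.cast_def]
  constructor
  · intro hw
    rw [← hw]
    field_simp
  · intro hw
    rw [← hw]
    field_simp

/-- **Exponential polynomials over `ℚ` are `∅`-definable functions**:
`v ↦ p(v, e^v)` for `p ∈ ℚ[X₁..Xₙ, Y₁..Yₙ]`. -/
theorem definableFun_expPoly {n : ℕ} (p : MvPolynomial (Fin n ⊕ Fin n) ℚ) :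
    (∅ : Set ℂ).DefinableFun Language.expRing
      (fun v : Fin n → ℂ => MvPolynomial.aeval (Sum.elim v (cexp ∘ v)) p) := by
  induction p using MvPolynomial.induction_on with
  | C a => simpa using definableFun_ratCast' (α := Fin n) a
  | add p q hp hq => simpa using definableFun_add' hp hq
  | mul_X p i hp =>
    rcases i with i | i
    · simpa using definableFun_mul' hp (definableFun_proj_params i)
    · simpa using definableFun_mul' hp (definableFun_cexp (definableFun_proj_params i))

/-- The zero set of an exponential polynomial over `ℚ` is `∅`-definable. -/
theorem definable_expPoly_zero {n : ℕ} (p : MvPolynomial (Fin n ⊕ Fin n) ℚ) :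
    (∅ : Set ℂ).Definable Language.expRing
      {v : Fin n → ℂ | MvPolynomial.aeval (Sum.elim v (cexp ∘ v)) p = 0} :=
  definable_setOf_eq_params (definableFun_expPoly p) definableFun_zero'

/-- The relation ideal of `(x, eˣ)` over `ℚ`. -/
def relIdeal {n : ℕ} (x : Fin n → ℂ) : Ideal (MvPolynomial (Fin n ⊕ Fin n) ℚ) :=
  RingHom.ker (MvPolynomial.aeval (R := ℚ) (Sum.elim x (cexp ∘ x))).toRingHom

theorem mem_relIdeal_iff {n : ℕ} (x : Fin n → ℂ) (p : MvPolynomial (Fin n ⊕ Fin n) ℚ) :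
    p ∈ relIdeal x ↔ MvPolynomial.aeval (Sum.elim x (cexp ∘ x)) p = 0 :=
  RingHom.mem_ker

/-- Hilbert basis: the relation ideal is finitely generated, so "satisfies every relation of
`(x, eˣ)`" is a FINITE conjunction. -/
theorem exists_finset_relIdeal {n : ℕ} (x : Fin n → ℂ) :
    ∃ G : Finset (MvPolynomial (Fin n ⊕ Fin n) ℚ), Ideal.span (G : Set _) = relIdeal x := by
  have hfg : (relIdeal x).FG := IsNoetherian.noetherian _
  exact hfg

/-- **The locus condition is `∅`-definable** (for each fixed `x`; `x` is NOT a parameter — it is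
eliminated through a finite generating set of its relation ideal). -/
theorem definable_locusCondition {n : ℕ} (x : Fin n → ℂ) :
    (∅ : Set ℂ).Definable Language.expRing
      {x' : Fin n → ℂ | ∀ p : MvPolynomial (Fin n ⊕ Fin n) ℚ,
        MvPolynomial.aeval (Sum.elim x (cexp ∘ x)) p = 0 →
        MvPolynomial.aeval (Sum.elim x' (cexp ∘ x')) p = 0} := by
  classical
  obtain ⟨G, hG⟩ := exists_finset_relIdeal x
  have hdef : (∅ : Set ℂ).Definable Language.expRing
      (⋂ g ∈ G, {v : Fin n → ℂ | MvPolynomial.aeval (Sum.elim v (cexp ∘ v)) g = 0}) :=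
    Set.definable_biInter_finset (fun g => definable_expPoly_zero g) G
  convert hdef using 1
  ext x'
  simp only [mem_setOf_eq, mem_iInter]
  constructor
  · intro h g hg
    refine h g ?_
    rw [← mem_relIdeal_iff, ← hG]
    exact Ideal.subset_span hg
  · intro h p hp
    rw [← mem_relIdeal_iff, ← hG] at hp
    have hle : Ideal.span (G : Set _) ≤ relIdeal x' := by
      rw [Ideal.span_le]
      intro g hg
      exact (mem_relIdeal_iff x' g).2 (h g hg)
    exact (mem_relIdeal_iff x' p).1 (hle hp)

/-- Finite sums of definable functions are definable. -/
theorem definableFun_finset_sum {ι : Type*} (s : Finset ι) {f : ι → (α → ℂ) → ℂ}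
    (hf : ∀ i ∈ s, (∅ : Set ℂ).DefinableFun Language.expRing (f i)) :
    (∅ : Set ℂ).DefinableFun Language.expRing (fun v => ∑ i ∈ s, f i v) := by
  classical
  induction s using Finset.induction_on with
  | empty => simpa using (definableFun_zero' (A := (∅ : Set ℂ)) (α := α))
  | insert a s ha ih =>
    have h := definableFun_add' (hf a (Finset.mem_insert_self a s))
      (ih fun i hi => hf i (Finset.mem_insert_of_mem hi))
    simpa [Finset.sum_insert ha] using h

/-- **ℤ-linear dependence is `∅`-definable** (`ℤ` is `∅`-definable in `ℂ_exp`, KMO §2.2):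
the set of `v ∈ ℂⁿ` admitting integers `m`, not all zero, with `Σ mⱼ vⱼ = 0`. -/
theorem definable_intDependent (n : ℕ) :
    (∅ : Set ℂ).Definable Language.expRing
      {v : Fin n → ℂ | ∃ m : Fin n → ℂ, (∀ j, m j ∈ intSet) ∧ (∃ j, m j ≠ 0) ∧
        ∑ j, m j * v j = 0} := by
  classical
  -- the inner condition on `(v, m) : Fin n ⊕ Fin n → ℂ`
  have h1 : (∅ : Set ℂ).Definable Language.expRing
      {u : Fin n ⊕ Fin n → ℂ | ∀ j, u (Sum.inr j) ∈ intSet} := by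
    have := Set.definable_iInter_of_finite (A := (∅ : Set ℂ)) (L := Language.expRing)
      (f := fun j : Fin n => {u : Fin n ⊕ Fin n → ℂ | u (Sum.inr j) ∈ intSet})
      (fun j => definable_mem_intSet (definableFun_proj_params (Sum.inr j)))
    convert this using 1
    ext u; simp
  have h2 : (∅ : Set ℂ).Definable Language.expRing
      {u : Fin n ⊕ Fin n → ℂ | ∃ j, u (Sum.inr j) ≠ 0} := by
    have := Set.definable_iUnion_of_finite (A := (∅ : Set ℂ)) (L := Language.expRing)
      (f := fun j : Fin n => {u : Fin n ⊕ Fin n → ℂ | ¬ u (Sum.inr j) = 0})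
      (fun j => definable_setOf_not_params
        (definable_setOf_eq_params (definableFun_proj_params (Sum.inr j)) definableFun_zero'))
    convert this using 1
    ext u; simp
  have h3 : (∅ : Set ℂ).Definable Language.expRing
      {u : Fin n ⊕ Fin n → ℂ | ∑ j, u (Sum.inr j) * u (Sum.inl j) = 0} :=
    definable_setOf_eq_params
      (definableFun_finset_sum Finset.univ fun j _ =>
        definableFun_mul' (definableFun_proj_params (Sum.inr j)) (definableFun_proj_params (Sum.inl j)))
      definableFun_zero'
  have h := ((h1.inter h2).inter h3).exists_of_finite (β := Fin n) (α := Fin n)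
  convert h using 1
  ext v
  simp only [mem_setOf_eq, mem_inter_iff, Sum.elim_inr, Sum.elim_inl]
  constructor
  · rintro ⟨m, hm, hne, hsum⟩
    exact ⟨m, ⟨hm, hne⟩, hsum⟩
  · rintro ⟨m, ⟨hm, hne⟩, hsum⟩
    exact ⟨m, hm, hne, hsum⟩

/-- Clearing denominators: a nonzero rational relation gives a nonzero integer relation. -/
theorem intDependent_of_ratDependent {n : ℕ} {v : Fin n → ℂ} {q : Fin n → ℚ}
    (hq : q ≠ 0) (hsum : ∑ j, (q j : ℂ) * v j = 0) :
    ∃ m : Fin n → ℂ, (∀ j, m j ∈ intSet) ∧ (∃ j, m j ≠ 0) ∧ ∑ j, m j * v j = 0 := by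
  classical
  -- common denominator
  set D : ℕ := ∏ j, (q j).den with hD
  have hD0 : (D : ℚ) ≠ 0 := by
    rw [hD]; exact_mod_cast Finset.prod_ne_zero_iff.2 fun j _ => (q j).den_nz
  have hint : ∀ j, ∃ z : ℤ, ((D : ℚ) * q j) = z := by
    intro j
    have hsplit : (D : ℚ) = (∏ i ∈ Finset.univ.erase j, ((q i).den : ℚ)) * (q j).den := by
      rw [hD, Nat.cast_prod, ← Finset.prod_erase_mul _ _ (Finset.mem_univ j)]
    refine ⟨(∏ i ∈ Finset.univ.erase j, ((q i).den : ℤ)) * (q j).num, ?_⟩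
    rw [hsplit, mul_assoc, Rat.den_mul_eq_num]
    push_cast
    ring
  choose z hz using hint
  refine ⟨fun j => (z j : ℂ), fun j => mem_intSet_iff.2 ⟨z j, rfl⟩, ?_, ?_⟩
  · obtain ⟨j, hj⟩ : ∃ j, q j ≠ 0 := by
      by_contra hall
      push Not at hall
      exact hq (funext hall)
    refine ⟨j, ?_⟩
    have : (z j : ℚ) ≠ 0 := by rw [← hz]; exact mul_ne_zero hD0 hj
    show (z j : ℂ) ≠ 0
    exact_mod_cast this
  · have : ∑ j, (z j : ℂ) * v j = (D : ℂ) * ∑ j, (q j : ℂ) * v j := by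
      rw [Finset.mul_sum]
      refine Finset.sum_congr rfl fun j _ => ?_
      have hzj : ((z j : ℚ) : ℂ) = ((D : ℚ) * q j : ℚ) := by rw [hz]
      rw [← mul_assoc]
      congr 1
      have : ((z j : ℚ) : ℂ) = (z j : ℂ) := by norm_cast
      rw [← this, hzj]
      push_cast
      ring
    rw [this, hsum, mul_zero]

/-- **Linear independence over `ℚ` is `∅`-definable in `ℂ_exp`.** -/
theorem definable_linearIndependent (n : ℕ) :
    (∅ : Set ℂ).Definable Language.expRing {v : Fin n → ℂ | LinearIndependent ℚ v} := by
  have h := (definable_intDependent n).compl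
  convert h using 1
  ext v
  simp only [mem_setOf_eq, mem_compl_iff]
  rw [Fintype.linearIndependent_iff]
  constructor
  · rintro hli ⟨m, hm, ⟨j₀, hj₀⟩, hsum⟩
    choose z hz using fun j => mem_intSet_iff.1 (hm j)
    have h0 := hli (fun j => (z j : ℚ)) (by
      rw [← hsum]
      refine Finset.sum_congr rfl fun j _ => ?_
      rw [hz j, Rat.smul_def]
      push_cast
      rfl)
    have := h0 j₀
    apply hj₀
    rw [hz j₀]
    exact_mod_cast this
  · intro hnot g hg
    by_contra hne
    push Not at hne
    obtain ⟨i, hi⟩ := hne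
    refine hnot (intDependent_of_ratDependent (q := g) ?_ ?_)
    · intro h0; exact hi (by rw [h0]; rfl)
    · rw [← hg]
      refine Finset.sum_congr rfl fun j _ => ?_
      rw [Rat.smul_def]

/-- **`locusMates x` is `∅`-definable** as an `n`-ary relation. -/
theorem definable_locusMates {n : ℕ} (x : Fin n → ℂ) :
    (∅ : Set ℂ).Definable Language.expRing (locusMates x) :=
  (definable_linearIndependent n).inter (definable_locusCondition x)

/-- Coordinate projections of an `∅`-definable set of tuples are `∅`-definable subsets of `ℂ`. -/
theorem definable₁_image_eval {n : ℕ} {S : Set (Fin n → ℂ)}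
    (hS : (∅ : Set ℂ).Definable Language.expRing S) (i : Fin n) :
    Set.Definable₁ (∅ : Set ℂ) Language.expRing ((fun x' : Fin n → ℂ => x' i) '' S) := by
  have h := hS.image_comp (fun _ : Fin 1 => i)
  unfold Set.Definable₁
  convert h using 1
  ext v
  simp only [mem_setOf_eq, mem_image]
  constructor
  · rintro ⟨x', hx', hv⟩
    refine ⟨x', hx', ?_⟩
    funext j
    rw [Subsingleton.elim j 0]
    simpa using hv
  · rintro ⟨x', hx', rfl⟩
    exact ⟨x', hx', rfl⟩

/-- **STUB I PROVED — definable isolation is free**: if the locus mates of a ℚ-linearly independent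
`x` are finitely many, every coordinate `x i` lies in a FINITE `∅`-definable subset of `ℂ_exp`
(namely the `i`-th coordinates of the mates).  No first-failure hypothesis and no parameter is
needed: `ℤ` is `∅`-definable (KMO) so "ℚ-linearly independent" is one `∅`-formula, and the locus is
cut out by finitely many relations with rational coefficients (Hilbert basis). -/
theorem isolationFree {n : ℕ} {x : Fin n → ℂ} (hx : LinearIndependent ℚ x)
    (hfin : (locusMates x).Finite) (i : Fin n) :
    ∃ s : Set ℂ, s.Finite ∧ Set.Definable₁ (∅ : Set ℂ) Language.expRing s ∧ x i ∈ s :=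
  ⟨(fun x' : Fin n → ℂ => x' i) '' locusMates x, hfin.image _,
    definable₁_image_eval (definable_locusMates x) i, ⟨x, self_mem_locusMates hx, rfl⟩⟩

/-- Hence **the crux follows from FIRST-FAILURE SPARSITY** ("a first failure has only finitely many
locus mates"), a statement with no definability in it: the open content of (S*) is pure
unlikely-intersection finiteness (Stubs D + M of the line), not model theory. -/
theorem crux_of_firstFailureSparsity
    (h : ∀ (n : ℕ) (x : Fin n → ℂ), IsFirstFailure x → (locusMates x).Finite) :
    Summit.Schanuel.Schanuel.Theses.RigidCore.MinimalCounterexampleInAcl :=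
  crux_iff.2 fun n x hx i => isolationFree hx.1 (h n x hx) i

/-- … and at rank 2: `CruxRankTwo` follows from finiteness of mates of rank-2 first failures. -/
theorem cruxRankTwo_of_sparsity
    (h : ∀ x : Fin 2 → ℂ, IsFirstFailure x → (locusMates x).Finite) : CruxRankTwo :=
  fun x hli htr i => isolationFree hli (h x ((isFirstFailure_two_iff x).2 ⟨hli, htr⟩)) i

end IsolationFree

/-! ## §9 The UNIFORM strengthening is equivalent to Schanuel -/

/-- Scaling by a nonzero integer keeps `ℚ(kx, e^{kx}) ⊆ ℚ(x, eˣ)`. -/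
theorem adjoin_zsmul_le {n : ℕ} (x : Fin n → ℂ) (k : ℤ) :
    IntermediateField.adjoin ℚ (range (fun i => (k : ℂ) * x i) ∪ range (cexp ∘ fun i => (k : ℂ) * x i)) ≤
      IntermediateField.adjoin ℚ (range x ∪ range (cexp ∘ x)) := by
  rw [IntermediateField.adjoin_le_iff]
  rintro a (⟨i, rfl⟩ | ⟨i, rfl⟩)
  · have hx : x i ∈ IntermediateField.adjoin ℚ (range x ∪ range (cexp ∘ x)) :=
      IntermediateField.subset_adjoin ℚ _ (Or.inl ⟨i, rfl⟩)
    exact mul_mem (intCast_mem _ k) hx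
  · have he : cexp (x i) ∈ IntermediateField.adjoin ℚ (range x ∪ range (cexp ∘ x)) :=
      IntermediateField.subset_adjoin ℚ _ (Or.inr ⟨i, rfl⟩)
    simp only [Function.comp_apply, Complex.exp_int_mul]
    exact zpow_mem he k

/-- **First failures come in infinite families**: `k • x` is a first failure whenever `x` is
(`k ∈ ℤ ∖ {0}`). -/
theorem IsFirstFailure.zsmul {n : ℕ} {x : Fin n → ℂ} (hx : IsFirstFailure x) {k : ℤ} (hk : k ≠ 0) :
    IsFirstFailure (fun i => (k : ℂ) * x i) := by
  refine ⟨?_, ?_, hx.2.2⟩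
  · have h := hx.1.units_smul (fun _ => Units.mk0 (k : ℚ) (Int.cast_ne_zero.2 hk))
    convert h using 1
    funext i
    simp only [Pi.smul_apply', Units.smul_def, Units.val_mk0, Rat.smul_def, Rat.cast_intCast]
  · exact (Literature.Barriers.Schanuel.trdeg_mono (adjoin_zsmul_le x k)).trans_lt hx.2.1

/-- The UNIFORM strengthening of the crux: ONE finite `∅`-definable set per rank catching every
first failure of that rank. -/
def UniformVersion : Prop :=
  ∀ n : ℕ, ∃ s : Set ℂ, s.Finite ∧ Set.Definable₁ (∅ : Set ℂ) Language.expRing s ∧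
    ∀ x : Fin n → ℂ, IsFirstFailure x → ∀ i, x i ∈ s

/-- **The uniform version is EQUIVALENT to Schanuel** (so it is not a usable strengthening): given a
first failure `x`, the first failures `k • x` have pairwise distinct coordinates `k · x 0`. -/
theorem uniformVersion_iff_schanuel : UniformVersion ↔ _root_.Schanuel := by
  constructor
  · intro h
    by_contra hS
    obtain ⟨n, x, hx⟩ := exists_isFirstFailure_of_not_schanuel hS
    obtain ⟨s, hs, -, hmem⟩ := h n
    have hn : 2 ≤ n := two_le_of_isFirstFailure hx
    obtain ⟨m, rfl⟩ : ∃ m, n = m + 1 := ⟨n - 1, by omega⟩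
    have hx0 : x 0 ≠ 0 := hx.1.ne_zero 0
    have hinj : Function.Injective (fun k : {k : ℤ // k ≠ 0} => ((k : ℤ) : ℂ) * x 0) := by
      intro a b hab
      have h := mul_right_cancel₀ hx0 hab
      exact Subtype.ext (by exact_mod_cast h)
    haveI : Infinite {k : ℤ // k ≠ 0} := Infinite.of_injective (fun j : ℕ => ⟨(j : ℤ) + 1, by omega⟩)
      (fun a b hab => by simpa using congrArg Subtype.val hab)
    have hinf := Set.infinite_range_of_injective hinj
    refine hinf (hs.subset ?_)
    rintro a ⟨⟨k, hk⟩, rfl⟩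
    exact hmem (fun i => (k : ℂ) * x i) (hx.zsmul hk) 0
  · intro hS n
    refine ⟨∅, Set.finite_empty, ?_, fun x hx => (hx.not_schanuel hS).elim⟩
    unfold Set.Definable₁
    simp

/-- Even rank by rank: a finite `∅`-definable set catching all RANK-`n` first failures exists iff there
is no rank-`n` first failure. -/
theorem uniform_at_rank_iff (n : ℕ) :
    (∃ s : Set ℂ, s.Finite ∧ Set.Definable₁ (∅ : Set ℂ) Language.expRing s ∧
      ∀ x : Fin n → ℂ, IsFirstFailure x → ∀ i, x i ∈ s) ↔ ∀ x : Fin n → ℂ, ¬ IsFirstFailure x := by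
  constructor
  · rintro ⟨s, hs, -, hmem⟩ x hx
    have hn : 2 ≤ n := two_le_of_isFirstFailure hx
    obtain ⟨m, rfl⟩ : ∃ m, n = m + 1 := ⟨n - 1, by omega⟩
    have hx0 : x 0 ≠ 0 := hx.1.ne_zero 0
    have hinj : Function.Injective (fun k : {k : ℤ // k ≠ 0} => ((k : ℤ) : ℂ) * x 0) := by
      intro a b hab
      have h := mul_right_cancel₀ hx0 hab
      exact Subtype.ext (by exact_mod_cast h)
    haveI : Infinite {k : ℤ // k ≠ 0} := Infinite.of_injective (fun j : ℕ => ⟨(j : ℤ) + 1, by omega⟩)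
      (fun a b hab => by simpa using congrArg Subtype.val hab)
    refine Set.infinite_range_of_injective hinj (hs.subset ?_)
    rintro a ⟨⟨k, hk⟩, rfl⟩
    exact hmem (fun i => (k : ℂ) * x i) (hx.zsmul hk) 0
  · intro h
    refine ⟨∅, Set.finite_empty, ?_, fun x hx => (h x hx).elim⟩
    unfold Set.Definable₁
    simp

/-! ## §10 Rank-2 anatomy: at `n = 2` the crux is about the EXPONENTIALS (log sector ∨ exp sector) -/

/-- In the transcendence-degree-`1` field of a rank-2 first failure, every generator is algebraic
over any transcendental generator. -/
theorem isAlgebraic_adjoin_of_trdeg_lt_two {x : Fin 2 → ℂ}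
    (htr : Algebra.trdeg ℚ ↥(IntermediateField.adjoin ℚ (range x ∪ range (cexp ∘ x))) < (2 : Cardinal))
    {t s : ℂ} (ht : t ∈ range x ∪ range (cexp ∘ x)) (hs : s ∈ range x ∪ range (cexp ∘ x))
    (htt : Transcendental ℚ t) : IsAlgebraic (Algebra.adjoin ℚ (range ![t])) s := by
  by_contra hs'
  have hst : Transcendental (Algebra.adjoin ℚ (range ![t])) s := hs'
  have hind1 : AlgebraicIndependent ℚ ![t] := algebraicIndependent_iff_transcendental.2 htt
  have hind : AlgebraicIndependent ℚ (fun o : Option (Fin 1) => o.elim s ![t]) :=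
    AlgebraicIndependent.option_iff.2 ⟨hind1, hst⟩
  set K := IntermediateField.adjoin ℚ (range x ∪ range (cexp ∘ x)) with hK
  have hmemK : ∀ o : Option (Fin 1), (o.elim s ![t] : ℂ) ∈ K := by
    rintro (_ | i)
    · exact IntermediateField.subset_adjoin ℚ _ hs
    · have : (![t] : Fin 1 → ℂ) i = t := by fin_cases i; rfl
      simp only [Option.elim_some, this]
      exact IntermediateField.subset_adjoin ℚ _ ht
  let v : Option (Fin 1) → K := fun o => ⟨o.elim s ![t], hmemK o⟩
  have hv : AlgebraicIndependent ℚ v := AlgebraicIndependent.of_comp K.val hind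
  have h2 : (2 : Cardinal) ≤ Algebra.trdeg ℚ K := by
    have h := hv.cardinalMk_le_trdeg
    simpa using h
  exact (not_le.2 htr) h2

/-- **The exp sector is free once the exponential is ∅-algebraic**: if a rank-2 first failure has a
TRANSCENDENTAL exponential `e^{x i}` lying in `acl(∅)`, then BOTH coordinates lie in `acl(∅)`
(everything in `ℚ(x, eˣ)` is algebraic over `ℚ(e^{x i}) ⊆ acl(∅)`, and `acl(∅)` is relatively
algebraically closed, `expAcl_relAlgClosed`). -/
theorem mem_expAcl_of_transcendental_exp_mem {x : Fin 2 → ℂ} (hx : IsFirstFailure x) {i : Fin 2}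
    (ht : Transcendental ℚ (cexp (x i))) (hmem : cexp (x i) ∈ expAcl) (j : Fin 2) : x j ∈ expAcl := by
  have htr : Algebra.trdeg ℚ ↥(IntermediateField.adjoin ℚ (range x ∪ range (cexp ∘ x))) < (2 : Cardinal) := by
    exact_mod_cast hx.2.1
  have halg := isAlgebraic_adjoin_of_trdeg_lt_two htr (Or.inr ⟨i, rfl⟩) (Or.inl ⟨j, rfl⟩) ht
  have hle : Algebra.adjoin ℚ (range ![cexp (x i)]) ≤ expAclField.toSubalgebra := by
    rw [Algebra.adjoin_le_iff]
    rintro a ⟨k, rfl⟩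
    fin_cases k
    simpa using hmem
  exact expAcl_relAlgClosed (x j) (halg.tower_top_of_subalgebra_le hle)

/-- In the LOG sector (both exponentials algebraic) both coordinates are transcendental
(Hermite–Lindemann), and the whole field is algebraic over EITHER coordinate. -/
theorem transcendental_of_exp_algebraic {x : Fin 2 → ℂ} (hx : IsFirstFailure x) (i : Fin 2)
    (halg : IsAlgebraic ℚ (cexp (x i))) : Transcendental ℚ (x i) := by
  intro hxi
  exact transcendental_exp_holds hxi (hx.1.ne_zero i) halg

/-- The LOG SECTOR of the rank-2 crux: first failures `(x₁, x₂)` with `e^{x₁}, e^{x₂} ∈ ℚ̄` (so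
`xᵢ = log αᵢ` for some branches; `trdeg ℚ(log α₁, log α₂) = 1`, i.e. the two logarithms are
ALGEBRAICALLY DEPENDENT — the open "algebraic independence of logarithms" at its first instance).
Its mates are `(log α₁' + 2πij, log α₂' + 2πik)` on the relation curve: finitely many by BAKER
(route supports `TwoLogsBranchRelationFinite` / `OneLogBranchRelationFinite`, stmt-Schanuel-0974/0975,
over the PROVED `baker_holds`) — so this sector is closable now via `isolationFree`. -/
def LogSectorTwo : Prop :=
  ∀ x : Fin 2 → ℂ, IsFirstFailure x → (∀ i, IsAlgebraic ℚ (cexp (x i))) → ∀ i, x i ∈ expAcl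

/-- The EXP SECTOR of the rank-2 crux: a TRANSCENDENTAL exponential of a rank-2 first failure is
`∅`-algebraic.  (Necessary: `x i ∈ acl(∅) ⟹ e^{x i} ∈ acl(∅)`.) -/
def ExpSectorTwo : Prop :=
  ∀ x : Fin 2 → ℂ, IsFirstFailure x → ∀ i, Transcendental ℚ (cexp (x i)) → cexp (x i) ∈ expAcl

/-- **RANK-2 ANATOMY**: `CruxRankTwo ↔ LogSectorTwo ∧ ExpSectorTwo`.  The crux at its first open rank
splits into the Baker-closable log sector and the statement that transcendental EXPONENTIALS of
first failures are `∅`-algebraic — the `x`'s themselves then come for free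
(`mem_expAcl_of_transcendental_exp_mem`). -/
theorem cruxRankTwo_iff_sectors : CruxRankTwo ↔ LogSectorTwo ∧ ExpSectorTwo := by
  constructor
  · intro h
    refine ⟨fun x hx _ i => ?_, fun x hx i _ => ?_⟩
    · exact h x hx.1 (by exact_mod_cast hx.2.1) i
    · exact exp_mem_expAcl (h x hx.1 (by exact_mod_cast hx.2.1) i)
  · rintro ⟨hlog, hexp⟩ x hli htr i
    have hx : IsFirstFailure x := (isFirstFailure_two_iff x).2 ⟨hli, htr⟩
    by_cases hall : ∀ k, IsAlgebraic ℚ (cexp (x k))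
    · exact hlog x hx hall i
    · push Not at hall
      obtain ⟨k, hk⟩ := hall
      have hkt : Transcendental ℚ (cexp (x k)) := hk
      exact mem_expAcl_of_transcendental_exp_mem hx hkt (hexp x hx k hkt) i

/-- Dually, in the exp sector the crux FAILS for `x` as soon as the transcendental exponential is NOT
`∅`-algebraic: `e^{x i} ∉ acl(∅) ⟹ x i ∉ acl(∅)`.  So a refutation of (S*) at rank 2 = a rank-2
Schanuel counterexample with a transcendental exponential provably outside `acl^{ℂ_exp}(∅)` —
both halves are beyond present knowledge. -/
theorem not_mem_expAcl_of_exp_not_mem {a : ℂ} (h : cexp a ∉ expAcl) : a ∉ expAcl :=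
  fun ha => h (exp_mem_expAcl ha)

/-! ## §11 Mates of first failures: `stub_mateFirstFailure` of the PICKED line `kernel-arithmetic-selection` PROVED -/

section Mates

/-- **Relations transfer algebraic independence backwards**: if `x'` satisfies every ℚ-relation of
`(x, eˣ)`, an algebraically independent sub-family of `(x', e^{x'})` is algebraically independent for
`(x, eˣ)` at the same indices. [folklore] -/
theorem algebraicIndependent_of_relations {n : ℕ} {x x' : Fin n → ℂ}
    (hrel : ∀ p : MvPolynomial (Fin n ⊕ Fin n) ℚ,
      MvPolynomial.aeval (Sum.elim x (cexp ∘ x)) p = 0 →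
      MvPolynomial.aeval (Sum.elim x' (cexp ∘ x')) p = 0)
    {ι : Type*} (f : ι → Fin n ⊕ Fin n)
    (hind : AlgebraicIndependent ℚ (Sum.elim x' (cexp ∘ x') ∘ f)) :
    AlgebraicIndependent ℚ (Sum.elim x (cexp ∘ x) ∘ f) := by
  rw [algebraicIndependent_iff] at hind ⊢
  intro P hP
  refine hind P ?_
  have h1 : MvPolynomial.aeval (Sum.elim x (cexp ∘ x)) (MvPolynomial.rename f P) = 0 := by
    rw [MvPolynomial.aeval_rename]; exact hP
  have h2 := hrel _ h1
  rwa [MvPolynomial.aeval_rename] at h2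

/-- Hence the transcendence degree cannot go up along relations:
`m ≤ trdeg ℚ(x', e^{x'}) ⟹ m ≤ trdeg ℚ(x, eˣ)` for every natural `m`. [folklore] -/
theorem natCast_le_trdeg_of_relations {n : ℕ} {x x' : Fin n → ℂ}
    (hrel : ∀ p : MvPolynomial (Fin n ⊕ Fin n) ℚ,
      MvPolynomial.aeval (Sum.elim x (cexp ∘ x)) p = 0 →
      MvPolynomial.aeval (Sum.elim x' (cexp ∘ x')) p = 0)
    {m : ℕ}
    (hm : (m : Cardinal) ≤ Algebra.trdeg ℚ ↥(IntermediateField.adjoin ℚ (range x' ∪ range (cexp ∘ x')))) :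
    (m : Cardinal) ≤ Algebra.trdeg ℚ ↥(IntermediateField.adjoin ℚ (range x ∪ range (cexp ∘ x))) := by
  classical
  set v : Fin n ⊕ Fin n → ℂ := Sum.elim x (cexp ∘ x) with hv
  set v' : Fin n ⊕ Fin n → ℂ := Sum.elim x' (cexp ∘ x') with hv'
  have hS : range x ∪ range (cexp ∘ x) = range v := by rw [hv, Set.Sum.elim_range]
  have hS' : range x' ∪ range (cexp ∘ x') = range v' := by rw [hv', Set.Sum.elim_range]
  rw [hS] at ⊢
  rw [hS'] at hm
  -- an independent subset `J` of `range v'` of size `m`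
  have hm' : (m : ℕ∞) ≤ (GammaField.algMatroid ℂ).eRk (range v') :=
    ZilberHomogeneity.natCast_le_eRk_of_le_trdeg hm
  obtain ⟨J, hJsub, hJind, hJcard⟩ := Matroid.le_eRk_iff.1 hm'
  -- index it
  have hpre : ∀ j : J, ∃ i : Fin n ⊕ Fin n, v' i = (j : ℂ) := fun j => hJsub j.2
  choose f hf using hpre
  have hvf : v' ∘ f = (Subtype.val : J → ℂ) := funext hf
  have hJind' : AlgebraicIndependent ℚ (v' ∘ f) := by
    rw [hvf]
    exact (AlgebraicIndependent.matroid_indep_iff.1 hJind)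
  -- transfer to `v`
  have hind : AlgebraicIndependent ℚ (v ∘ f) := algebraicIndependent_of_relations hrel f hJind'
  have hinj : Function.Injective (v ∘ f) := hind.injective
  have hI : (GammaField.algMatroid ℂ).Indep (range (v ∘ f)) :=
    AlgebraicIndependent.matroid_indep_iff.2 hind.to_subtype_range
  have hIsub : range (v ∘ f) ⊆ range v := by
    rintro a ⟨j, rfl⟩; exact ⟨f j, rfl⟩
  have hcard : (range (v ∘ f)).encard = m := by
    rw [← hJcard, ← Set.image_univ, hinj.encard_image, Set.encard_univ]
    simp
  have hle : (m : ℕ∞) ≤ (GammaField.algMatroid ℂ).eRk (range v) := by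
    rw [← hcard]; exact hI.encard_le_eRk_of_subset hIsub
  exact le_trdeg_adjoin_of_natCast_le_eRk hle


/-- At a first-failure rank, an LI mate `x'` has an algebraically independent sub-family of
`(x', e^{x'})` of size `n − 1`, indexed injectively. [folklore] -/
theorem exists_indep_subfamily {n : ℕ} {x' : Fin n → ℂ} (hli : LinearIndependent ℚ x')
    (hrank : ∀ r < n, SchanuelRank r) :
    ∃ f : Fin (n - 1) → Fin n ⊕ Fin n, AlgebraicIndependent ℚ (Sum.elim x' (cexp ∘ x') ∘ f) := by
  classical
  set v' : Fin n ⊕ Fin n → ℂ := Sum.elim x' (cexp ∘ x') with hv'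
  have hS' : range x' ∪ range (cexp ∘ x') = range v' := by rw [hv', Set.Sum.elim_range]
  have hm : ((n - 1 : ℕ) : Cardinal) ≤
      Algebra.trdeg ℚ ↥(IntermediateField.adjoin ℚ (range x' ∪ range (cexp ∘ x'))) :=
    pred_le_trdeg_of_ranks_below hli hrank
  rw [hS'] at hm
  have hm' : ((n - 1 : ℕ) : ℕ∞) ≤ (GammaField.algMatroid ℂ).eRk (range v') :=
    ZilberHomogeneity.natCast_le_eRk_of_le_trdeg hm
  obtain ⟨J, hJsub, hJind, hJcard⟩ := Matroid.le_eRk_iff.1 hm'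
  have hpre : ∀ j : J, ∃ i : Fin n ⊕ Fin n, v' i = (j : ℂ) := fun j => hJsub j.2
  choose f hf using hpre
  have hvf : v' ∘ f = (Subtype.val : J → ℂ) := funext hf
  have hJind' : AlgebraicIndependent ℚ (v' ∘ f) := by
    rw [hvf]; exact AlgebraicIndependent.matroid_indep_iff.1 hJind
  -- reindex `J ≃ Fin (n-1)`
  have hfin : J.Finite := Set.finite_of_encard_eq_coe hJcard
  haveI : Fintype J := hfin.fintype
  have hcardJ : Fintype.card J = n - 1 := by
    have h := hJcard
    rw [Set.encard_eq_coe_toFinset_card, Set.toFinset_card] at h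
    exact_mod_cast h
  let e : Fin (n - 1) ≃ J := (Fintype.equivFinOfCardEq hcardJ).symm
  refine ⟨f ∘ e, ?_⟩
  have : v' ∘ (f ∘ e) = (v' ∘ f) ∘ e := rfl
  rw [this]
  exact hJind'.comp _ e.injective

/-- (dev copy of `mate_trdeg_lt`) [folklore] -/
theorem mate_trdeg_lt' {n : ℕ} {x x' : Fin n → ℂ}
    (htr : Algebra.trdeg ℚ ↥(IntermediateField.adjoin ℚ (range x ∪ range (cexp ∘ x))) < (n : Cardinal))
    (hrel : ∀ p : MvPolynomial (Fin n ⊕ Fin n) ℚ,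
      MvPolynomial.aeval (Sum.elim x (cexp ∘ x)) p = 0 →
      MvPolynomial.aeval (Sum.elim x' (cexp ∘ x')) p = 0) :
    Algebra.trdeg ℚ ↥(IntermediateField.adjoin ℚ (range x' ∪ range (cexp ∘ x'))) < (n : Cardinal) := by
  by_contra h
  exact (not_le.2 htr) (natCast_le_trdeg_of_relations hrel (not_lt.1 h))

/-- **The locus of a mate is the locus** (second half of `stub_mateFirstFailure`): if `x'` is a
ℚ-linearly independent tuple satisfying every ℚ-relation of a first failure `x`, then conversely `x`
satisfies every ℚ-relation of `x'` — the relation ideals coincide.  (Prime ideals `P ⊆ P'` of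
`ℚ[X, Y]` whose quotients `ℚ[x, eˣ] ↠ ℚ[x', e^{x'}]` have the same transcendence degree `n − 1` are
equal: lift an algebraically independent `(n−1)`-sub-family `v' ∘ f` to `v ∘ f`; a relation `p` of `x'`
evaluates at `(x, eˣ)` to an element `a` algebraic over `ℚ[v ∘ f]`, with a relation of non-zero constant
term `g₀(v ∘ f)` if `a ≠ 0`; transporting that relation along `P ⊆ P'` kills `g₀(v' ∘ f)`, so `g₀ = 0`.)
[cite: Kirby2010, §1] -/
theorem mate_relations_symm {n : ℕ} {x x' : Fin n → ℂ}
    (hx : LinearIndependent ℚ x ∧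
      Algebra.trdeg ℚ ↥(IntermediateField.adjoin ℚ (range x ∪ range (cexp ∘ x))) < (n : Cardinal) ∧
      ∀ r < n, SchanuelRank r)
    (hx' : LinearIndependent ℚ x' ∧ ∀ p : MvPolynomial (Fin n ⊕ Fin n) ℚ,
      MvPolynomial.aeval (Sum.elim x (cexp ∘ x)) p = 0 →
      MvPolynomial.aeval (Sum.elim x' (cexp ∘ x')) p = 0)
    (p : MvPolynomial (Fin n ⊕ Fin n) ℚ)
    (hp : MvPolynomial.aeval (Sum.elim x' (cexp ∘ x')) p = 0) :
    MvPolynomial.aeval (Sum.elim x (cexp ∘ x)) p = 0 := by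
  classical
  set v : Fin n ⊕ Fin n → ℂ := Sum.elim x (cexp ∘ x) with hv
  set v' : Fin n ⊕ Fin n → ℂ := Sum.elim x' (cexp ∘ x') with hv'
  have hrel : ∀ q : MvPolynomial (Fin n ⊕ Fin n) ℚ,
      MvPolynomial.aeval v q = 0 → MvPolynomial.aeval v' q = 0 := hx'.2
  have hn : 1 ≤ n := le_trans (by norm_num) (two_le_of_isFirstFailure (x := x) ⟨hx.1, hx.2.1, hx.2.2⟩)
  -- an independent `(n-1)`-sub-family of `v'`, pulled back to `v`
  obtain ⟨f, hf'⟩ := exists_indep_subfamily hx'.1 hx.2.2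
  have hf : AlgebraicIndependent ℚ (v ∘ f) := algebraicIndependent_of_relations hrel f hf'
  set a : ℂ := MvPolynomial.aeval v p with ha
  by_contra ha0
  set B : Subalgebra ℚ ℂ := Algebra.adjoin ℚ (range (v ∘ f)) with hB
  -- Step A: `a` is algebraic over `B` (`(a, v ∘ f)` are `n` elements of `ℚ(x, eˣ)`, `trdeg < n`)
  have halg : IsAlgebraic B a := by
    by_contra htr
    have hind : AlgebraicIndependent ℚ (fun o : Option (Fin (n - 1)) => o.elim a (v ∘ f)) :=
      AlgebraicIndependent.option_iff.2 ⟨hf, htr⟩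
    set K := IntermediateField.adjoin ℚ (range x ∪ range (cexp ∘ x)) with hK
    have hvK : ∀ i, v i ∈ K := by
      rintro (i | i)
      · exact IntermediateField.subset_adjoin ℚ _ (Or.inl ⟨i, rfl⟩)
      · exact IntermediateField.subset_adjoin ℚ _ (Or.inr ⟨i, rfl⟩)
    have haK : a ∈ K := by
      rw [ha, MvPolynomial.aeval_def, MvPolynomial.eval₂_eq]
      refine sum_mem fun m _ => mul_mem ?_ (prod_mem fun i _ => pow_mem (hvK i) _)
      exact (algebraMap ℚ K (p.coeff m)).2
    have hmemK : ∀ o : Option (Fin (n - 1)), (o.elim a (v ∘ f) : ℂ) ∈ K := by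
      rintro (_ | i)
      · exact haK
      · exact hvK (f i)
    let w : Option (Fin (n - 1)) → K := fun o => ⟨o.elim a (v ∘ f), hmemK o⟩
    have hw : AlgebraicIndependent ℚ w := AlgebraicIndependent.of_comp K.val hind
    have hle := hw.cardinalMk_le_trdeg
    have hcard : Cardinal.mk (Option (Fin (n - 1))) = (n : Cardinal) := by
      rw [Cardinal.mk_option, Cardinal.mk_fin]
      have : ((n - 1 : ℕ) : Cardinal) + 1 = ((n - 1 + 1 : ℕ) : Cardinal) := by push_cast; rfl
      rw [this, Nat.sub_add_cancel hn]
    rw [hcard] at hle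
    exact (not_le.2 hx.2.1) hle
  -- Step B: a relation of `a` over `B` with non-zero constant term
  obtain ⟨q, hq0, hqa⟩ := halg
  obtain ⟨q₁, hq₁, hndvd⟩ := Polynomial.exists_eq_pow_rootMultiplicity_mul_and_not_dvd q hq0 0
  have hq₁0 : q₁.coeff 0 ≠ 0 := by
    intro h0
    apply hndvd
    rw [map_zero, sub_zero]
    exact Polynomial.X_dvd_iff.2 h0
  have hq₁a : Polynomial.aeval a q₁ = 0 := by
    have h := hqa
    rw [hq₁, map_mul, map_pow, map_sub, Polynomial.aeval_X, Polynomial.aeval_C, map_zero,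
      sub_zero] at h
    exact (mul_eq_zero.1 h).resolve_left (pow_ne_zero _ ha0)
  -- Step C: coefficients of `q₁` as polynomials in `v ∘ f`
  have hcoef : ∀ j : ℕ, ∃ g : MvPolynomial (Fin (n - 1)) ℚ,
      MvPolynomial.aeval (v ∘ f) g = ((q₁.coeff j : B) : ℂ) := by
    intro j
    have hmem : ((q₁.coeff j : B) : ℂ) ∈ Algebra.adjoin ℚ (range (v ∘ f)) := (q₁.coeff j).2
    rw [Algebra.adjoin_range_eq_range_aeval] at hmem
    obtain ⟨g, hg⟩ := hmem
    exact ⟨g, hg⟩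
  choose g hg using hcoef
  -- Step D: the transported relation `G := Σ_j (rename f g_j) · p^j`
  set N := q₁.natDegree + 1 with hN
  set G : MvPolynomial (Fin n ⊕ Fin n) ℚ :=
    ∑ j ∈ Finset.range N, MvPolynomial.rename f (g j) * p ^ j with hG
  have hGv : MvPolynomial.aeval v G = Polynomial.aeval a q₁ := by
    rw [Polynomial.aeval_eq_sum_range, hG, map_sum]
    refine Finset.sum_congr rfl fun j _ => ?_
    rw [map_mul, map_pow, MvPolynomial.aeval_rename, hg j, Algebra.smul_def]
    rfl
  have hG0 : MvPolynomial.aeval v G = 0 := by rw [hGv, hq₁a]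
  have hG0' : MvPolynomial.aeval v' G = 0 := hrel G hG0
  have hpv' : MvPolynomial.aeval v' p = 0 := hp
  have hGv' : MvPolynomial.aeval v' G = MvPolynomial.aeval (v' ∘ f) (g 0) := by
    rw [hG, map_sum, Finset.sum_eq_single 0]
    · rw [map_mul, pow_zero, map_one, mul_one, MvPolynomial.aeval_rename]
    · intro j _ hj
      rw [map_mul, map_pow, hpv', zero_pow hj, mul_zero]
    · intro h
      exact absurd (Finset.mem_range.2 (by rw [hN]; omega)) h
  have hg0 : g 0 = 0 := by
    apply algebraicIndependent_iff.1 hf'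
    rw [← hGv']
    exact hG0'
  apply hq₁0
  have hc : ((q₁.coeff 0 : B) : ℂ) = 0 := by rw [← hg 0, hg0, map_zero]
  exact_mod_cast hc

/-- Hence **the locus of a mate is the locus** as sets: the registered set-equality conjunct of
`stub_mateFirstFailure`. [cite: Kirby2010, §1] -/
theorem mate_locus_eq {n : ℕ} {x x' : Fin n → ℂ}
    (hx : LinearIndependent ℚ x ∧
      Algebra.trdeg ℚ ↥(IntermediateField.adjoin ℚ (range x ∪ range (cexp ∘ x))) < (n : Cardinal) ∧
      ∀ r < n, SchanuelRank r)
    (hx' : LinearIndependent ℚ x' ∧ ∀ p : MvPolynomial (Fin n ⊕ Fin n) ℚ,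
      MvPolynomial.aeval (Sum.elim x (cexp ∘ x)) p = 0 →
      MvPolynomial.aeval (Sum.elim x' (cexp ∘ x')) p = 0) :
    {x'' : Fin n → ℂ | ∀ p : MvPolynomial (Fin n ⊕ Fin n) ℚ,
        MvPolynomial.aeval (Sum.elim x' (cexp ∘ x')) p = 0 →
        MvPolynomial.aeval (Sum.elim x'' (cexp ∘ x'')) p = 0} =
    {x'' : Fin n → ℂ | ∀ p : MvPolynomial (Fin n ⊕ Fin n) ℚ,
        MvPolynomial.aeval (Sum.elim x (cexp ∘ x)) p = 0 →
        MvPolynomial.aeval (Sum.elim x'' (cexp ∘ x'')) p = 0} := by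
  ext x''
  simp only [mem_setOf_eq]
  constructor
  · intro h p hp
    exact h p (hx'.2 p hp)
  · intro h p hp
    exact h p (mate_relations_symm hx hx' p hp)


/-- **A mate of a first failure is a first failure** (Disproof vocabulary). -/
theorem IsFirstFailure.of_mem_locusMates {n : ℕ} {x x' : Fin n → ℂ} (hx : IsFirstFailure x)
    (hx' : x' ∈ locusMates x) : IsFirstFailure x' :=
  ⟨hx'.1, mate_trdeg_lt' hx.2.1 hx'.2, hx.2.2⟩

/-- **The mate relation is symmetric on first failures**: `x ∈ locusMates x'`. -/
theorem locusMates_symm {n : ℕ} {x x' : Fin n → ℂ} (hx : IsFirstFailure x)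
    (hx' : x' ∈ locusMates x) : x ∈ locusMates x' :=
  ⟨hx.1, fun p hp => mate_relations_symm ⟨hx.1, hx.2.1, hx.2.2⟩ hx' p hp⟩

/-- … so mates of a first failure have the SAME mate set (the mate family is one "locus class"). -/
theorem locusMates_eq_of_mem {n : ℕ} {x x' : Fin n → ℂ} (hx : IsFirstFailure x)
    (hx' : x' ∈ locusMates x) : locusMates x' = locusMates x := by
  ext x''
  constructor
  · rintro ⟨hli, h⟩
    exact ⟨hli, fun p hp => h p (hx'.2 p hp)⟩
  · rintro ⟨hli, h⟩
    exact ⟨hli, fun p hp => h p (mate_relations_symm ⟨hx.1, hx.2.1, hx.2.2⟩ hx' p hp)⟩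

/-- **Stub T1 of `span-growth-dichotomy` (`stub_matePredim`) PROVED**: a mate of a first failure has
`δ(⟨x'⟩_ℚ/0) ≤ −1` (indeed `= −1`: `IsFirstFailure.predim_eq` applied to the mate, which is a first
failure by `IsFirstFailure.of_mem_locusMates`). -/
theorem stub_matePredim_holds {n : ℕ} {x : Fin n → ℂ} (hx : IsFirstFailure x)
    {x' : Fin n → ℂ} (hx' : x' ∈ locusMates x) :
    GammaField.predim (⊥ : Submodule ℚ ℂ) (Submodule.span ℚ (range x')) ≤ -1 :=
  (hx.of_mem_locusMates hx').predim_le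

/-- … with equality. -/
theorem matePredim_eq {n : ℕ} {x : Fin n → ℂ} (hx : IsFirstFailure x)
    {x' : Fin n → ℂ} (hx' : x' ∈ locusMates x) :
    GammaField.predim (⊥ : Submodule ℚ ℂ) (Submodule.span ℚ (range x')) = -1 :=
  (hx.of_mem_locusMates hx').predim_eq

end Mates

/-! ## §12 Conjugation symmetry: first failures come in conjugate pairs; the `dcl` strengthening forces them to be real -/

/-- `ℚ(conj S) = conj(ℚ(S))` has the same transcendence degree. -/
theorem trdeg_adjoin_conj (S : Set ℂ) :
    Algebra.trdeg ℚ ↥(IntermediateField.adjoin ℚ ((starRingEnd ℂ) '' S)) =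
      Algebra.trdeg ℚ ↥(IntermediateField.adjoin ℚ S) := by
  have hmap : IntermediateField.adjoin ℚ ((starRingEnd ℂ) '' S) = (IntermediateField.adjoin ℚ S).map conjQ := by
    rw [IntermediateField.adjoin_map]; rfl
  rw [hmap]
  exact ((IntermediateField.adjoin ℚ S).equivMap conjQ).symm.trdeg_eq

/-- The range data of the conjugate tuple. -/
theorem range_conj_union {n : ℕ} (x : Fin n → ℂ) :
    range ((starRingEnd ℂ) ∘ x) ∪ range (cexp ∘ ((starRingEnd ℂ) ∘ x)) =
      (starRingEnd ℂ) '' (range x ∪ range (cexp ∘ x)) := by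
  have hcomp : cexp ∘ ((starRingEnd ℂ) ∘ x) = (starRingEnd ℂ) ∘ (cexp ∘ x) := by
    funext i
    simp [Complex.exp_conj]
  rw [hcomp, Set.image_union, ← Set.range_comp, ← Set.range_comp]

/-- **First failures come in conjugate pairs** (`conj` is an automorphism of `ℂ_exp`). -/
theorem IsFirstFailure.conj {n : ℕ} {x : Fin n → ℂ} (hx : IsFirstFailure x) :
    IsFirstFailure ((starRingEnd ℂ) ∘ x) := by
  refine ⟨?_, ?_, hx.2.2⟩
  · exact hx.1.map' (conjQ.toLinearMap) (LinearMap.ker_eq_bot_of_injective (starRingEnd ℂ).injective)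
  · have hS : IntermediateField.adjoin ℚ (range ((starRingEnd ℂ) ∘ x) ∪ range (cexp ∘ ((starRingEnd ℂ) ∘ x))) =
        (IntermediateField.adjoin ℚ (range x ∪ range (cexp ∘ x))).map conjQ := by
      rw [range_conj_union, IntermediateField.adjoin_map]; rfl
    have e := (IntermediateField.equivOfEq hS).trans
      ((IntermediateField.adjoin ℚ (range x ∪ range (cexp ∘ x))).equivMap conjQ).symm
    calc Algebra.trdeg ℚ ↥(IntermediateField.adjoin ℚ
          (range ((starRingEnd ℂ) ∘ x) ∪ range (cexp ∘ ((starRingEnd ℂ) ∘ x))))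
        ≤ Algebra.trdeg ℚ ↥(IntermediateField.adjoin ℚ (range x ∪ range (cexp ∘ x))) :=
          trdeg_le_of_injective e.toAlgHom e.injective
      _ < n := hx.2.1

/-- … and `acl^{ℂ_exp}(∅)` is `conj`-stable (sibling `conj_mem_expAcl`), so the crux is `conj`-symmetric:
it holds at `x` iff it holds at `conj ∘ x`. -/
theorem crux_at_conj_iff {n : ℕ} (x : Fin n → ℂ) :
    (∀ i, ((starRingEnd ℂ) ∘ x) i ∈ expAcl) ↔ ∀ i, x i ∈ expAcl := by
  constructor
  · intro h i
    have := conj_mem_expAcl (h i)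
    simpa using this
  · intro h i
    exact conj_mem_expAcl (h i)

/-- The `dcl` STRENGTHENING of the crux: every coordinate of a first failure is POINTWISE `∅`-definable. -/
def WithDcl : Prop :=
  ∀ (n : ℕ) (x : Fin n → ℂ), IsFirstFailure x → ∀ i, x i ∈ expDcl

/-- **`WithDcl` forces every first failure to be REAL** (`dcl^{ℂ_exp}(∅) ⊆ ℝ` by conjugation symmetry,
sibling `expDcl_subset_range_ofReal`) — whereas first failures come in conjugate pairs
(`IsFirstFailure.conj`).  Not refutable (no non-real Schanuel counterexample is known either), but any
proof through pointwise definability would prove "Schanuel fails only at real tuples". -/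
theorem withDcl_forces_real (h : WithDcl) {n : ℕ} {x : Fin n → ℂ} (hx : IsFirstFailure x) (i : Fin n) :
    (x i).im = 0 := by
  obtain ⟨r, hr⟩ := expDcl_subset_range_ofReal (h n x hx i)
  rw [← hr, Complex.ofReal_im]

/-- `WithDcl` implies the crux (`dcl ⊆ acl`). -/
theorem crux_of_withDcl (h : WithDcl) :
    Summit.Schanuel.Schanuel.Theses.RigidCore.MinimalCounterexampleInAcl :=
  crux_iff.2 fun n x hx i => expDcl_subset_expAcl (h n x hx i)

/-! ## §13 `stub_endgame` of the PICKED line PROVED (also `Negative/Endgame.lean` p75280, `StubsProved6.lean`) -/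

section Endgame

/-! #### Linear algebra: a rational frame adapted to `ker q` -/

/-- For `m` ℚ-linearly independent rational forms `q` on `ℚⁿ` there are `r = n − m` rational vectors
`d_k` killed by every `q_j` together with rational "dual" vectors `c_k` (`c_k · d_{k'} = δ_{kk'}`).
[folklore] -/
theorem exists_kernel_frame {n m : ℕ} (q : Fin m → Fin n → ℚ) (hq : LinearIndependent ℚ q) :
    ∃ (r : ℕ) (d c : Fin r → Fin n → ℚ), r + m = n ∧
      (∀ j k, ∑ i, q j i * d k i = 0) ∧ (∀ k k', ∑ i, c k i * d k' i = if k = k' then 1 else 0) := by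
  classical
  let Q : (Fin n → ℚ) →ₗ[ℚ] (Fin m → ℚ) := Matrix.mulVecLin (q : Matrix (Fin m) (Fin n) ℚ)
  have hQ : ∀ z j, Q z j = ∑ i, q j i * z i := fun z j => by
    simp [Q, Matrix.mulVec, dotProduct]
  have hrank : Module.finrank ℚ (LinearMap.range Q) = m := by
    have h := LinearIndependent.rank_matrix (M := (q : Matrix (Fin m) (Fin n) ℚ)) hq
    simpa [Matrix.rank] using h
  have hker : Module.finrank ℚ (LinearMap.ker Q) + m = n := by
    have h := LinearMap.finrank_range_add_finrank_ker Q
    rw [hrank, Module.finrank_fin_fun] at h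
    omega
  set r := Module.finrank ℚ (LinearMap.ker Q) with hr
  let b := Module.finBasis ℚ (LinearMap.ker Q)
  let d : Fin r → Fin n → ℚ := fun k => (LinearMap.ker Q).subtype (b k)
  have hd_ker : ∀ k, Q (d k) = 0 := fun k => (b k).2
  have hdli : LinearIndependent ℚ d :=
    b.linearIndependent.map' (LinearMap.ker Q).subtype (Submodule.ker_subtype _)
  let D : (Fin r → ℚ) →ₗ[ℚ] (Fin n → ℚ) := Fintype.linearCombination ℚ d
  have hD : ∀ t, D t = ∑ k, t k • d k := fun t => Fintype.linearCombination_apply ℚ d t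
  have hDker : LinearMap.ker D = ⊥ := by
    rw [LinearMap.ker_eq_bot']
    intro t ht
    rw [hD] at ht
    exact funext ((Fintype.linearIndependent_iff.1 hdli) t ht)
  obtain ⟨π, hπ⟩ := LinearMap.exists_leftInverse_of_injective D hDker
  have hπD : ∀ t, π (D t) = t := fun t => by
    have := LinearMap.congr_fun hπ t
    simpa using this
  let c : Fin r → Fin n → ℚ := fun k i => π (Pi.single i 1) k
  refine ⟨r, d, c, hker, fun j k => ?_, fun k k' => ?_⟩
  · have h := congrFun (hd_ker k) j
    rw [hQ] at h
    simpa using h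
  · -- `Σ_i c k i * d k' i = (π (d k')) k = (π (D e_{k'})) k = e_{k'} k`
    have h1 : ∑ i, c k i * d k' i = (π (d k')) k := by
      have hsum : π (d k') = ∑ i, d k' i • π (Pi.single i 1) := by
        conv_lhs => rw [pi_eq_sum_univ' (d k')]
        rw [map_sum]
        refine Finset.sum_congr rfl fun i _ => ?_
        rw [map_smul]
      rw [hsum, Finset.sum_apply]
      refine Finset.sum_congr rfl fun i _ => ?_
      simp [c, mul_comm]
    have h2 : d k' = D (Pi.single k' 1) := by
      rw [hD]
      rw [Finset.sum_eq_single k']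
      · simp
      · intro k'' _ hne
        simp [hne]
      · intro h; exact absurd (Finset.mem_univ _) h
    rw [h1, h2, hπD]
    simp [Pi.single_apply]

/-! #### The spreading map `ψ : ℚ[X,Y] → ℂ[T]` -/

section Spread

variable {n r : ℕ} (x : Fin n → ℂ) (d : Fin r → Fin n → ℚ)

/-- The spreading map `ψ : ℚ[X,Y] → ℂ[T₁,…,T_r]`, `X_i ↦ x_i + Σ_k d_{k,i} T_k`, `Y_i ↦ e^{x_i}`. -/
def spreadMap : MvPolynomial (Fin n ⊕ Fin n) ℚ →ₐ[ℚ] MvPolynomial (Fin r) ℂ :=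
  MvPolynomial.aeval
    (Sum.elim (fun i => MvPolynomial.C (x i) + ∑ k, MvPolynomial.C (((d k i : ℚ) : ℂ)) * MvPolynomial.X k)
      (fun i => MvPolynomial.C (cexp (x i))))

/-- Evaluating `ψ p` at `t ∈ ℂ^r` is evaluating `p` at the point `(x + Σ t_k d_k, eˣ)`. [folklore] -/
theorem eval_spreadMap (t : Fin r → ℂ) (p : MvPolynomial (Fin n ⊕ Fin n) ℚ) :
    MvPolynomial.eval t (spreadMap x d p) =
      MvPolynomial.aeval (Sum.elim (fun i => x i + ∑ k, (((d k i : ℚ) : ℂ)) * t k) (cexp ∘ x)) p := by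
  have key : ((MvPolynomial.aeval t : MvPolynomial (Fin r) ℂ →ₐ[ℂ] ℂ).restrictScalars ℚ).comp
      (spreadMap x d) =
      MvPolynomial.aeval (Sum.elim (fun i => x i + ∑ k, (((d k i : ℚ) : ℂ)) * t k) (cexp ∘ x)) := by
    refine MvPolynomial.algHom_ext fun s => ?_
    rcases s with i | i
    · simp [spreadMap, mul_comm]
    · simp [spreadMap]
  have h := congrArg (fun f => f p) key
  simpa [MvPolynomial.coe_aeval_eq_eval] using h

/-- `ψ` of a rational linear form `Σ a_i X_i`. [folklore] -/
theorem spreadMap_linearForm (a : Fin n → ℚ) :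
    spreadMap x d (∑ i, MvPolynomial.C (a i) * MvPolynomial.X (Sum.inl i)) =
      MvPolynomial.C (∑ i, ((a i : ℚ) : ℂ) * x i) +
        ∑ k, MvPolynomial.C (((∑ i, a i * d k i : ℚ) : ℂ)) * MvPolynomial.X k := by
  apply MvPolynomial.funext
  intro t
  rw [eval_spreadMap]
  simp only [map_sum, map_mul, map_add, MvPolynomial.aeval_C, MvPolynomial.aeval_X, Sum.elim_inl,
    MvPolynomial.eval_C, MvPolynomial.eval_X, eq_ratCast, Rat.cast_sum, Rat.cast_mul]
  simp only [mul_add, Finset.sum_add_distrib, Finset.mul_sum, Finset.sum_mul]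
  congr 1
  rw [Finset.sum_comm]
  refine Finset.sum_congr rfl fun k _ => Finset.sum_congr rfl fun i _ => ?_
  ring

/-- `ψ (Y_i) = C (e^{x_i})`. [folklore] -/
theorem spreadMap_Y (i : Fin n) :
    spreadMap x d (MvPolynomial.X (Sum.inr i)) = MvPolynomial.C (cexp (x i)) := by
  simp [spreadMap]

end Spread

/-! #### Shifted variables plus algebraically independent constants stay algebraically independent -/

/-- In `ℂ[T₁,…,T_r]`, the family consisting of the shifted variables `C a_k + T_k` and the constants
`C (g j)` for a ℚ-algebraically independent family `g` of complex numbers is ℚ-algebraically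
independent. [folklore] -/
theorem algebraicIndependent_shift_constants {r : ℕ} {ι : Type*} (a : Fin r → ℂ) {g : ι → ℂ}
    (hg : AlgebraicIndependent ℚ g) :
    AlgebraicIndependent ℚ
      (Sum.elim (fun k => MvPolynomial.C (a k) + MvPolynomial.X k) (fun j => MvPolynomial.C (g j)) :
        Fin r ⊕ ι → MvPolynomial (Fin r) ℂ) := by
  classical
  set Φ : Fin r ⊕ ι → MvPolynomial (Fin r) ℂ :=
    Sum.elim (fun k => MvPolynomial.C (a k) + MvPolynomial.X k) (fun j => MvPolynomial.C (g j)) with hΦ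
  set Φ' : Fin r ⊕ ι → MvPolynomial (Fin r) ℂ :=
    Sum.elim (fun k => MvPolynomial.X k) (fun j => MvPolynomial.C (g j)) with hΦ'
  rw [algebraicIndependent_iff]
  intro G hG
  -- shift the variables back: `τ (T_k) = T_k − a_k`
  set τ : MvPolynomial (Fin r) ℂ →ₐ[ℂ] MvPolynomial (Fin r) ℂ :=
    MvPolynomial.aeval (fun k => MvPolynomial.X k - MvPolynomial.C (a k)) with hτ
  have hτΦ : ∀ G' : MvPolynomial (Fin r ⊕ ι) ℚ,
      (τ.restrictScalars ℚ) (MvPolynomial.aeval Φ G') = MvPolynomial.aeval Φ' G' := by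
    intro G'
    have hcomp := MvPolynomial.comp_aeval Φ (τ.restrictScalars ℚ)
    rw [← AlgHom.comp_apply, hcomp]
    have hfun : (fun i => (τ.restrictScalars ℚ) (Φ i)) = Φ' := by
      funext i
      rcases i with k | j
      · simp [hΦ, hΦ', hτ]
      · simp [hΦ, hΦ', hτ]
    rw [hfun]
  have h0 : MvPolynomial.aeval Φ' G = 0 := by rw [← hτΦ, hG, map_zero]
  -- `aeval Φ'` = (map the coefficients by `aeval g`) ∘ (separate the variables)
  set agg : MvPolynomial ι ℚ →+* ℂ := (MvPolynomial.aeval g : MvPolynomial ι ℚ →ₐ[ℚ] ℂ).toRingHom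
    with hagg
  have hkey : (MvPolynomial.aeval Φ' : MvPolynomial (Fin r ⊕ ι) ℚ →ₐ[ℚ] MvPolynomial (Fin r) ℂ).toRingHom =
      (MvPolynomial.map agg).comp (MvPolynomial.sumRingEquiv ℚ (Fin r) ι).toRingHom := by
    refine MvPolynomial.ringHom_ext (fun q => ?_) (fun i => ?_)
    · simp [hagg, MvPolynomial.sumRingEquiv_C]
    · rcases i with k | j
      · simp [hagg, hΦ', MvPolynomial.sumRingEquiv_X_inl]
      · simp [hagg, hΦ', MvPolynomial.sumRingEquiv_X_inr]
  have h1 : MvPolynomial.map agg (MvPolynomial.sumRingEquiv ℚ (Fin r) ι G) = 0 := by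
    have h := RingHom.congr_fun hkey G
    simp only [RingHom.coe_comp, Function.comp_apply, RingEquiv.toRingHom_eq_coe,
      RingEquiv.coe_toRingHom] at h
    rw [← h]
    exact h0
  have hinj : Function.Injective agg := algebraicIndependent_iff_injective_aeval.1 hg
  have h2 : MvPolynomial.sumRingEquiv ℚ (Fin r) ι G = 0 :=
    MvPolynomial.map_injective agg hinj (by rw [h1, map_zero])
  exact (MvPolynomial.sumRingEquiv ℚ (Fin r) ι).injective (by rw [h2, map_zero])

/-! #### Small facts for the endgame -/

/-- `e^{a} ∈ ℚ(e^{x₁},…,e^{xₙ})` for `a` in the `ℤ`-span of `x`. [folklore] -/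
theorem exp_mem_adjoin_exp_of_mem_span_int {ι : Type*} (x : ι → ℂ) {a : ℂ}
    (ha : a ∈ Submodule.span ℤ (Set.range x)) :
    cexp a ∈ IntermediateField.adjoin ℚ (Set.range (cexp ∘ x)) := by
  set K := IntermediateField.adjoin ℚ (Set.range (cexp ∘ x))
  induction ha using Submodule.span_induction with
  | mem b hb =>
    obtain ⟨i, rfl⟩ := hb
    exact IntermediateField.subset_adjoin ℚ _ ⟨i, rfl⟩
  | zero => rw [Complex.exp_zero]; exact one_mem K
  | add b c _ _ hb hc => rw [Complex.exp_add]; exact mul_mem hb hc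
  | smul m b _ hb =>
    rw [zsmul_eq_mul, Complex.exp_int_mul]
    exact zpow_mem hb m

/-- Independent rational forms of an independent tuple form an independent tuple. [folklore] -/
theorem linearIndependent_forms {n m : ℕ} {x : Fin n → ℂ} (hx : LinearIndependent ℚ x)
    {q : Fin m → Fin n → ℚ} (hq : LinearIndependent ℚ q) :
    LinearIndependent ℚ (fun j => ∑ i, ((q j i : ℚ) : ℂ) * x i) := by
  rw [Fintype.linearIndependent_iff]
  intro s hs
  -- `Σ_j s_j (Σ_i q_ji x_i) = Σ_i (Σ_j s_j q_ji) x_i = 0`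
  have h1 : ∑ i, ((∑ j, s j * q j i : ℚ) : ℂ) * x i = 0 := by
    rw [← hs]
    simp only [Rat.cast_sum, Rat.cast_mul, Finset.sum_mul, Rat.smul_def, Finset.mul_sum]
    rw [Finset.sum_comm]
    refine Finset.sum_congr rfl fun j _ => Finset.sum_congr rfl fun i _ => ?_
    ring
  have h2 : ∀ i, ∑ j, s j * q j i = 0 := by
    have h := (Fintype.linearIndependent_iff.1 hx) (fun i => ∑ j, s j * q j i) (by
      rw [← h1]
      refine Finset.sum_congr rfl fun i _ => ?_
      rw [Rat.smul_def])
    exact h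
  have h3 : ∑ j, s j • q j = 0 := by
    funext i
    simp only [Finset.sum_apply, Pi.smul_apply, smul_eq_mul, Pi.zero_apply]
    exact h2 i
  exact (Fintype.linearIndependent_iff.1 hq) s h3

/-! #### The endgame: a rational affine subspace inside the frozen fibre is a smaller counterexample -/

/-- **`stub_endgame` of the PICKED line `kernel-arithmetic-selection`, VERBATIM, proved.**  If `x` is a
first failure of rank `n`, `m < n`, `q` are `m` independent rational forms and the affine space
`{z | q z = q x}` lies in the frozen fibre `{z | ∀ p ∈ rel x, p(z, eˣ) = 0}`, then `False`: spreading
the fibre along a kernel frame (`spreadMap`) realises `ℚ[x, eˣ]` inside `ℂ[T₁..T_r]` (`r = n − m`)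
with `r` shifted variables `c_k·x + T_k` and `m` algebraically independent constants among
`q x ∪ eˣ` (from `SchanuelRank m` applied to `y = q x`, whose exponentials are algebraic over `ℚ(eˣ)`);
pulling back gives `n = r + m` algebraically independent elements of `ℚ(x, eˣ)`, against `trdeg < n`.
[cite: Kirby2010, §1] -/
theorem stub_endgame_holds : ∀ (n : ℕ) (x : Fin n → ℂ), (LinearIndependent ℚ x ∧ Algebra.trdeg ℚ ↥(IntermediateField.adjoin ℚ (Set.range x ∪ Set.range (Complex.exp ∘ x))) < (n : Cardinal) ∧ ∀ r < n, Literature.NumberTheory.Transcendental.SchanuelRank r) → ∀ (m : ℕ), m < n → ∀ (q : Fin m → Fin n → ℚ), LinearIndependent ℚ q → (∀ z : Fin n → ℂ, (∀ j, ∑ i, (q j i : ℂ) * z i = ∑ i, (q j i : ℂ) * x i) → ∀ p : MvPolynomial (Fin n ⊕ Fin n) ℚ, MvPolynomial.aeval (Sum.elim x (Complex.exp ∘ x)) p = 0 → MvPolynomial.aeval (Sum.elim z (Complex.exp ∘ x)) p = 0) → False := by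
  intro n x hx m hm q hq H
  classical
  obtain ⟨r, d, c, hrm, hqd, hcd⟩ := exists_kernel_frame q hq
  set v : Fin n ⊕ Fin n → ℂ := Sum.elim x (cexp ∘ x) with hv
  -- (A) every relation of `(x, eˣ)` dies under the spreading map
  have hψ : ∀ p : MvPolynomial (Fin n ⊕ Fin n) ℚ, MvPolynomial.aeval v p = 0 → spreadMap x d p = 0 := by
    intro p hp
    apply MvPolynomial.funext
    intro t
    rw [eval_spreadMap, map_zero]
    refine H _ (fun j => ?_) p hp
    simp only [mul_add, Finset.sum_add_distrib, Finset.mul_sum]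
    have hzero : ∑ i, ∑ k, ((q j i : ℚ) : ℂ) * ((((d k i : ℚ)) : ℂ) * t k) = 0 := by
      rw [Finset.sum_comm]
      refine Finset.sum_eq_zero fun k _ => ?_
      have h' : ∑ i, ((q j i : ℚ) : ℂ) * ((d k i : ℚ) : ℂ) = 0 := by
        have h := hqd j k
        have : ((∑ i, q j i * d k i : ℚ) : ℂ) = 0 := by rw [h, Rat.cast_zero]
        simpa [Rat.cast_sum, Rat.cast_mul] using this
      calc ∑ i, ((q j i : ℚ) : ℂ) * ((((d k i : ℚ)) : ℂ) * t k)
          = (∑ i, ((q j i : ℚ) : ℂ) * ((d k i : ℚ) : ℂ)) * t k := by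
            rw [Finset.sum_mul]
            refine Finset.sum_congr rfl fun i _ => ?_
            ring
        _ = 0 := by rw [h', zero_mul]
    rw [hzero, add_zero]
  -- (B) `y = q x`, the generators `g = (y, eˣ)`, and `m` independent elements among them
  set y : Fin m → ℂ := fun j => ∑ i, ((q j i : ℚ) : ℂ) * x i with hy
  have hyli : LinearIndependent ℚ y := linearIndependent_forms hx.1 hq
  set g : Fin m ⊕ Fin n → ℂ := Sum.elim y (cexp ∘ x) with hg
  have hy_span : ∀ j, y j ∈ Submodule.span ℚ (Set.range x) := fun j =>
    Submodule.sum_mem _ fun i _ => by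
      have hsm : ((q j i : ℚ) : ℂ) * x i = (q j i : ℚ) • x i := by rw [Rat.smul_def]
      rw [hsm]
      exact Submodule.smul_mem _ _ (Submodule.subset_span ⟨i, rfl⟩)
  have hsub : Set.range y ∪ Set.range (cexp ∘ y) ⊆ GammaField.acl (Set.range g) := by
    rintro w (⟨j, rfl⟩ | ⟨j, rfl⟩)
    · exact GammaField.subset_acl _ ⟨Sum.inl j, rfl⟩
    · -- `(e^{y_j})^N ∈ ℚ(eˣ) ⊆ ℚ(g) ⊆ acl (range g)`
      obtain ⟨N, hN, hNmem⟩ := exists_nsmul_mem_span_int x (hy_span j)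
      have hpow : cexp (y j) ^ N ∈ GammaField.acl (Set.range g) := by
        have h1 : cexp ((N : ℚ) • y j) = cexp (y j) ^ N := by
          have hN' : ((N : ℚ) • y j : ℂ) = (N : ℂ) * y j := by rw [Rat.smul_def]; push_cast; ring
          rw [hN']
          exact Complex.exp_nat_mul (y j) N
        rw [← h1]
        refine GammaField.adjoin_subset_acl (Set.range g) ?_
        have hle : IntermediateField.adjoin ℚ (Set.range (cexp ∘ x)) ≤
            IntermediateField.adjoin ℚ (Set.range g) :=
          IntermediateField.adjoin.mono ℚ _ _ (by rintro a ⟨i, rfl⟩; exact ⟨Sum.inr i, rfl⟩)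
        exact hle (exp_mem_adjoin_exp_of_mem_span_int x hNmem)
      simpa using GammaField.mem_acl_of_pow_mem hN hpow
  have hm_le : (m : ℕ∞) ≤ (GammaField.algMatroid ℂ).eRk (Set.range g) := by
    have h1 : (m : Cardinal) ≤
        Algebra.trdeg ℚ ↥(IntermediateField.adjoin ℚ (Set.range y ∪ Set.range (cexp ∘ y))) :=
      hx.2.2 m hm y hyli
    refine (ZilberHomogeneity.natCast_le_eRk_of_le_trdeg h1).trans ?_
    calc (GammaField.algMatroid ℂ).eRk (Set.range y ∪ Set.range (cexp ∘ y))
        ≤ (GammaField.algMatroid ℂ).eRk ((GammaField.algMatroid ℂ).closure (Set.range g)) :=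
          (GammaField.algMatroid ℂ).eRk_mono hsub
      _ = (GammaField.algMatroid ℂ).eRk (Set.range g) := (GammaField.algMatroid ℂ).eRk_closure_eq _
  obtain ⟨J, hJsub, hJind, hJcard⟩ := Matroid.le_eRk_iff.1 hm_le
  have hpre : ∀ j : J, ∃ s : Fin m ⊕ Fin n, g s = (j : ℂ) := fun j => hJsub j.2
  choose f hf using hpre
  have hgf : AlgebraicIndependent ℚ (g ∘ f) := by
    have hfun : g ∘ f = (Subtype.val : J → ℂ) := funext hf
    rw [hfun]
    exact AlgebraicIndependent.matroid_indep_iff.1 hJind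
  -- (C) the two families of polynomials and their images
  set a : Fin r → ℂ := fun k => ∑ i, ((c k i : ℚ) : ℂ) * x i with ha
  set P : Fin r ⊕ J → MvPolynomial (Fin n ⊕ Fin n) ℚ :=
    Sum.elim (fun k => ∑ i, MvPolynomial.C (c k i) * MvPolynomial.X (Sum.inl i))
      (fun j => Sum.elim (fun j' => ∑ i, MvPolynomial.C (q j' i) * MvPolynomial.X (Sum.inl i))
        (fun i => MvPolynomial.X (Sum.inr i)) (f j)) with hP
  set Φ : Fin r ⊕ J → MvPolynomial (Fin r) ℂ :=
    Sum.elim (fun k => MvPolynomial.C (a k) + MvPolynomial.X k) (fun j => MvPolynomial.C (g (f j))) with hΦ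
  have hψP : ∀ ℓ, spreadMap x d (P ℓ) = Φ ℓ := by
    rintro (k | j)
    · simp only [hP, hΦ, Sum.elim_inl]
      rw [spreadMap_linearForm]
      congr 1
      rw [Finset.sum_eq_single k]
      · simp [hcd]
      · intro k' _ hk'
        simp [hcd, Ne.symm hk']
      · intro h; exact absurd (Finset.mem_univ k) h
    · simp only [hP, hΦ, Sum.elim_inr]
      rcases hfj : f j with j' | i
      · simp only [Sum.elim_inl]
        rw [spreadMap_linearForm]
        simp [hqd, hg, hy]
      · simp only [Sum.elim_inr]
        rw [spreadMap_Y]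
        simp [hg]
  have hvP : ∀ ℓ, MvPolynomial.aeval v (P ℓ) = Sum.elim a (fun j : J => (j : ℂ)) ℓ := by
    rintro (k | j)
    · simp [hP, hv, ha]
    · simp only [hP, Sum.elim_inr]
      rw [← hf j]
      rcases hfj : f j with j' | i
      · simp [hv, hg, hy]
      · simp [hv, hg]
  -- (D) independence transfers back to `ℚ(x, eˣ)`
  have hΦind : AlgebraicIndependent ℚ Φ := algebraicIndependent_shift_constants a hgf
  have hα : AlgebraicIndependent ℚ (Sum.elim a (fun j : J => (j : ℂ))) := by
    rw [algebraicIndependent_iff]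
    intro G hG
    apply algebraicIndependent_iff.1 hΦind
    have h1 : MvPolynomial.aeval v (MvPolynomial.aeval P G) = 0 := by
      rw [← AlgHom.comp_apply, MvPolynomial.comp_aeval]
      have hfun : (fun ℓ => MvPolynomial.aeval v (P ℓ)) = Sum.elim a (fun j : J => (j : ℂ)) := funext hvP
      rw [hfun]
      exact hG
    have h2 := hψ _ h1
    rw [← AlgHom.comp_apply, MvPolynomial.comp_aeval] at h2
    have hfun : (fun ℓ => spreadMap x d (P ℓ)) = Φ := funext hψP
    rw [hfun] at h2
    exact h2
  -- (E) count: `n = r + m` independent elements inside `ℚ(x, eˣ)` of `trdeg < n`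
  set K := IntermediateField.adjoin ℚ (Set.range x ∪ Set.range (cexp ∘ x)) with hK
  have hxK : ∀ i, x i ∈ K := fun i => IntermediateField.subset_adjoin ℚ _ (Or.inl ⟨i, rfl⟩)
  have heK : ∀ i, cexp (x i) ∈ K := fun i => IntermediateField.subset_adjoin ℚ _ (Or.inr ⟨i, rfl⟩)
  have hmem : ∀ ℓ, Sum.elim a (fun j : J => (j : ℂ)) ℓ ∈ K := by
    rintro (k | j)
    · simp only [Sum.elim_inl, ha]
      exact sum_mem fun i _ => mul_mem (by exact_mod_cast (algebraMap ℚ K (c k i)).2) (hxK i)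
    · simp only [Sum.elim_inr]
      rw [← hf j]
      rcases f j with j' | i
      · simp only [hg, Sum.elim_inl, hy]
        exact sum_mem fun i _ => mul_mem (by exact_mod_cast (algebraMap ℚ K (q j' i)).2) (hxK i)
      · exact heK i
  let w : Fin r ⊕ J → K := fun ℓ => ⟨_, hmem ℓ⟩
  have hw : AlgebraicIndependent ℚ w := AlgebraicIndependent.of_comp K.val hα
  have hle := hw.cardinalMk_le_trdeg
  have hfin : (J : Set ℂ).Finite := Set.finite_of_encard_eq_coe hJcard
  haveI : Fintype J := hfin.fintype
  have hcardJ : Fintype.card J = m := by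
    have h := hJcard
    rw [Set.encard_eq_coe_toFinset_card, Set.toFinset_card] at h
    exact_mod_cast h
  have hcard : Cardinal.mk (Fin r ⊕ J) = (n : Cardinal) := by
    rw [Cardinal.mk_fintype, Fintype.card_sum, Fintype.card_fin, hcardJ, hrm]
  rw [hcard] at hle
  exact (not_le.2 hx.2.1) hle


end Endgame


/-! ## §14 (gen 4) Kernel translates on the locus are finite once `x` is algebraic over `ℚ[eˣ]` —
`stub_branchFiniteness_rankTwo` OFF the log sector PROVED (LI-free) -/

section Translates

/-- `e^{x + 2πik} = eˣ` coordinatewise (the skeleton's `cexp_comp_kerTranslate`). -/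
theorem cexp_comp_translate {n : ℕ} (x : Fin n → ℂ) (k : Fin n → ℤ) :
    (cexp ∘ fun i => x i + 2 * Real.pi * I * (k i : ℂ)) = cexp ∘ x := by
  funext i
  simp only [Function.comp_apply]
  rw [Complex.exp_add, cexp_two_pi_I_mul_int, mul_one]

/-- The kernel-translation map `k ↦ x + 2πik` is injective. -/
theorem translate_injective {n : ℕ} (x : Fin n → ℂ) :
    Function.Injective (fun k : Fin n → ℤ => fun i => x i + 2 * Real.pi * I * (k i : ℂ)) := by
  intro k k' h
  funext i
  have hi := congr_fun h i
  have h2 : (2 * Real.pi * I : ℂ) ≠ 0 := two_pi_I_ne_zero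
  have h3 : (2 * Real.pi * I : ℂ) * (k i : ℂ) = 2 * Real.pi * I * (k' i : ℂ) := add_left_cancel hi
  exact_mod_cast mul_left_cancel₀ h2 h3

/-- **An algebraic dependence of `x i` over `ℚ[eˣ]` is a ℚ-polynomial RELATION of `(x, eˣ)`**, so it
transfers to every point `v` of the frozen fibre `W_y = {v | (v, y) ∈ W}` (`y = eˣ`, `W` the ℚ-locus
of `(x, eˣ)`): `F(v i) = 0` for ONE fixed non-zero `F ∈ ℂ[T]` (the minimal polynomial of `x i` over
`ℚ[y]`, its coefficients written as ℚ-polynomials in `y`). -/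
theorem exists_polynomial_of_isAlgebraic_exp {n : ℕ} (x : Fin n → ℂ) (i : Fin n)
    (ha : IsAlgebraic (Algebra.adjoin ℚ (range (cexp ∘ x))) (x i)) :
    ∃ F : Polynomial ℂ, F ≠ 0 ∧ ∀ v : Fin n → ℂ,
      (∀ p : MvPolynomial (Fin n ⊕ Fin n) ℚ,
        MvPolynomial.aeval (Sum.elim x (cexp ∘ x)) p = 0 →
        MvPolynomial.aeval (Sum.elim v (cexp ∘ x)) p = 0) → F.eval (v i) = 0 := by
  classical
  set y : Fin n → ℂ := cexp ∘ x with hy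
  set S : Subalgebra ℚ ℂ := Algebra.adjoin ℚ (range y) with hS
  obtain ⟨g, hg0, hg⟩ := ha
  have hcoef : ∀ j : ℕ, ∃ Q : MvPolynomial (Fin n) ℚ,
      MvPolynomial.aeval y Q = ((g.coeff j : S) : ℂ) := by
    intro j
    have hmem : ((g.coeff j : S) : ℂ) ∈ (MvPolynomial.aeval (R := ℚ) y).range := by
      rw [← Algebra.adjoin_range_eq_range_aeval]
      exact (g.coeff j).2
    exact (AlgHom.mem_range _).1 hmem
  choose Q hQ using hcoef
  let P : MvPolynomial (Fin n ⊕ Fin n) ℚ :=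
    ∑ j ∈ g.support, MvPolynomial.rename Sum.inr (Q j) * MvPolynomial.X (Sum.inl i) ^ j
  have hinj : Function.Injective (algebraMap S ℂ) := fun a b h => Subtype.ext h
  set F : Polynomial ℂ := g.map (algebraMap S ℂ) with hF
  have hF0 : F ≠ 0 := (Polynomial.map_ne_zero_iff hinj).2 hg0
  have hevalP : ∀ v : Fin n → ℂ, MvPolynomial.aeval (Sum.elim v y) P = F.eval (v i) := by
    intro v
    rw [hF, Polynomial.eval_map, Polynomial.eval₂_eq_sum, Polynomial.sum_def]
    simp only [P, map_sum, map_mul, map_pow, MvPolynomial.aeval_X, Sum.elim_inl,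
      MvPolynomial.aeval_rename]
    refine Finset.sum_congr rfl fun j _ => ?_
    have hcomp : (Sum.elim v y ∘ Sum.inr) = y := rfl
    rw [hcomp, hQ j]
    rfl
  refine ⟨F, hF0, fun v hv => ?_⟩
  have h0 : MvPolynomial.aeval (Sum.elim x y) P = 0 := by
    rw [hevalP x, hF, Polynomial.eval_map, ← Polynomial.aeval_def]
    exact hg
  have h1 := hv P h0
  rwa [hevalP v] at h1

/-- **Kernel translates on the locus are FINITE as soon as every `x i` is algebraic over `ℚ[eˣ]`**
(any rank, no linear independence, no first-failure hypothesis): the translate `x + 2πik` keeps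
`y = eˣ`, so each `x i + 2πi kᵢ` is a root of the fixed non-zero `Fᵢ ∈ ℂ[T]` above.  At a first
failure this is the case `trdeg ℚ(eˣ) = n − 1` (exponentials as independent as possible); the
complementary case `trdeg ℚ(eˣ) ≤ n − 2` — where the frozen fibre `W_y` has positive dimension —
is exactly where the sweep / structure lemma of stubs 4–5 is needed. -/
theorem translates_finite_of_isAlgebraic {n : ℕ} (x : Fin n → ℂ)
    (halg : ∀ i, IsAlgebraic (Algebra.adjoin ℚ (range (cexp ∘ x))) (x i)) :
    {k : Fin n → ℤ | ∀ p : MvPolynomial (Fin n ⊕ Fin n) ℚ,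
        MvPolynomial.aeval (Sum.elim x (cexp ∘ x)) p = 0 →
        MvPolynomial.aeval (Sum.elim (fun i => x i + 2 * Real.pi * I * (k i : ℂ))
          (cexp ∘ fun i => x i + 2 * Real.pi * I * (k i : ℂ))) p = 0}.Finite := by
  choose F hF0 hF using fun i => exists_polynomial_of_isAlgebraic_exp x i (halg i)
  have hR : ∀ i, {z : ℂ | (F i).IsRoot z}.Finite := fun i => Polynomial.finite_setOf_isRoot (hF0 i)
  let T : (Fin n → ℤ) → (Fin n → ℂ) := fun k i => x i + 2 * Real.pi * I * (k i : ℂ)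
  have hT : Function.Injective T := translate_injective x
  have hfin : (T ⁻¹' Set.pi Set.univ fun i => {z : ℂ | (F i).IsRoot z}).Finite :=
    (Set.Finite.pi hR).preimage hT.injOn
  refine hfin.subset ?_
  intro k hk
  rw [Set.mem_preimage, Set.mem_univ_pi]
  intro i
  have hk' : ∀ p : MvPolynomial (Fin n ⊕ Fin n) ℚ,
      MvPolynomial.aeval (Sum.elim x (cexp ∘ x)) p = 0 →
      MvPolynomial.aeval (Sum.elim (T k) (cexp ∘ x)) p = 0 := by
    intro p hp
    have h := hk p hp
    rwa [cexp_comp_translate] at h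
  exact hF i (T k) hk'

/-- Off the log sector at rank 2, EVERY coordinate is algebraic over `ℚ[eˣ]` (the field `ℚ(x, eˣ)`
has transcendence degree `1` and contains the transcendental `e^{x i}`). -/
theorem isAlgebraic_exp_adjoin_of_offLog {x : Fin 2 → ℂ}
    (htr : Algebra.trdeg ℚ ↥(IntermediateField.adjoin ℚ (range x ∪ range (cexp ∘ x))) < (2 : Cardinal))
    {i : Fin 2} (ht : Transcendental ℚ (cexp (x i))) (j : Fin 2) :
    IsAlgebraic (Algebra.adjoin ℚ (range (cexp ∘ x))) (x j) := by
  refine (isAlgebraic_adjoin_of_trdeg_lt_two htr (Or.inr ⟨i, rfl⟩) (Or.inl ⟨j, rfl⟩) ht)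
    |>.tower_top_of_subalgebra_le (Algebra.adjoin_mono ?_)
  rintro _ ⟨l, rfl⟩
  fin_cases l
  exact ⟨i, by simp⟩

/-- **`stub_branchFiniteness_rankTwo` OFF THE LOG SECTOR — PROVED, in the stronger form with NO
linear-independence hypothesis at all** (neither on `x` nor on the counted translates): if
`trdeg ℚ(x, eˣ) < 2` and some `e^{x i}` is transcendental, only finitely many kernel translates
`x + 2πik` lie on the ℚ-locus of `(x, eˣ)`.  So the registered stub 4 is EQUIVALENT to its
log-sector case (`stub4_iff_logSector` below): two algebraically dependent logarithms of algebraic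
numbers and the finiteness of the branch pairs on their relation curve (Baker / Hermite–Lindemann:
route support `TwoLogsBranchRelationFinite`, stmt-Schanuel-0975, for `(x₁, x₂, 2πi)` ℚ-independent,
see `stub4Log_indep_of_twoLogs`; plus the degenerate sub-case `2πi ∈ span_ℚ(x₁, x₂)`). -/
theorem branchFiniteness_rankTwo_offLog (x : Fin 2 → ℂ)
    (htr : Algebra.trdeg ℚ ↥(IntermediateField.adjoin ℚ (range x ∪ range (cexp ∘ x))) < (2 : Cardinal))
    (hoff : ∃ i, Transcendental ℚ (cexp (x i))) :
    {k : Fin 2 → ℤ | ∀ p : MvPolynomial (Fin 2 ⊕ Fin 2) ℚ,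
        MvPolynomial.aeval (Sum.elim x (cexp ∘ x)) p = 0 →
        MvPolynomial.aeval (Sum.elim (fun i => x i + 2 * Real.pi * I * (k i : ℂ))
          (cexp ∘ fun i => x i + 2 * Real.pi * I * (k i : ℂ))) p = 0}.Finite := by
  obtain ⟨i, hi⟩ := hoff
  exact translates_finite_of_isAlgebraic x fun j => isAlgebraic_exp_adjoin_of_offLog htr hi j

/-- The registered stub 4 of the PICKED line, verbatim (skeleton f7f45f09face). -/
def Stub4 : Prop :=
  ∀ (x : Fin 2 → ℂ), (LinearIndependent ℚ x ∧ Algebra.trdeg ℚ ↥(IntermediateField.adjoin ℚ (Set.range x ∪ Set.range (Complex.exp ∘ x))) < (2 : Cardinal)) → {k : Fin 2 → ℤ | LinearIndependent ℚ (fun i => x i + 2 * ↑Real.pi * Complex.I * (k i : ℂ)) ∧ ∀ p : MvPolynomial (Fin 2 ⊕ Fin 2) ℚ, MvPolynomial.aeval (Sum.elim x (Complex.exp ∘ x)) p = 0 → MvPolynomial.aeval (Sum.elim (fun i => x i + 2 * ↑Real.pi * Complex.I * (k i : ℂ)) (Complex.exp ∘ fun i => x i + 2 * ↑Real.pi * Complex.I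 * (k i : ℂ))) p = 0}.Finite

/-- Its LOG-SECTOR case: both exponentials algebraic. -/
def Stub4Log : Prop :=
  ∀ (x : Fin 2 → ℂ), (LinearIndependent ℚ x ∧ Algebra.trdeg ℚ ↥(IntermediateField.adjoin ℚ (Set.range x ∪ Set.range (Complex.exp ∘ x))) < (2 : Cardinal)) → (∀ i, IsAlgebraic ℚ (Complex.exp (x i))) → {k : Fin 2 → ℤ | LinearIndependent ℚ (fun i => x i + 2 * ↑Real.pi * Complex.I * (k i : ℂ)) ∧ ∀ p : MvPolynomial (Fin 2 ⊕ Fin 2) ℚ, MvPolynomial.aeval (Sum.elim x (Complex.exp ∘ x)) p = 0 → MvPolynomial.aeval (Sum.elim (fun i => x i + 2 * ↑Real.pi * Complex.I * (k i : ℂ)) (Complex.exp ∘ fun i => x i + 2 * ↑Real.pi * Complex.I * (k i : ℂ))) p = 0}.Finite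

/-- Stub 4 with the off-log hypothesis added: PROVED (verbatim shape). -/
theorem stub_branchFiniteness_rankTwo_offLog : ∀ (x : Fin 2 → ℂ), (LinearIndependent ℚ x ∧ Algebra.trdeg ℚ ↥(IntermediateField.adjoin ℚ (Set.range x ∪ Set.range (Complex.exp ∘ x))) < (2 : Cardinal)) → (∃ i, Transcendental ℚ (Complex.exp (x i))) → {k : Fin 2 → ℤ | LinearIndependent ℚ (fun i => x i + 2 * ↑Real.pi * Complex.I * (k i : ℂ)) ∧ ∀ p : MvPolynomial (Fin 2 ⊕ Fin 2) ℚ, MvPolynomial.aeval (Sum.elim x (Complex.exp ∘ x)) p = 0 → MvPolynomial.aeval (Sum.elim (fun i => x i + 2 * ↑Real.pi * Complex.I * (k i : ℂ)) (Complex.exp ∘ fun i => x i + 2 * ↑Real.pi * Complex.I * (k i : ℂ))) p = 0}.Finite :=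
  fun x hx hoff => (branchFiniteness_rankTwo_offLog x hx.2 hoff).subset fun _ hk => hk.2

/-- **Stub 4 ⟺ its log-sector case.** -/
theorem stub4_iff_logSector : Stub4 ↔ Stub4Log := by
  refine ⟨fun h x hx _ => h x hx, fun h x hx => ?_⟩
  by_cases hall : ∀ i, IsAlgebraic ℚ (cexp (x i))
  · exact h x hx hall
  · push Not at hall
    obtain ⟨i, hi⟩ := hall
    exact stub_branchFiniteness_rankTwo_offLog x hx ⟨i, hi⟩

/-- A transcendence-degree-`< 2` pair is algebraically DEPENDENT: some non-zero `F ∈ ℚ[X₁, X₂]`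
vanishes at `x` (and it is non-constant). -/
theorem exists_relation_of_trdeg_lt_two {x : Fin 2 → ℂ}
    (htr : Algebra.trdeg ℚ ↥(IntermediateField.adjoin ℚ (range x ∪ range (cexp ∘ x))) < (2 : Cardinal)) :
    ∃ F : MvPolynomial (Fin 2) ℚ, F ≠ 0 ∧ MvPolynomial.aeval x F = 0 ∧ 0 < F.totalDegree := by
  classical
  have hdep : ¬ AlgebraicIndependent ℚ x := by
    intro hind
    set K := IntermediateField.adjoin ℚ (range x ∪ range (cexp ∘ x)) with hK
    let v : Fin 2 → K := fun i => ⟨x i, IntermediateField.subset_adjoin ℚ _ (Or.inl ⟨i, rfl⟩)⟩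
    have hv : AlgebraicIndependent ℚ v := AlgebraicIndependent.of_comp K.val hind
    have h2 : (2 : Cardinal) ≤ Algebra.trdeg ℚ K := by simpa using hv.cardinalMk_le_trdeg
    exact (not_le.2 htr) h2
  rw [algebraicIndependent_iff] at hdep
  push Not at hdep
  obtain ⟨F, hF, hF0⟩ := hdep
  refine ⟨F, hF0, hF, ?_⟩
  rw [Nat.pos_iff_ne_zero]
  intro hdeg
  rw [MvPolynomial.totalDegree_eq_zero_iff_eq_C] at hdeg
  rw [hdeg, MvPolynomial.aeval_C, map_eq_zero] at hF
  apply hF0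
  rw [hdeg, hF, map_zero]

/-- **The log sector of stub 4 in the INDEPENDENT case `(x₁, x₂, 2πi)` ℚ-linearly independent is an
instance of the route's support item `TwoLogsBranchRelationFinite` (stmt-Schanuel-0975, Baker's
theorem at its proved linear strength)**, applied to the ℚ-relation `F` of the two dependent
logarithms `x₁, x₂` (every translate on the locus satisfies `F(x₁ + 2πik₁, x₂ + 2πik₂) = 0`).  The
residual sub-case `2πi ∈ span_ℚ(x₁, x₂)` (e.g. `x = (log α, q log α + r·2πi)`, where `trdeg < 2`
means `log α` and `π` algebraically dependent — not excluded by known transcendence) is the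
Hermite–Lindemann / Galois-stability argument of drefute-g2's note (b); it is NOT covered here. -/
theorem stub4Log_indep_of_twoLogs
    (hL : Summit.Schanuel.Schanuel.Theses.RigidCore.TwoLogsBranchRelationFinite)
    (x : Fin 2 → ℂ)
    (htr : Algebra.trdeg ℚ ↥(IntermediateField.adjoin ℚ (range x ∪ range (cexp ∘ x))) < (2 : Cardinal))
    (halg : ∀ i, IsAlgebraic ℚ (cexp (x i)))
    (hind : LinearIndependent ℚ ![x 0, x 1, 2 * ↑Real.pi * I]) :
    {k : Fin 2 → ℤ | ∀ p : MvPolynomial (Fin 2 ⊕ Fin 2) ℚ,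
        MvPolynomial.aeval (Sum.elim x (cexp ∘ x)) p = 0 →
        MvPolynomial.aeval (Sum.elim (fun i => x i + 2 * Real.pi * I * (k i : ℂ))
          (cexp ∘ fun i => x i + 2 * Real.pi * I * (k i : ℂ))) p = 0}.Finite := by
  classical
  obtain ⟨F, hF0, hFx, hdeg⟩ := exists_relation_of_trdeg_lt_two htr
  -- `F` with coefficients in `ℚ̄ ⊆ ℂ`
  set Fbar : MvPolynomial (Fin 2) ↥(algebraicClosure ℚ ℂ) :=
    MvPolynomial.map (algebraMap ℚ ↥(algebraicClosure ℚ ℂ)) F with hFbar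
  have hdegbar : 0 < Fbar.totalDegree := by
    have e : Fbar.totalDegree = F.totalDegree := by
      simp only [hFbar, MvPolynomial.totalDegree,
        MvPolynomial.support_map_of_injective _ (algebraMap ℚ ↥(algebraicClosure ℚ ℂ)).injective]
    rwa [e]
  have hfin := hL (x 0) (x 1) (halg 0) (halg 1) hind Fbar hdegbar
  -- the translates inject into the finite branch-pair set
  let π₂ : (Fin 2 → ℤ) → ℤ × ℤ := fun k => (k 0, k 1)
  have hπ : Function.Injective π₂ := by
    intro k k' h
    simp only [π₂, Prod.mk.injEq] at h
    funext i; fin_cases i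
    · exact h.1
    · exact h.2
  refine (hfin.preimage hπ.injOn).subset ?_
  intro k hk
  rw [Set.mem_preimage, Set.mem_setOf_eq]
  -- the relation `F(X₁, X₂)` transfers to the translate
  have hrel : MvPolynomial.aeval (Sum.elim x (cexp ∘ x)) (MvPolynomial.rename Sum.inl F) = 0 := by
    rw [MvPolynomial.aeval_rename]
    exact hFx
  have hk' := hk _ hrel
  rw [MvPolynomial.aeval_rename] at hk'
  have hcomp : (Sum.elim (fun i => x i + 2 * ↑Real.pi * I * (k i : ℂ))
      (cexp ∘ fun i => x i + 2 * ↑Real.pi * I * (k i : ℂ)) ∘ Sum.inl) =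
      ![x 0 + 2 * ↑Real.pi * I * ((π₂ k).1 : ℂ), x 1 + 2 * ↑Real.pi * I * ((π₂ k).2 : ℂ)] := by
    funext i; fin_cases i <;> rfl
  rw [hcomp] at hk'
  rw [hFbar, MvPolynomial.aeval_map_algebraMap]
  exact hk'

end Translates

/-! ## §15 (gen 4) Instance audit at rank 2: the classical candidate pairs satisfy the CONCLUSION outright -/

section Instances

/-- `i ∈ acl(∅)` (algebraic). -/
theorem I_mem_expAcl : I ∈ expAcl := by
  refine expAcl_relAlgClosed I ?_
  have hI : IsAlgebraic ℚ I := by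
    refine ⟨Polynomial.X ^ 2 + 1, ?_, ?_⟩
    · exact Polynomial.X_pow_add_C_ne_zero (by norm_num) 1
    · simp [Complex.I_sq]
  exact hI.tower_top (L := ↥expAclField)

/-- Every algebraic number is in `acl(∅)`. -/
theorem mem_expAcl_of_isAlgebraic {a : ℂ} (ha : IsAlgebraic ℚ a) : a ∈ expAcl :=
  expAcl_relAlgClosed a (ha.tower_top (L := ↥expAclField))

/-- `πi ∈ acl(∅)`. -/
theorem pi_mul_I_mem_expAcl : (Real.pi : ℂ) * I ∈ expAcl := mul_mem_expAcl pi_mem_expAcl I_mem_expAcl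

/-- **Candidate `x = (1, πi)`** (a rank-2 first failure iff `e` and `π` are algebraically DEPENDENT —
the open `e ⊥ π`): the crux's conclusion holds for it unconditionally (`e = exp 1`, `π ∈ dcl(∅)`). -/
theorem conclusion_at_one_piI (i : Fin 2) : (![(1 : ℂ), Real.pi * I] i) ∈ expAcl := by
  fin_cases i
  · simpa using natCast_mem_expAcl 1
  · simpa using pi_mul_I_mem_expAcl

/-- **Candidates `x = (πi, πα)`, `α` algebraic** (first failures iff `π` and `e^{πα}` are algebraically
dependent — open for `α ∉ ℚ(i) ∪ {√d}`-type cases beyond Nesterenko): conclusion holds unconditionally. -/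
theorem conclusion_at_piI_piMul {α : ℂ} (hα : IsAlgebraic ℚ α) (i : Fin 2) :
    (![(Real.pi : ℂ) * I, Real.pi * α] i) ∈ expAcl := by
  fin_cases i
  · simpa using pi_mul_I_mem_expAcl
  · simpa using mul_mem_expAcl pi_mem_expAcl (mem_expAcl_of_isAlgebraic hα)

/-- **Candidate `x = (1, e)`** (first failure iff `e` and `e^e` algebraically dependent): conclusion
holds unconditionally. -/
theorem conclusion_at_one_e (i : Fin 2) : (![(1 : ℂ), cexp 1] i) ∈ expAcl := by
  fin_cases i
  · simpa using natCast_mem_expAcl 1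
  · simpa using e_mem_expAcl

/-- More generally the conclusion is free on the LOG-FREE CORE `C_EA` (sibling library
`logFreeCore_subset_expAcl`, = route support item 0972): the crux has content only at first failures
with a coordinate OUTSIDE `C_EA` — by Kirby (§5) such a coordinate lies in `ecl(∅) ∖ C_EA`, the
"symmetric side" (branches of logarithms of algebraic numbers, `log 2`, fixed points of `exp`, …). -/
theorem conclusion_of_mem_logFreeCore {n : ℕ} {x : Fin n → ℂ} (hx : ∀ i, x i ∈ logFreeCore) (i : Fin n) :
    x i ∈ expAcl :=
  logFreeCore_subset_expAcl (hx i)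

/-- **What the route actually needs from (S*)**: combined with the sibling crux (A)
`AclSubsetLogFreeCore`, the crux says every first failure lies in `C_EAⁿ` … -/
theorem firstFailure_mem_logFreeCore_of_crux_and_A
    (hS : Summit.Schanuel.Schanuel.Theses.RigidCore.MinimalCounterexampleInAcl)
    (hA : Summit.Schanuel.Schanuel.Theses.RigidCore.AclSubsetLogFreeCore)
    {n : ℕ} {x : Fin n → ℂ} (hx : IsFirstFailure x) (i : Fin n) : x i ∈ logFreeCore := by
  have h := hA (x i) (crux_iff.1 hS n x hx i)
  exact h

/-- … and conversely "first failures lie in `C_EAⁿ`" (call it (S**)) implies the crux outright (no (A)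
needed), and with (R) `SchanuelOnLogFreeCore` alone it already gives Schanuel.  So (S**) is an
(A)-free sufficient form of the route's first two cruxes. -/
theorem crux_of_firstFailures_in_core
    (h : ∀ (n : ℕ) (x : Fin n → ℂ), IsFirstFailure x → ∀ i, x i ∈ logFreeCore) :
    Summit.Schanuel.Schanuel.Theses.RigidCore.MinimalCounterexampleInAcl :=
  crux_iff.2 fun n x hx i => conclusion_of_mem_logFreeCore (h n x hx) i

theorem schanuel_of_firstFailures_in_core_of_R
    (h : ∀ (n : ℕ) (x : Fin n → ℂ), IsFirstFailure x → ∀ i, x i ∈ logFreeCore)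
    (hR : Summit.Schanuel.Schanuel.Theses.RigidCore.SchanuelOnLogFreeCore) : _root_.Schanuel := by
  by_contra hS
  obtain ⟨n, x, hx⟩ := exists_isFirstFailure_of_not_schanuel hS
  have hmem : ∀ i, x i ∈ (sInf {K : IntermediateField ℚ ℂ | (2 * ↑Real.pi * Complex.I : ℂ) ∈ K ∧
      (∀ w ∈ K, Complex.exp w ∈ K) ∧ ∀ w : ℂ, IsAlgebraic K w → w ∈ K} : IntermediateField ℚ ℂ) :=
    fun i => h n x hx i
  exact (not_le.2 hx.2.1) (hR n x hmem hx.1)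

end Instances


/-! ## §16 (gen 4) NO ANALYTIC ARC of `𝒵_W` through a first failure — see the companion workfile `DisproofNoArc.lean`

(Moved out of this file to respect the 200 kB cap on crux workfiles.)  `Cruxes/MinimalCounterexampleInAcl/
DisproofNoArc.lean` (rc 0, 0 sorry; also proposed as `Negative/{ArcTaylorPoint,ArcFrame,NoAnalyticArc}.lean`)
proves, by Ax 1971 Thm 3 in the differential field `(ℂ⸨X⸩, d/dX)`: for a first failure `x` and germs `Γᵢ`
analytic at `0` with `Γ(0) = x` along which every ℚ-relation of `(x, eˣ)` vanishes near `0`, every `Γᵢ`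
is constant near `0` (`DisproofNoArc.firstFailure_no_analytic_arc`, `…not_exists_nonconstant_arc`,
`…line_not_in_locus`, `…mate_no_analytic_arc_of_symm`).  It is SUPERSEDED in strength by §17 below (full
topological isolation via the Khovanskii point), but its method (Taylor point + adapted frame) is
independent of the Khovanskii dichotomy. -/

/-! ## §17 (gen 4) A first failure is a non-degenerate KHOVANSKII POINT of its own locus ⟹ first failures and all their mates are ISOLATED points of `𝒵_W` (all ranks) -/

section KhovOpens
open Filter Topology

/-! Technical development in the sub-namespace `Khov` (verbatim the proposed
`Theorems/MinimalCounterexampleInAcl/Negative/{KhovanskiiPoint,FirstFailureIsolated}.lean`). -/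
namespace Khov

set_option maxHeartbeats 1600000 in
/-- **A first failure is a non-degenerate KHOVANSKII POINT of its own locus**: there are `n`
ℚ-relations `g₁,…,gₙ` of `(x, eˣ)` whose exponential Jacobian `det((∂ⱼ + Yⱼ∂_{n+j}) gᵢ (x, eˣ))`
does not vanish.  (Khovanskii dichotomy, tree `khovanskii_dichotomy`: otherwise `ℚ(x, eˣ)` carries a
non-zero E-derivation for `x ↦ eˣ`; Ax 1971 Thm 3 for it, WITH its rank term, plus `SchanuelRank m`
on the constants `q·x`, and the tower law give `n + 1 ≤ trdeg ℚ(x, eˣ) < n`.) -/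
theorem firstFailure_khovanskii {n : ℕ} {x : Fin n → ℂ} (hxli : LinearIndependent ℚ x)
    (htr : Algebra.trdeg ℚ ↥(IntermediateField.adjoin ℚ (range x ∪ range (cexp ∘ x))) < (n : Cardinal))
    (hrank : ∀ r < n, SchanuelRank r) :
    ∃ g : Fin n → MvPolynomial (Fin n ⊕ Fin n) ℚ,
      (∀ i, MvPolynomial.aeval (Sum.elim x (cexp ∘ x)) (g i) = 0) ∧
      (Matrix.of fun i j => MvPolynomial.aeval (Sum.elim x (cexp ∘ x))
        (Khovanskii.ePD j (g i))).det ≠ 0 := by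
  classical
  rcases Nat.eq_zero_or_pos n with rfl | hn
  · exact absurd htr (not_lt.2 (by simp))
  -- the field `L = ℚ(x̄, e^{x̄})`
  set S : Set ℂ := Set.range x ∪ Set.range (cexp ∘ x) with hS
  set L : IntermediateField ℚ ℂ := IntermediateField.adjoin ℚ S with hL
  have hxS : ∀ i, x i ∈ L := fun i => IntermediateField.subset_adjoin ℚ S (Or.inl ⟨i, rfl⟩)
  have hyS : ∀ i, cexp (x i) ∈ L := fun i => IntermediateField.subset_adjoin ℚ S (Or.inr ⟨i, rfl⟩)
  set xL : Fin n → L := fun i => ⟨x i, hxS i⟩ with hxL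
  set yL : Fin n → L := fun i => ⟨cexp (x i), hyS i⟩ with hyL
  have hy0 : ∀ i, yL i ≠ 0 := fun i h => Complex.exp_ne_zero (x i) (congrArg Subtype.val h)
  have htopL : IntermediateField.adjoin ℚ (Set.range xL ∪ Set.range yL) = ⊤ := by
    have h := IntermediateField.adjoin_preimage_val_eq_top (F := ℚ) S
    have hpre : Set.range xL ∪ Set.range yL = ((↑) : L → ℂ) ⁻¹' S := by
      ext t
      simp only [Set.mem_union, Set.mem_range, Set.mem_preimage, hS, Function.comp_apply]
      constructor
      · rintro (⟨i, rfl⟩ | ⟨i, rfl⟩)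
        · exact Or.inl ⟨i, rfl⟩
        · exact Or.inr ⟨i, rfl⟩
      · rintro (⟨i, hi⟩ | ⟨i, hi⟩)
        · exact Or.inl ⟨i, Subtype.ext hi⟩
        · exact Or.inr ⟨i, Subtype.ext hi⟩
    rw [hpre]
    exact h
  set zL : Fin n ⊕ Fin n → L := Sum.elim xL yL with hzL
  have hpt : Sum.elim x (cexp ∘ x) = algebraMap L ℂ ∘ zL := by
    funext s; rcases s with i | i <;> rfl
  have heval : ∀ p : MvPolynomial (Fin n ⊕ Fin n) ℚ,
      MvPolynomial.aeval (Sum.elim x (cexp ∘ x)) p = algebraMap L ℂ (MvPolynomial.aeval zL p) := by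
    intro p
    rw [hpt, MvPolynomial.aeval_algebraMap_apply]
  rcases khovanskii_dichotomy xL yL htopL with ⟨g, hg0, hdet⟩ | ⟨D, hDE, j₀, hj₀⟩
  · /- (a) a Khovanskii system over ℚ: transport to ℂ -/
    simp only [← hzL] at hg0 hdet
    refine ⟨g, fun i => ?_, ?_⟩
    · rw [heval, hg0 i, map_zero]
    · have hJ : (Matrix.of fun i j => MvPolynomial.aeval (Sum.elim x (cexp ∘ x))
          (Khovanskii.ePD j (g i))) =
          (algebraMap L ℂ).mapMatrix (Matrix.of fun i j => MvPolynomial.aeval zL (Khovanskii.ePD j (g i))) := by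
        ext i j
        simp only [Matrix.of_apply, RingHom.mapMatrix_apply, Matrix.map_apply]
        rw [heval]
      rw [hJ, ← RingHom.map_det, map_ne_zero]
      exact hdet
  · /- (b) a non-zero E-derivation `D` of `L` over `ℚ`: impossible at a first failure -/
    exfalso
    set Dz : Derivation ℤ L L := D.restrictScalars ℤ with hDz
    set D1 : Fin 1 → Derivation ℤ L L := fun _ => Dz with hD1
    set CD : Subring L := constantSubring D1 with hCD
    have hmemCD : ∀ a : L, a ∈ CD ↔ D a = 0 := fun a => by
      simp only [hCD, hD1, hDz, mem_constantSubring, forall_const]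
      exact Iff.rfl
    have hFCD : ∀ c : ℚ, algebraMap ℚ L c ∈ CD := fun c => (hmemCD _).mpr (D.map_algebraMap c)
    -- the elements of `L` killed by `D`, as a `ℚ`-subspace `N` of `ℂ`
    set N : Submodule ℚ ℂ :=
      (LinearMap.ker (D : L →ₗ[ℚ] L)).map (IsScalarTower.toAlgHom ℚ L ℂ).toLinearMap with hN
    have hmemN : ∀ a : ℂ, a ∈ N ↔ ∃ l : L, D l = 0 ∧ (l : ℂ) = a := fun a => by
      simp only [hN, Submodule.mem_map, LinearMap.mem_ker]
      constructor
      · rintro ⟨l, hl, rfl⟩; exact ⟨l, hl, rfl⟩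
      · rintro ⟨l, hl, rfl⟩; exact ⟨l, hl, rfl⟩
    -- the dependence space `V = {q ∈ ℚⁿ | q·x̄ ∈ N}` and the splitting `n = n' + m`
    set T : (Fin n → ℚ) →ₗ[ℚ] ℂ := Fintype.linearCombination ℚ x with hT
    have hTapply : ∀ v : Fin n → ℚ, T v = ∑ i, v i • x i := fun v =>
      Fintype.linearCombination_apply ℚ x v
    set V : Submodule ℚ (Fin n → ℚ) := N.comap T with hV
    set T' : (Fin n → ℚ) →ₗ[ℚ] ℂ ⧸ N := N.mkQ ∘ₗ T with hT'
    have hker : LinearMap.ker T' = V := by rw [hT', LinearMap.ker_comp, Submodule.ker_mkQ]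
    obtain ⟨κ, a, ha, hspan, hli⟩ := exists_linearIndependent' ℚ ((Submodule.mkQ N) ∘ x)
    haveI : Fintype κ := Fintype.ofInjective a ha
    set n' := Fintype.card κ with hn'
    set e := Fintype.equivFin κ with he
    have hrange : Module.finrank ℚ (LinearMap.range T') = n' := by
      have h1 : LinearMap.range T' = Submodule.span ℚ (Set.range (N.mkQ ∘ x)) := by
        rw [hT', LinearMap.range_comp, hT, Fintype.range_linearCombination, Submodule.map_span,
          ← Set.range_comp]
      rw [h1, ← hspan, finrank_span_eq_card hli]
    set m := Module.finrank ℚ V with hm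
    have hnm : n' + m = n := by
      have := LinearMap.finrank_range_add_finrank_ker T'
      rwa [hrange, hker, Module.finrank_fin_fun] at this
    -- `x j₀ ∉ N`
    have hxj₀N : x j₀ ∉ N := by
      intro hmem
      obtain ⟨l, hl0, hl⟩ := (hmemN _).mp hmem
      have hlx : l = xL j₀ := Subtype.ext hl
      rw [hlx] at hl0
      exact hj₀ hl0
    have hmn : m < n := by
      by_contra hmn'
      have hmn2 : m = n := le_antisymm (by omega) (not_lt.mp hmn')
      have hVtop : V = ⊤ :=
        Submodule.eq_top_of_finrank_eq (by rw [← hm, hmn2, Module.finrank_fin_fun])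
      have hmemV : (Pi.single j₀ (1 : ℚ) : Fin n → ℚ) ∈ V := hVtop ▸ Submodule.mem_top
      rw [hV, Submodule.mem_comap, hT, Fintype.linearCombination_apply_single, one_smul] at hmemV
      exact hxj₀N hmemV
    -- every element of the sub-tuple has `D ≠ 0`, and the sub-tuple is non-empty
    have hDx' : ∀ k : κ, D (xL (a k)) ≠ 0 := by
      intro k hk
      have hmemN' : x (a k) ∈ N := (hmemN _).mpr ⟨xL (a k), hk, rfl⟩
      have h0 : ((Submodule.mkQ N) ∘ x ∘ a) k = 0 := by
        simp only [Function.comp_apply, Submodule.mkQ_apply, Submodule.Quotient.mk_eq_zero]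
        exact hmemN'
      exact hli.ne_zero k h0
    have hn'pos : 0 < n' := by
      rw [hn', Fintype.card_pos_iff]
      by_contra hempty
      rw [not_nonempty_iff] at hempty
      have hbot : Submodule.span ℚ (Set.range (((Submodule.mkQ N) ∘ x) ∘ a)) = ⊥ := by
        rw [Set.range_eq_empty, Submodule.span_empty]
      have hmem : (Submodule.mkQ N) (x j₀) ∈ Submodule.span ℚ (Set.range ((Submodule.mkQ N) ∘ x)) :=
        Submodule.subset_span ⟨j₀, rfl⟩
      rw [← hspan, hbot, Submodule.mem_bot, Submodule.mkQ_apply, Submodule.Quotient.mk_eq_zero] at hmem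
      exact hxj₀N hmem
    -- Ax's theorem, WITH the rank term, for the sub-tuple
    set x' : Fin n' → L := fun i => xL (a (e.symm i)) with hx'
    set y' : Fin n' → L := fun i => yL (a (e.symm i)) with hy'
    have hind : IsQLinearIndependentMod D1 x' := by
      intro q hq
      have hD0 : D (∑ i, (q i : L) * x' i) = 0 := (hmemCD _).mp hq
      have hNmem : (∑ i, ((q i : ℚ)) • x (a (e.symm i))) ∈ N := by
        refine (hmemN _).mpr ⟨_, hD0, ?_⟩
        rw [show (∑ i, ((q i : ℚ)) • x (a (e.symm i))) = ∑ i, (q i : ℂ) * x (a (e.symm i)) from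
          Finset.sum_congr rfl fun i _ => by rw [Rat.smul_def, Rat.cast_intCast] ]
        push_cast
        simp only [hx', hxL]
      have h0 : ∑ i, ((q i : ℤ) : ℚ) • ((N.mkQ ∘ x ∘ a) ∘ e.symm) i = 0 := by
        have h1 : N.mkQ (∑ i, ((q i : ℚ)) • x (a (e.symm i))) = 0 :=
          (Submodule.Quotient.mk_eq_zero N).mpr hNmem
        rw [map_sum] at h1
        simpa only [map_smul, Function.comp_apply] using h1
      have hli' : LinearIndependent ℚ ((N.mkQ ∘ x ∘ a) ∘ e.symm) := hli.comp e.symm e.symm.injective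
      have h2 := Fintype.linearIndependent_iff.mp hli' _ h0
      funext i
      exact_mod_cast h2 i
    have hrank1 : 1 ≤ (Matrix.of fun i j => D1 j (x' i)).rank := by
      rw [Matrix.rank]
      by_contra hlt
      push Not at hlt
      have hbot : LinearMap.range (Matrix.of fun i j => D1 j (x' i)).mulVecLin = ⊥ :=
        Submodule.finrank_eq_zero.1 (Nat.lt_one_iff.1 hlt)
      have hmem : (Matrix.of fun i j => D1 j (x' i)).mulVecLin (Pi.single 0 1) ∈
          LinearMap.range (Matrix.of fun i j => D1 j (x' i)).mulVecLin := LinearMap.mem_range_self _ _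
      rw [hbot, Submodule.mem_bot, Matrix.mulVecLin_apply, Matrix.mulVec_single_one] at hmem
      have h := congrFun hmem ⟨0, hn'pos⟩
      simp only [Matrix.col_apply, Matrix.of_apply, Pi.zero_apply, hD1, hDz,
        Derivation.restrictScalars_apply] at h
      exact hDx' _ h
    have hAxL' := ax_schanuel_holds L 1 n' D1 x' y' (fun i => hy0 _)
      (fun _ i => hDE (a (e.symm i))) hind
    letI algCD : Algebra CD L := Algebra.ofSubsemiring CD.toSubsemiring
    have h1 : ((n' + 1 : ℕ) : Cardinal) ≤ Algebra.trdeg CD L := by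
      have h2 : ((n' + 1 : ℕ) : Cardinal) ≤ ((n' + (Matrix.of fun i j => D1 j (x' i)).rank : ℕ) : Cardinal) := by
        exact_mod_cast (by omega : n' + 1 ≤ n' + (Matrix.of fun i j => D1 j (x' i)).rank)
      exact (h2.trans hAxL').trans (trdeg_le_of_injective (Subalgebra.val _) Subtype.val_injective)
    -- an integral basis of `V` and the tuple `z̄ = (w_k · x̄)_k`
    haveI : Module.Free ℚ ↥V := Module.Free.of_divisionRing ℚ ↥V
    haveI : Module.Finite ℚ ↥V := Module.IsNoetherian.finite ℚ ↥V
    let bV := Module.finBasis ℚ V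
    have hint : ∀ k : Fin m, ∃ d : ℕ, d ≠ 0 ∧ ∃ w : Fin n → ℤ,
        ∀ i, (d : ℚ) * ((bV k : V) : Fin n → ℚ) i = w i := fun k => exists_nat_mul_eq_intCast _
    choose d hd w hw using hint
    have huV : ∀ k, (fun i => (w k i : ℚ)) ∈ V := fun k => by
      have : (fun i => (w k i : ℚ)) = (d k : ℚ) • ((bV k : V) : Fin n → ℚ) := by
        funext i; rw [Pi.smul_apply, smul_eq_mul, hw]
      rw [this]
      exact V.smul_mem _ (bV k).2
    have hli_u : LinearIndependent ℚ (fun k => fun i => (w k i : ℚ)) := by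
      have hb : LinearIndependent ℚ (fun k => ((bV k : V) : Fin n → ℚ)) :=
        bV.linearIndependent.map' V.subtype (Submodule.ker_subtype V)
      have hb2 := hb.units_smul fun k => Units.mk0 (d k : ℚ) (Nat.cast_ne_zero.mpr (hd k))
      convert hb2 using 1
      funext k i
      change (w k i : ℚ) = ((Units.mk0 (d k : ℚ) (Nat.cast_ne_zero.mpr (hd k))) •
        ((bV k : V) : Fin n → ℚ)) i
      rw [Units.smul_def, Units.val_mk0, Pi.smul_apply, smul_eq_mul, hw]
    set z : Fin m → ℂ := fun k => ∑ i, (w k i : ℂ) * x i with hz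
    -- `z̄` is ℚ-linearly independent (`x̄` is, and the rows `w_k` are)
    have hzli : LinearIndependent ℚ z := by
      rw [Fintype.linearIndependent_iff]
      intro c hc k
      have hsum : (∑ k, c k • z k) = ∑ i, (∑ k, c k * (w k i : ℚ)) • x i := by
        simp only [hz, Rat.smul_def, Finset.mul_sum]
        rw [Finset.sum_comm]
        refine Finset.sum_congr rfl fun i _ => ?_
        push_cast
        rw [Finset.sum_mul]
        refine Finset.sum_congr rfl fun k _ => ?_
        ring
      rw [hsum] at hc
      have hcoef := (Fintype.linearIndependent_iff.1 hxli) _ hc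
      have hvec : (∑ k, c k • fun i => (w k i : ℚ)) = 0 := by
        funext i
        simp only [Finset.sum_apply, Pi.smul_apply, smul_eq_mul, Pi.zero_apply]
        exact hcoef i
      exact (Fintype.linearIndependent_iff.1 hli_u) c hvec k
    -- `SchanuelRank m` on `z̄`
    have hSR : (m : Cardinal) ≤ Algebra.trdeg ℚ
        ↥(IntermediateField.adjoin ℚ (Set.range z ∪ Set.range (cexp ∘ z))) := hrank m hmn z hzli
    -- `z_k ∈ L` and `e^{z_k} ∈ L` are killed by `D`
    set zLk : Fin m → L := fun k => ∑ i, (w k i : L) * xL i with hzLk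
    have hzcoe : ∀ k, ((zLk k : L) : ℂ) = z k := fun k => by
      simp only [hzLk, hz, hxL]
      push_cast
      rfl
    have hDz0 : ∀ k, D (zLk k) = 0 := fun k => by
      obtain ⟨l, hl0, hl⟩ := (hmemN _).mp (Submodule.mem_comap.mp (huV k))
      have hTz : T (fun i => (w k i : ℚ)) = z k := by
        rw [hTapply, hz]
        exact Finset.sum_congr rfl fun i _ => by rw [Rat.smul_def, Rat.cast_intCast]
      have hl' : l = zLk k := Subtype.ext (by rw [hl, hTz, hzcoe])
      rw [← hl']
      exact hl0
    set ezLk : Fin m → L := fun k => ∏ i, yL i ^ w k i with hezLk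
    have hezcoe : ∀ k, ((ezLk k : L) : ℂ) = cexp (z k) := fun k => by
      rw [hz]
      dsimp only
      rw [Complex.exp_sum]
      simp only [hezLk, hyL]
      push_cast
      refine Finset.prod_congr rfl fun i _ => ?_
      rw [Complex.exp_int_mul]
      exact map_zpow₀ (algebraMap (↥L) ℂ) _ _
    have hDez0 : ∀ k, D (ezLk k) = 0 := fun k => by
      simp only [hezLk]
      rw [derivation_prod_zpow_of_exp D xL yL hy0 hDE (w k)]
      have : D (∑ i, (w k i : L) * xL i) = 0 := hDz0 k
      rw [this, mul_zero]
    set Sz : Set ℂ := Set.range z ∪ Set.range (cexp ∘ z) with hSz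
    set Nz : IntermediateField ℚ ℂ := IntermediateField.adjoin ℚ Sz with hNz
    have hle : Nz ≤ L := by
      rw [hNz, IntermediateField.adjoin_le_iff]
      rintro t (⟨k, rfl⟩ | ⟨k, rfl⟩)
      · rw [← hzcoe]; exact (zLk k).2
      · simp only [Function.comp_apply]; rw [← hezcoe]; exact (ezLk k).2
    have hιE : ∀ (t : ℂ) (ht : t ∈ Nz), (⟨t, hle ht⟩ : L) ∈ CD := by
      intro t ht
      rw [hmemCD]
      induction ht using IntermediateField.adjoin_induction with
      | mem t ht =>
        rcases ht with ⟨k, rfl⟩ | ⟨k, rfl⟩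
        · have h' : (⟨z k, hle (IntermediateField.subset_adjoin ℚ Sz (Or.inl ⟨k, rfl⟩))⟩ : L) =
              zLk k := Subtype.ext (hzcoe k).symm
          rw [h']; exact hDz0 k
        · have h' : (⟨(cexp ∘ z) k, hle (IntermediateField.subset_adjoin ℚ Sz (Or.inr ⟨k, rfl⟩))⟩ : L) =
              ezLk k := Subtype.ext (hezcoe k).symm
          rw [h']; exact hDez0 k
      | algebraMap c => exact D.map_algebraMap c
      | add s t hs ht ihs iht =>
        have h' : (⟨s + t, hle (add_mem hs ht)⟩ : L) = ⟨s, hle hs⟩ + ⟨t, hle ht⟩ := rfl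
        rw [h', map_add, ihs, iht, add_zero]
      | inv s hs ihs =>
        have h' : (⟨s⁻¹, hle (inv_mem hs)⟩ : L) = (⟨s, hle hs⟩)⁻¹ := rfl
        rw [h', Derivation.leibniz_inv, ihs, smul_zero]
      | mul s t hs ht ihs iht =>
        have h' : (⟨s * t, hle (mul_mem hs ht)⟩ : L) = ⟨s, hle hs⟩ * ⟨t, hle ht⟩ := rfl
        rw [h', Derivation.leibniz, ihs, iht, smul_zero, smul_zero, add_zero]
    -- assembling: `n + 1 = m + (n' + 1) ≤ trdeg_ℚ Nz + trdeg_CD L ≤ trdeg_ℚ L < n`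
    have htower := trdeg_add_le_of_le_subring L Nz hle CD hFCD hιE
    have hfinal : ((n + 1 : ℕ) : Cardinal) ≤ Algebra.trdeg ℚ L :=
      calc ((n + 1 : ℕ) : Cardinal) = (m : Cardinal) + ((n' + 1 : ℕ) : Cardinal) := by
            rw [← hnm]; push_cast; ring
        _ ≤ Algebra.trdeg ℚ Nz + Algebra.trdeg CD L := add_le_add hSR h1
        _ ≤ Algebra.trdeg ℚ L := htower
    have hlt : ((n + 1 : ℕ) : Cardinal) < (n : Cardinal) := lt_of_le_of_lt hfinal htr
    have : n + 1 < n := by exact_mod_cast hlt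
    omega


/-- **ISOLATION**: a first failure `x` is an isolated point of `𝒵_W = {z | (z, eᶻ) ∈ W}`: every
`z ≠ x` close to `x` violates some ℚ-relation of `(x, eˣ)` (inverse function theorem at the
non-degenerate Khovanskii point, tree `hasStrictFDerivAt_khovanskiiMap`). -/
theorem firstFailure_isolated {n : ℕ} {x : Fin n → ℂ} (hxli : LinearIndependent ℚ x)
    (htr : Algebra.trdeg ℚ ↥(IntermediateField.adjoin ℚ (range x ∪ range (cexp ∘ x))) < (n : Cardinal))
    (hrank : ∀ r < n, SchanuelRank r) :
    ∀ᶠ z in 𝓝[≠] x, ∃ p : MvPolynomial (Fin n ⊕ Fin n) ℚ,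
      MvPolynomial.aeval (Sum.elim x (cexp ∘ x)) p = 0 ∧
      MvPolynomial.aeval (Sum.elim z (cexp ∘ z)) p ≠ 0 := by
  classical
  obtain ⟨g, hg0, hdet⟩ := firstFailure_khovanskii hxli htr hrank
  set f : Fin n → MvPolynomial (Fin n ⊕ Fin n) ℂ := fun i => MvPolynomial.map (algebraMap ℚ ℂ) (g i)
    with hf
  have hmap : ∀ z : Fin n → ℂ, ∀ i, khovanskiiMap f z i =
      MvPolynomial.aeval (Sum.elim z (cexp ∘ z)) (g i) := by
    intro z i
    simp only [khovanskiiMap, hf]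
    rw [MvPolynomial.eval_map, ← MvPolynomial.aeval_def]
    rfl
  have hjac : Khovanskii.kjac x f = Matrix.of fun i j =>
      MvPolynomial.aeval (Sum.elim x (cexp ∘ x)) (Khovanskii.ePD j (g i)) := by
    ext i j
    simp only [Khovanskii.kjac, Matrix.of_apply, hf]
    rw [Khovanskii.ePD_map, MvPolynomial.eval_map, ← MvPolynomial.aeval_def]
    rfl
  have hx0 : khovanskiiMap f x = 0 := by
    funext i; rw [hmap, hg0 i]; rfl
  -- inverse function theorem at the non-degenerate point
  set A := LinearMap.toContinuousLinearMap (Matrix.toLin' (Khovanskii.kjac x f)) with hA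
  have hAdet : A.det ≠ 0 := by
    rw [hA, ContinuousLinearMap.det, LinearMap.coe_toContinuousLinearMap, LinearMap.det_toLin', hjac]
    exact hdet
  have hF : HasStrictFDerivAt (khovanskiiMap f)
      ((A.toContinuousLinearEquivOfDetNeZero hAdet : (Fin n → ℂ) ≃L[ℂ] (Fin n → ℂ)) :
        (Fin n → ℂ) →L[ℂ] (Fin n → ℂ)) x := by
    rw [ContinuousLinearMap.coe_toContinuousLinearEquivOfDetNeZero]
    exact hasStrictFDerivAt_khovanskiiMap f x
  have hx' : hF.localInverse _ _ _ (khovanskiiMap f x) = x := hF.localInverse_apply_image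
  have hev : ∀ᶠ z in 𝓝 x, hF.localInverse _ _ _ (khovanskiiMap f z) = z := hF.eventually_left_inverse
  rw [eventually_nhdsWithin_iff]
  filter_upwards [hev] with z hz hne
  -- if all relations of `x` vanished at `z`, then `F z = 0 = F x`, so `z = x`
  by_contra hall
  push Not at hall
  apply hne
  have hz0 : khovanskiiMap f z = 0 := by
    funext i; rw [hmap]; exact hall (g i) (hg0 i)
  calc z = hF.localInverse _ _ _ (khovanskiiMap f z) := hz.symm
    _ = hF.localInverse _ _ _ (khovanskiiMap f x) := by rw [hz0, hx0]
    _ = x := hx'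


/-- **Every mate with the same relations is isolated in `𝒵_W`** (relations of `x` fail near `x'`):
for `x'` ℚ-linearly independent satisfying the relations of the first failure `x`, and conversely
(`hsymm`, automatic for mates of first failures), every `z ≠ x'` near `x'` violates a relation of `x`
(the linear independence of `x` itself is not even needed).
[cite: Kirby2010, Prop. 7.2] -/
theorem mate_isolated_of_symm {n : ℕ} {x x' : Fin n → ℂ}
    (htr : Algebra.trdeg ℚ ↥(IntermediateField.adjoin ℚ (range x ∪ range (cexp ∘ x))) < (n : Cardinal))
    (hrank : ∀ r < n, SchanuelRank r) (hx'li : LinearIndependent ℚ x')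
    (hrel : ∀ p : MvPolynomial (Fin n ⊕ Fin n) ℚ,
      MvPolynomial.aeval (Sum.elim x (cexp ∘ x)) p = 0 →
      MvPolynomial.aeval (Sum.elim x' (cexp ∘ x')) p = 0)
    (hsymm : ∀ p : MvPolynomial (Fin n ⊕ Fin n) ℚ,
      MvPolynomial.aeval (Sum.elim x' (cexp ∘ x')) p = 0 →
      MvPolynomial.aeval (Sum.elim x (cexp ∘ x)) p = 0) :
    ∀ᶠ z in 𝓝[≠] x', ∃ p : MvPolynomial (Fin n ⊕ Fin n) ℚ,
      MvPolynomial.aeval (Sum.elim x (cexp ∘ x)) p = 0 ∧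
      MvPolynomial.aeval (Sum.elim z (cexp ∘ z)) p ≠ 0 := by
  -- `x'` is itself a first failure: its transcendence degree cannot exceed that of `x`
  have htr' : Algebra.trdeg ℚ ↥(IntermediateField.adjoin ℚ (range x' ∪ range (cexp ∘ x'))) <
      (n : Cardinal) := by
    by_contra h
    apply (not_le.2 htr)
    -- an independent family for `x'` of size `n` would pull back to `x` along the relations
    have hm : (n : Cardinal) ≤ Algebra.trdeg ℚ
        ↥(IntermediateField.adjoin ℚ (range x' ∪ range (cexp ∘ x'))) := not_lt.1 h
    classical
    set v : Fin n ⊕ Fin n → ℂ := Sum.elim x (cexp ∘ x) with hv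
    set v' : Fin n ⊕ Fin n → ℂ := Sum.elim x' (cexp ∘ x') with hv'
    have hS : range x ∪ range (cexp ∘ x) = range v := by rw [hv, Set.Sum.elim_range]
    have hS' : range x' ∪ range (cexp ∘ x') = range v' := by rw [hv', Set.Sum.elim_range]
    rw [hS]
    rw [hS'] at hm
    have hm' : (n : ℕ∞) ≤ (GammaField.algMatroid ℂ).eRk (range v') :=
      ZilberHomogeneity.natCast_le_eRk_of_le_trdeg hm
    obtain ⟨J, hJsub, hJind, hJcard⟩ := Matroid.le_eRk_iff.1 hm'
    have hpre : ∀ j : J, ∃ i : Fin n ⊕ Fin n, v' i = (j : ℂ) := fun j => hJsub j.2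
    choose f hf using hpre
    have hinj : Function.Injective f := by
      intro j j' h
      apply Subtype.ext
      rw [← hf j, ← hf j', h]
    have hvf : v' ∘ f = (Subtype.val : J → ℂ) := funext hf
    have hJind' : AlgebraicIndependent ℚ (v' ∘ f) := by
      rw [hvf]; exact AlgebraicIndependent.matroid_indep_iff.1 hJind
    have hind : AlgebraicIndependent ℚ (v ∘ f) := by
      rw [algebraicIndependent_iff] at hJind' ⊢
      intro P hP
      refine hJind' P ?_
      have h1 : MvPolynomial.aeval v (MvPolynomial.rename f P) = 0 := by
        rw [MvPolynomial.aeval_rename]; exact hP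
      have h2 := hrel _ h1
      rwa [MvPolynomial.aeval_rename] at h2
    have hI : (GammaField.algMatroid ℂ).Indep (range (v ∘ f)) :=
      AlgebraicIndependent.matroid_indep_iff.2 hind.to_subtype_range
    have hIsub : range (v ∘ f) ⊆ range v := by
      rintro a ⟨j, rfl⟩; exact ⟨f j, rfl⟩
    have hcard : (range (v ∘ f)).encard = n := by
      rw [← hJcard, ← Set.image_univ, (hind.injective.injOn).encard_image, Set.encard_univ]
      simp
    have hle : (n : ℕ∞) ≤ (GammaField.algMatroid ℂ).eRk (range v) := by
      rw [← hcard]; exact hI.encard_le_eRk_of_subset hIsub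
    exact le_trdeg_adjoin_of_natCast_le_eRk hle
  have h := firstFailure_isolated hx'li htr' hrank
  filter_upwards [h] with z hz
  obtain ⟨p, hp0, hpz⟩ := hz
  exact ⟨p, hsymm p hp0, hpz⟩

/-- Hence the mates with symmetric relations form a DISCRETE set: near such a mate `x'` there is no
other tuple satisfying the relations of `x`. [cite: Kirby2010, Remark 3.4] -/
theorem locusMates_discrete_of_symm {n : ℕ} {x x' : Fin n → ℂ}
    (htr : Algebra.trdeg ℚ ↥(IntermediateField.adjoin ℚ (range x ∪ range (cexp ∘ x))) < (n : Cardinal))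
    (hrank : ∀ r < n, SchanuelRank r) (hx'li : LinearIndependent ℚ x')
    (hrel : ∀ p : MvPolynomial (Fin n ⊕ Fin n) ℚ,
      MvPolynomial.aeval (Sum.elim x (cexp ∘ x)) p = 0 →
      MvPolynomial.aeval (Sum.elim x' (cexp ∘ x')) p = 0)
    (hsymm : ∀ p : MvPolynomial (Fin n ⊕ Fin n) ℚ,
      MvPolynomial.aeval (Sum.elim x' (cexp ∘ x')) p = 0 →
      MvPolynomial.aeval (Sum.elim x (cexp ∘ x)) p = 0) :
    ∀ᶠ z in 𝓝[≠] x', ¬ ∀ p : MvPolynomial (Fin n ⊕ Fin n) ℚ,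
      MvPolynomial.aeval (Sum.elim x (cexp ∘ x)) p = 0 →
      MvPolynomial.aeval (Sum.elim z (cexp ∘ z)) p = 0 := by
  filter_upwards [mate_isolated_of_symm htr hrank hx'li hrel hsymm] with z hz hall
  obtain ⟨p, hp0, hpz⟩ := hz
  exact hpz (hall p hp0)


end Khov

/-- **§17 HEADLINE 1 — A FIRST FAILURE IS A NON-DEGENERATE KHOVANSKII POINT OF ITS OWN LOCUS**: there are
`n` relations `g₁,…,gₙ ∈ relIdeal x` with `det((∂/∂Xⱼ + Yⱼ∂/∂Yⱼ) gᵢ)(x, eˣ) ≠ 0`.  (Khovanskii dichotomy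
in `ℚ(x, eˣ)` — tree `khovanskii_dichotomy`; the alternative, a non-zero E-derivation for `x ↦ eˣ`, is
killed by Ax 1971 Thm 3 WITH its rank term + `SchanuelRank m` on the constants `q·x` + the tower law:
`n + 1 ≤ trdeg ℚ(x, eˣ) < n`.)  Kirby's Prop. 7.2 read POINTWISE: the Khovanskii system witnessing
`x ∈ ecl(∅)` can be taken inside `relIdeal x`, in the variables of `x` alone. -/
theorem IsFirstFailure.khovanskii_point {n : ℕ} {x : Fin n → ℂ} (hx : IsFirstFailure x) :
    ∃ g : Fin n → MvPolynomial (Fin n ⊕ Fin n) ℚ,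
      (∀ i, MvPolynomial.aeval (Sum.elim x (cexp ∘ x)) (g i) = 0) ∧
      (Matrix.of fun i j => MvPolynomial.aeval (Sum.elim x (cexp ∘ x))
        (Khovanskii.ePD j (g i))).det ≠ 0 :=
  Khov.firstFailure_khovanskii hx.1 hx.2.1 hx.2.2

/-- **§17 HEADLINE 2 — A FIRST FAILURE IS AN ISOLATED POINT OF `𝒵_W = {z | (z, eᶻ) ∈ W}`**: every
`z ≠ x` close enough to `x` violates some ℚ-relation of `(x, eˣ)` (inverse function theorem at the
non-degenerate Khovanskii point).  Full topological isolation, every rank — supersedes §16's arc form. -/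
theorem IsFirstFailure.isolated {n : ℕ} {x : Fin n → ℂ} (hx : IsFirstFailure x) :
    ∀ᶠ z in 𝓝[≠] x, ∃ p : MvPolynomial (Fin n ⊕ Fin n) ℚ,
      MvPolynomial.aeval (Sum.elim x (cexp ∘ x)) p = 0 ∧
      MvPolynomial.aeval (Sum.elim z (cexp ∘ z)) p ≠ 0 :=
  Khov.firstFailure_isolated hx.1 hx.2.1 hx.2.2

/-- **§17 HEADLINE 3 — EVERY LOCUS MATE OF A FIRST FAILURE IS ISOLATED IN `𝒵_W`** (`W` = locus of `x`):
near a mate `x'`, every other tuple violates a relation of `x` (mates are first failures with the same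
relation ideal, §11). -/
theorem IsFirstFailure.mate_isolated {n : ℕ} {x x' : Fin n → ℂ} (hx : IsFirstFailure x)
    (hx' : x' ∈ locusMates x) :
    ∀ᶠ z in 𝓝[≠] x', ∃ p : MvPolynomial (Fin n ⊕ Fin n) ℚ,
      MvPolynomial.aeval (Sum.elim x (cexp ∘ x)) p = 0 ∧
      MvPolynomial.aeval (Sum.elim z (cexp ∘ z)) p ≠ 0 :=
  Khov.mate_isolated_of_symm hx.2.1 hx.2.2 hx'.1 hx'.2
    fun p hp => mate_relations_symm ⟨hx.1, hx.2.1, hx.2.2⟩ hx' p hp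

/-- Hence **`locusMates x` is a DISCRETE subset of `ℂⁿ`**: no mate is a limit of other mates. -/
theorem IsFirstFailure.locusMates_discrete {n : ℕ} {x x' : Fin n → ℂ} (hx : IsFirstFailure x)
    (hx' : x' ∈ locusMates x) : ∀ᶠ z in 𝓝[≠] x', z ∉ locusMates x := by
  filter_upwards [hx.mate_isolated hx'] with z hz hzm
  obtain ⟨p, hp0, hpz⟩ := hz
  exact hpz (hzm.2 p hp0)

/-- **The non-isolated part of `𝒵_W` is ℚ-linearly DEPENDENT**: a point of `𝒵_W` at which `𝒵_W`
accumulates is not ℚ-linearly independent (ℚ-independent points of `𝒵_W` are mates, hence isolated).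
So locus mates can only "escape": to infinity, or towards the rational hyperplanes `{q·z = 0} ∩ 𝒵_W` —
the honest residue of stub 7 / `ExpSectorTwo`; there is NO local finiteness content left in the crux. -/
theorem IsFirstFailure.not_linearIndependent_of_accumulation {n : ℕ} {x z : Fin n → ℂ}
    (hx : IsFirstFailure x)
    (hacc : ∃ᶠ w in 𝓝[≠] z, ∀ p : MvPolynomial (Fin n ⊕ Fin n) ℚ,
      MvPolynomial.aeval (Sum.elim x (cexp ∘ x)) p = 0 →
      MvPolynomial.aeval (Sum.elim w (cexp ∘ w)) p = 0)
    (hz : ∀ p : MvPolynomial (Fin n ⊕ Fin n) ℚ,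
      MvPolynomial.aeval (Sum.elim x (cexp ∘ x)) p = 0 →
      MvPolynomial.aeval (Sum.elim z (cexp ∘ z)) p = 0) :
    ¬ LinearIndependent ℚ z := by
  intro hzli
  have hiso := hx.mate_isolated ⟨hzli, hz⟩
  obtain ⟨w, hw, hw'⟩ := (hacc.and_eventually hiso).exists
  obtain ⟨p, hp0, hpw⟩ := hw'
  exact hpw (hw p hp0)

/-- At rank 2 the dependent points of `𝒵_W` are the origin and the points on rational lines
`{a z₁ + b z₂ = 0}`; in particular (sanity check of the shape of the residue) a sequence of pairwise
distinct mates of a rank-2 first failure that CONVERGES in `ℂ²` has a ℚ-linearly dependent limit. -/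
theorem IsFirstFailure.tendsto_mates_limit_dependent {n : ℕ} {x z : Fin n → ℂ} (hx : IsFirstFailure x)
    {u : ℕ → Fin n → ℂ} (hu : ∀ k, u k ∈ locusMates x) (hne : ∀ k, u k ≠ z)
    (hlim : Tendsto u atTop (𝓝 z)) : ¬ LinearIndependent ℚ z := by
  -- `z ∈ 𝒵_W` by closedness of each relation, and `𝒵_W` accumulates at `z`
  have hcont : ∀ p : MvPolynomial (Fin n ⊕ Fin n) ℚ, Continuous fun w : Fin n → ℂ =>
      MvPolynomial.aeval (Sum.elim w (cexp ∘ w)) p := by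
    intro p
    have h1 : Continuous fun w : Fin n → ℂ => (Sum.elim w (cexp ∘ w) : Fin n ⊕ Fin n → ℂ) := by
      refine continuous_pi fun s => ?_
      rcases s with i | i
      · exact continuous_apply i
      · exact Complex.continuous_exp.comp (continuous_apply i)
    have e : (fun w : Fin n → ℂ => MvPolynomial.aeval (Sum.elim w (cexp ∘ w)) p) =
        fun w => MvPolynomial.eval (Sum.elim w (cexp ∘ w)) (MvPolynomial.map (algebraMap ℚ ℂ) p) := by
      funext w
      rw [MvPolynomial.eval_map, ← MvPolynomial.aeval_def]
    rw [e]
    exact (MvPolynomial.continuous_eval _).comp h1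
  have hz : ∀ p : MvPolynomial (Fin n ⊕ Fin n) ℚ,
      MvPolynomial.aeval (Sum.elim x (cexp ∘ x)) p = 0 →
      MvPolynomial.aeval (Sum.elim z (cexp ∘ z)) p = 0 := by
    intro p hp
    have hseq : Tendsto (fun k => MvPolynomial.aeval (Sum.elim (u k) (cexp ∘ u k)) p) atTop
        (𝓝 (MvPolynomial.aeval (Sum.elim z (cexp ∘ z)) p)) := ((hcont p).tendsto z).comp hlim
    have hzero : (fun k => MvPolynomial.aeval (Sum.elim (u k) (cexp ∘ u k)) p) = fun _ => 0 :=
      funext fun k => (hu k).2 p hp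
    rw [hzero] at hseq
    exact tendsto_nhds_unique hseq tendsto_const_nhds
  refine hx.not_linearIndependent_of_accumulation ?_ hz
  -- frequently in the punctured neighbourhood filter: the sequence visits every punctured nbhd
  rw [Filter.frequently_iff]
  intro U hU
  rw [mem_nhdsWithin] at hU
  obtain ⟨V, hVopen, hzV, hVU⟩ := hU
  have hev : ∀ᶠ k in atTop, u k ∈ V := hlim (hVopen.mem_nhds hzV)
  obtain ⟨k, hk⟩ := hev.exists
  exact ⟨u k, hVU ⟨hk, hne k⟩, fun p hp => (hu k).2 p hp⟩

/-! ### §17b Accumulation points have defect ≥ 2; at rank 2 only the origin -/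

/-- An algebraically independent `(n−1)`-sub-family from the transcendence degree alone (cf. §11
`exists_indep_subfamily`, which derives the bound from linear independence). -/
theorem exists_indep_subfamily_of_trdeg {n : ℕ} {x' : Fin n → ℂ}
    (hm : ((n - 1 : ℕ) : Cardinal) ≤
      Algebra.trdeg ℚ ↥(IntermediateField.adjoin ℚ (range x' ∪ range (cexp ∘ x')))) :
    ∃ f : Fin (n - 1) → Fin n ⊕ Fin n, AlgebraicIndependent ℚ (Sum.elim x' (cexp ∘ x') ∘ f) := by
  classical
  set v' : Fin n ⊕ Fin n → ℂ := Sum.elim x' (cexp ∘ x') with hv'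
  have hS' : range x' ∪ range (cexp ∘ x') = range v' := by rw [hv', Set.Sum.elim_range]
  rw [hS'] at hm
  have hm' : ((n - 1 : ℕ) : ℕ∞) ≤ (GammaField.algMatroid ℂ).eRk (range v') :=
    ZilberHomogeneity.natCast_le_eRk_of_le_trdeg hm
  obtain ⟨J, hJsub, hJind, hJcard⟩ := Matroid.le_eRk_iff.1 hm'
  have hpre : ∀ j : J, ∃ i : Fin n ⊕ Fin n, v' i = (j : ℂ) := fun j => hJsub j.2
  choose f hf using hpre
  have hvf : v' ∘ f = (Subtype.val : J → ℂ) := funext hf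
  have hJind' : AlgebraicIndependent ℚ (v' ∘ f) := by
    rw [hvf]; exact AlgebraicIndependent.matroid_indep_iff.1 hJind
  have hfin : J.Finite := Set.finite_of_encard_eq_coe hJcard
  haveI : Fintype J := hfin.fintype
  have hcardJ : Fintype.card J = n - 1 := by
    have h := hJcard
    rw [Set.encard_eq_coe_toFinset_card, Set.toFinset_card] at h
    exact_mod_cast h
  let e : Fin (n - 1) ≃ J := (Fintype.equivFinOfCardEq hcardJ).symm
  refine ⟨f ∘ e, ?_⟩
  have : v' ∘ (f ∘ e) = (v' ∘ f) ∘ e := rfl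
  rw [this]
  exact hJind'.comp _ e.injective

/-- **Relations are symmetric on points of full transcendence degree** (variant of §11
`mate_relations_symm` with `n − 1 ≤ trdeg ℚ(x', e^{x'})` in place of the linear independence of `x'`):
if `x'` satisfies the relations of the first failure `x` and `trdeg ℚ(x', e^{x'}) ≥ n − 1`, then `x`
satisfies the relations of `x'`. -/
theorem relations_symm_of_trdeg {n : ℕ} {x x' : Fin n → ℂ} (hx : IsFirstFailure x)
    (hrel : ∀ p : MvPolynomial (Fin n ⊕ Fin n) ℚ,
      MvPolynomial.aeval (Sum.elim x (cexp ∘ x)) p = 0 →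
      MvPolynomial.aeval (Sum.elim x' (cexp ∘ x')) p = 0)
    (hm : ((n - 1 : ℕ) : Cardinal) ≤
      Algebra.trdeg ℚ ↥(IntermediateField.adjoin ℚ (range x' ∪ range (cexp ∘ x'))))
    (p : MvPolynomial (Fin n ⊕ Fin n) ℚ)
    (hp : MvPolynomial.aeval (Sum.elim x' (cexp ∘ x')) p = 0) :
    MvPolynomial.aeval (Sum.elim x (cexp ∘ x)) p = 0 := by
  classical
  set v : Fin n ⊕ Fin n → ℂ := Sum.elim x (cexp ∘ x) with hv
  set v' : Fin n ⊕ Fin n → ℂ := Sum.elim x' (cexp ∘ x') with hv'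
  have hn : 1 ≤ n := le_trans (by norm_num) (two_le_of_isFirstFailure hx)
  obtain ⟨f, hf'⟩ := exists_indep_subfamily_of_trdeg hm
  have hf : AlgebraicIndependent ℚ (v ∘ f) := algebraicIndependent_of_relations hrel f hf'
  set a : ℂ := MvPolynomial.aeval v p with ha
  by_contra ha0
  set B : Subalgebra ℚ ℂ := Algebra.adjoin ℚ (range (v ∘ f)) with hB
  have halg : IsAlgebraic B a := by
    by_contra htr
    have hind : AlgebraicIndependent ℚ (fun o : Option (Fin (n - 1)) => o.elim a (v ∘ f)) :=
      AlgebraicIndependent.option_iff.2 ⟨hf, htr⟩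
    set K := IntermediateField.adjoin ℚ (range x ∪ range (cexp ∘ x)) with hK
    have hvK : ∀ i, v i ∈ K := by
      rintro (i | i)
      · exact IntermediateField.subset_adjoin ℚ _ (Or.inl ⟨i, rfl⟩)
      · exact IntermediateField.subset_adjoin ℚ _ (Or.inr ⟨i, rfl⟩)
    have haK : a ∈ K := by
      rw [ha, MvPolynomial.aeval_def, MvPolynomial.eval₂_eq]
      refine sum_mem fun m _ => mul_mem ?_ (prod_mem fun i _ => pow_mem (hvK i) _)
      exact (algebraMap ℚ K (p.coeff m)).2
    have hmemK : ∀ o : Option (Fin (n - 1)), (o.elim a (v ∘ f) : ℂ) ∈ K := by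
      rintro (_ | i)
      · exact haK
      · exact hvK (f i)
    let w : Option (Fin (n - 1)) → K := fun o => ⟨o.elim a (v ∘ f), hmemK o⟩
    have hw : AlgebraicIndependent ℚ w := AlgebraicIndependent.of_comp K.val hind
    have hle := hw.cardinalMk_le_trdeg
    have hcard : Cardinal.mk (Option (Fin (n - 1))) = (n : Cardinal) := by
      rw [Cardinal.mk_option, Cardinal.mk_fin]
      have : ((n - 1 : ℕ) : Cardinal) + 1 = ((n - 1 + 1 : ℕ) : Cardinal) := by push_cast; rfl
      rw [this, Nat.sub_add_cancel hn]
    rw [hcard] at hle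
    exact (not_le.2 hx.2.1) hle
  obtain ⟨q, hq0, hqa⟩ := halg
  obtain ⟨q₁, hq₁, hndvd⟩ := Polynomial.exists_eq_pow_rootMultiplicity_mul_and_not_dvd q hq0 0
  have hq₁0 : q₁.coeff 0 ≠ 0 := by
    intro h0
    apply hndvd
    rw [map_zero, sub_zero]
    exact Polynomial.X_dvd_iff.2 h0
  have hq₁a : Polynomial.aeval a q₁ = 0 := by
    have h := hqa
    rw [hq₁, map_mul, map_pow, map_sub, Polynomial.aeval_X, Polynomial.aeval_C, map_zero,
      sub_zero] at h
    exact (mul_eq_zero.1 h).resolve_left (pow_ne_zero _ ha0)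
  have hcoef : ∀ j : ℕ, ∃ g : MvPolynomial (Fin (n - 1)) ℚ,
      MvPolynomial.aeval (v ∘ f) g = ((q₁.coeff j : B) : ℂ) := by
    intro j
    have hmem : ((q₁.coeff j : B) : ℂ) ∈ Algebra.adjoin ℚ (range (v ∘ f)) := (q₁.coeff j).2
    rw [Algebra.adjoin_range_eq_range_aeval] at hmem
    obtain ⟨g, hg⟩ := hmem
    exact ⟨g, hg⟩
  choose g hg using hcoef
  set N := q₁.natDegree + 1 with hN
  set G : MvPolynomial (Fin n ⊕ Fin n) ℚ :=
    ∑ j ∈ Finset.range N, MvPolynomial.rename f (g j) * p ^ j with hG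
  have hGv : MvPolynomial.aeval v G = Polynomial.aeval a q₁ := by
    rw [Polynomial.aeval_eq_sum_range, hG, map_sum]
    refine Finset.sum_congr rfl fun j _ => ?_
    rw [map_mul, map_pow, MvPolynomial.aeval_rename, hg j, Algebra.smul_def]
    rfl
  have hG0 : MvPolynomial.aeval v G = 0 := by rw [hGv, hq₁a]
  have hG0' : MvPolynomial.aeval v' G = 0 := hrel G hG0
  have hpv' : MvPolynomial.aeval v' p = 0 := hp
  have hGv' : MvPolynomial.aeval v' G = MvPolynomial.aeval (v' ∘ f) (g 0) := by
    rw [hG, map_sum, Finset.sum_eq_single 0]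
    · rw [map_mul, pow_zero, map_one, mul_one, MvPolynomial.aeval_rename]
    · intro j _ hj
      rw [map_mul, map_pow, hpv', zero_pow hj, mul_zero]
    · intro h
      exact absurd (Finset.mem_range.2 (by rw [hN]; omega)) h
  have hg0 : g 0 = 0 := by
    apply algebraicIndependent_iff.1 hf'
    rw [← hGv']
    exact hG0'
  apply hq₁0
  have hc : ((q₁.coeff 0 : B) : ℂ) = 0 := by rw [← hg 0, hg0, map_zero]
  exact_mod_cast hc

/-- **Points of `𝒵_W` of full transcendence degree are MATES** (ℚ-linearly independent): a ℚ-linear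
relation of `z` would be a relation of `(z, eᶻ)`, hence (symmetry) of `(x, eˣ)`, contradicting the
independence of `x`. -/
theorem IsFirstFailure.linearIndependent_of_trdeg {n : ℕ} {x z : Fin n → ℂ} (hx : IsFirstFailure x)
    (hz : ∀ p : MvPolynomial (Fin n ⊕ Fin n) ℚ,
      MvPolynomial.aeval (Sum.elim x (cexp ∘ x)) p = 0 →
      MvPolynomial.aeval (Sum.elim z (cexp ∘ z)) p = 0)
    (hm : ((n - 1 : ℕ) : Cardinal) ≤
      Algebra.trdeg ℚ ↥(IntermediateField.adjoin ℚ (range z ∪ range (cexp ∘ z)))) :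
    LinearIndependent ℚ z := by
  classical
  rw [Fintype.linearIndependent_iff]
  intro c hc
  set Λ : MvPolynomial (Fin n ⊕ Fin n) ℚ := ∑ i, MvPolynomial.C (c i) * MvPolynomial.X (Sum.inl i)
    with hΛ
  have hΛeval : ∀ y : Fin n → ℂ, MvPolynomial.aeval (Sum.elim y (cexp ∘ y)) Λ = ∑ i, c i • y i := by
    intro y
    simp only [hΛ, map_sum, map_mul, MvPolynomial.aeval_C, MvPolynomial.aeval_X, Sum.elim_inl]
    refine Finset.sum_congr rfl fun i _ => ?_
    rw [Rat.smul_def]; rfl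
  have hΛz : MvPolynomial.aeval (Sum.elim z (cexp ∘ z)) Λ = 0 := by rw [hΛeval, hc]
  have hΛx := relations_symm_of_trdeg hx hz hm Λ hΛz
  rw [hΛeval] at hΛx
  exact (Fintype.linearIndependent_iff.1 hx.1) c hΛx

/-- **ACCUMULATION POINTS OF `𝒵_W` HAVE DEFECT ≥ 2**: if `𝒵_W` accumulates at its point `z`, then
`trdeg ℚ(z, eᶻ) < n − 1` (else `z` would be a mate, hence isolated, §17). -/
theorem IsFirstFailure.trdeg_lt_of_accumulation {n : ℕ} {x z : Fin n → ℂ} (hx : IsFirstFailure x)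
    (hacc : ∃ᶠ w in 𝓝[≠] z, ∀ p : MvPolynomial (Fin n ⊕ Fin n) ℚ,
      MvPolynomial.aeval (Sum.elim x (cexp ∘ x)) p = 0 →
      MvPolynomial.aeval (Sum.elim w (cexp ∘ w)) p = 0)
    (hz : ∀ p : MvPolynomial (Fin n ⊕ Fin n) ℚ,
      MvPolynomial.aeval (Sum.elim x (cexp ∘ x)) p = 0 →
      MvPolynomial.aeval (Sum.elim z (cexp ∘ z)) p = 0) :
    Algebra.trdeg ℚ ↥(IntermediateField.adjoin ℚ (range z ∪ range (cexp ∘ z))) <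
      ((n - 1 : ℕ) : Cardinal) := by
  by_contra h
  exact hx.not_linearIndependent_of_accumulation hacc hz
    (hx.linearIndependent_of_trdeg hz (not_lt.1 h))

/-- In transcendence degree `0` every generator is algebraic. -/
theorem isAlgebraic_of_trdeg_lt_one {S : Set ℂ}
    (htr : Algebra.trdeg ℚ ↥(IntermediateField.adjoin ℚ S) < (1 : Cardinal)) {t : ℂ} (ht : t ∈ S) :
    IsAlgebraic ℚ t := by
  by_contra htt
  have hind : AlgebraicIndependent ℚ ![t] := algebraicIndependent_iff_transcendental.2 htt
  set K := IntermediateField.adjoin ℚ S with hK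
  let v : Fin 1 → K := fun _ => ⟨t, IntermediateField.subset_adjoin ℚ _ ht⟩
  have hv : AlgebraicIndependent ℚ v := by
    refine AlgebraicIndependent.of_comp K.val ?_
    convert hind using 1
    funext i; fin_cases i; rfl
  have h1 : (1 : Cardinal) ≤ Algebra.trdeg ℚ K := by simpa using hv.cardinalMk_le_trdeg
  exact (not_le.2 htr) h1

/-- **RANK 2: THE ONLY POSSIBLE FINITE ACCUMULATION POINT OF THE MATES IS THE ORIGIN.**  If `𝒵_W`
accumulates at its point `z` for a rank-2 first failure, then `trdeg ℚ(z, eᶻ) = 0`, so `zᵢ` and `e^{zᵢ}`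
are algebraic and Hermite–Lindemann forces `z = 0`.  Hence at the first open rank the finiteness residue
of the crux (`ExpSectorTwo` / stub 7) reads: *the mates are bounded in `ℂ²` and do not accumulate at
`0`* (the latter being void unless `(0; 1, 1) ∈ W`). -/
theorem IsFirstFailure.accumulation_eq_zero_of_rank_two {x z : Fin 2 → ℂ} (hx : IsFirstFailure x)
    (hacc : ∃ᶠ w in 𝓝[≠] z, ∀ p : MvPolynomial (Fin 2 ⊕ Fin 2) ℚ,
      MvPolynomial.aeval (Sum.elim x (cexp ∘ x)) p = 0 →
      MvPolynomial.aeval (Sum.elim w (cexp ∘ w)) p = 0)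
    (hz : ∀ p : MvPolynomial (Fin 2 ⊕ Fin 2) ℚ,
      MvPolynomial.aeval (Sum.elim x (cexp ∘ x)) p = 0 →
      MvPolynomial.aeval (Sum.elim z (cexp ∘ z)) p = 0) :
    z = 0 := by
  have htr := hx.trdeg_lt_of_accumulation hacc hz
  have htr1 : Algebra.trdeg ℚ ↥(IntermediateField.adjoin ℚ (range z ∪ range (cexp ∘ z))) <
      (1 : Cardinal) := by simpa using htr
  funext i
  by_contra hzi
  have halg : IsAlgebraic ℚ (z i) := isAlgebraic_of_trdeg_lt_one htr1 (Or.inl ⟨i, rfl⟩)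
  have halge : IsAlgebraic ℚ (cexp (z i)) := isAlgebraic_of_trdeg_lt_one htr1 (Or.inr ⟨i, rfl⟩)
  exact transcendental_exp_holds halg hzi halge

/-- Sequential form at rank 2: a convergent sequence of pairwise-distinct-from-the-limit mates of a
rank-2 first failure converges to the ORIGIN. -/
theorem IsFirstFailure.tendsto_mates_rank_two {x z : Fin 2 → ℂ} (hx : IsFirstFailure x)
    {u : ℕ → Fin 2 → ℂ} (hu : ∀ k, u k ∈ locusMates x) (hne : ∀ k, u k ≠ z)
    (hlim : Tendsto u atTop (𝓝 z)) : z = 0 := by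
  -- as in `tendsto_mates_limit_dependent`: `z ∈ 𝒵_W` and `𝒵_W` accumulates at `z`
  have hcont : ∀ p : MvPolynomial (Fin 2 ⊕ Fin 2) ℚ, Continuous fun w : Fin 2 → ℂ =>
      MvPolynomial.aeval (Sum.elim w (cexp ∘ w)) p := by
    intro p
    have h1 : Continuous fun w : Fin 2 → ℂ => (Sum.elim w (cexp ∘ w) : Fin 2 ⊕ Fin 2 → ℂ) := by
      refine continuous_pi fun s => ?_
      rcases s with i | i
      · exact continuous_apply i
      · exact Complex.continuous_exp.comp (continuous_apply i)
    have e : (fun w : Fin 2 → ℂ => MvPolynomial.aeval (Sum.elim w (cexp ∘ w)) p) =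
        fun w => MvPolynomial.eval (Sum.elim w (cexp ∘ w)) (MvPolynomial.map (algebraMap ℚ ℂ) p) := by
      funext w
      rw [MvPolynomial.eval_map, ← MvPolynomial.aeval_def]
    rw [e]
    exact (MvPolynomial.continuous_eval _).comp h1
  have hz : ∀ p : MvPolynomial (Fin 2 ⊕ Fin 2) ℚ,
      MvPolynomial.aeval (Sum.elim x (cexp ∘ x)) p = 0 →
      MvPolynomial.aeval (Sum.elim z (cexp ∘ z)) p = 0 := by
    intro p hp
    have hseq : Tendsto (fun k => MvPolynomial.aeval (Sum.elim (u k) (cexp ∘ u k)) p) atTop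
        (𝓝 (MvPolynomial.aeval (Sum.elim z (cexp ∘ z)) p)) := ((hcont p).tendsto z).comp hlim
    have hzero : (fun k => MvPolynomial.aeval (Sum.elim (u k) (cexp ∘ u k)) p) = fun _ => 0 :=
      funext fun k => (hu k).2 p hp
    rw [hzero] at hseq
    exact tendsto_nhds_unique hseq tendsto_const_nhds
  refine hx.accumulation_eq_zero_of_rank_two ?_ hz
  rw [Filter.frequently_iff]
  intro U hU
  rw [mem_nhdsWithin] at hU
  obtain ⟨V, hVopen, hzV, hVU⟩ := hU
  have hev : ∀ᶠ k in atTop, u k ∈ V := hlim (hVopen.mem_nhds hzV)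
  obtain ⟨k, hk⟩ := hev.exists
  exact ⟨u k, hVU ⟨hk, hne k⟩, fun p hp => (hu k).2 p hp⟩

end KhovOpens


/-! ## §18 (gen 4) RANK 2: `𝒵_W ⊆ Z(m₀) × Z(m₁)` is CLOSED DISCRETE — bounded sets of locus points are FINITE; `ExpSectorTwo` ⟺ "mates are bounded" -/

section RankTwoOpens
open Filter Topology
open Literature.NumberTheory.Transcendental.KernelTranslatesRankTwo (eval_map_finSuccEquiv
  finite_setOf_aeval_eq_zero exists_mvPolynomial_of_trdeg_lt_two)

/-! Technical development in the sub-namespace `RankTwo` (uses the lead's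
`Literature/NumberTheory/Transcendental/KernelTranslatesRankTwoSectors.lean`). -/
namespace RankTwo

/-- The one-variable exponential polynomial `s ↦ m(e^s, s)` attached to `m ∈ ℚ[T, S]`. -/
def expPoly (m : MvPolynomial (Fin 2) ℚ) (s : ℂ) : ℂ := MvPolynomial.aeval ![cexp s, s] m

theorem expPoly_def (m : MvPolynomial (Fin 2) ℚ) (s : ℂ) :
    expPoly m s = MvPolynomial.aeval ![cexp s, s] m := rfl

/-- `s ↦ m(e^s, s)` is analytic everywhere. -/
theorem analyticAt_expPoly (m : MvPolynomial (Fin 2) ℚ) (s₀ : ℂ) : AnalyticAt ℂ (expPoly m) s₀ := by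
  unfold expPoly
  induction m using MvPolynomial.induction_on with
  | C a =>
    have e : (fun s : ℂ => MvPolynomial.aeval ![cexp s, s] (MvPolynomial.C a)) = fun _ => (a : ℂ) := by
      funext s; simp
    rw [e]; exact analyticAt_const
  | add p q hp hq =>
    have e : (fun s : ℂ => MvPolynomial.aeval ![cexp s, s] (p + q)) =
        fun s => MvPolynomial.aeval ![cexp s, s] p + MvPolynomial.aeval ![cexp s, s] q := by
      funext s; simp
    rw [e]; exact hp.add hq
  | mul_X p i hp =>
    have e : (fun s : ℂ => MvPolynomial.aeval ![cexp s, s] (p * MvPolynomial.X i)) =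
        fun s => MvPolynomial.aeval ![cexp s, s] p * (![cexp s, s] i) := by
      funext s; simp
    rw [e]
    refine hp.mul ?_
    fin_cases i
    · exact analyticAt_cexp
    · exact analyticAt_id

/-- **A non-zero `m ∈ ℚ[T, S]` gives a non-zero exponential polynomial**: there is a rational `q ≠ 0`
with `m(e^q, q) ≠ 0` (Hermite–Lindemann: `e^q` is transcendental, so it is not a root of the non-zero
rational polynomial `m(·, q)` — non-zero for all `q` off the finitely many roots of the leading
coefficient). -/
theorem exists_rat_expPoly_ne_zero {m : MvPolynomial (Fin 2) ℚ} (hm : m ≠ 0) :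
    ∃ q : ℚ, q ≠ 0 ∧ expPoly m q ≠ 0 := by
  classical
  set M : Polynomial (MvPolynomial (Fin 1) ℚ) := MvPolynomial.finSuccEquiv ℚ 1 m with hM
  have hM0 : M ≠ 0 := by
    rw [hM]; exact (EmbeddingLike.map_ne_zero_iff).2 hm
  set L : MvPolynomial (Fin 1) ℚ := M.leadingCoeff with hL
  have hL0 : L ≠ 0 := Polynomial.leadingCoeff_ne_zero.2 hM0
  -- the leading coefficient, as a polynomial in `S`, has finitely many complex roots
  set L2 : MvPolynomial (Fin 2) ℚ := MvPolynomial.rename (fun _ : Fin 1 => (0 : Fin 2)) L with hL2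
  have hL20 : L2 ≠ 0 := by
    rw [hL2]
    exact (MvPolynomial.rename_injective _ (fun a b _ => Subsingleton.elim a b)).ne hL0
  have heval2 : ∀ z y : ℂ, MvPolynomial.aeval ![z, y] L2 = MvPolynomial.aeval (fun _ : Fin 1 => z) L := by
    intro z y
    rw [hL2, MvPolynomial.aeval_rename]
    rfl
  have htrans : Transcendental ℚ (cexp 1) := by
    intro h
    exact transcendental_exp_holds (isAlgebraic_one) one_ne_zero h
  have hfin : {z : ℂ | MvPolynomial.aeval (fun _ : Fin 1 => z) L = 0}.Finite := by
    have h := finite_setOf_aeval_eq_zero hL20 htrans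
    refine h.subset ?_
    intro z hz
    simp only [Set.mem_setOf_eq] at hz ⊢
    rw [heval2]; exact hz
  -- pick a non-zero rational off that finite set
  have hinf : (Set.range (fun q : ℚ => (q : ℂ)) \ {0}).Infinite := by
    refine Set.Infinite.sdiff ?_ (Set.finite_singleton 0)
    exact Set.infinite_range_of_injective Rat.cast_injective
  obtain ⟨c, ⟨⟨q, rfl⟩, hq0⟩, hqL⟩ := (hinf.sdiff hfin).nonempty
  have hq : (q : ℂ) ≠ 0 := hq0
  have hqL' : MvPolynomial.aeval (fun _ : Fin 1 => (q : ℂ)) L ≠ 0 := hqL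
  refine ⟨q, by exact_mod_cast hq, ?_⟩
  -- `m(·, q)` as a rational polynomial
  set Mq : Polynomial ℚ := M.map (MvPolynomial.aeval (fun _ : Fin 1 => q) :
      MvPolynomial (Fin 1) ℚ →ₐ[ℚ] ℚ).toRingHom with hMq
  have hcoef : ∀ r : MvPolynomial (Fin 1) ℚ, (MvPolynomial.aeval (fun _ : Fin 1 => (q : ℂ)) r : ℂ) =
      algebraMap ℚ ℂ (MvPolynomial.aeval (fun _ : Fin 1 => q) r) := by
    intro r
    have e : (fun _ : Fin 1 => (q : ℂ)) = algebraMap ℚ ℂ ∘ fun _ : Fin 1 => q := by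
      funext i; rfl
    rw [e, MvPolynomial.aeval_algebraMap_apply]
  have hMqC : M.map (MvPolynomial.aeval (fun _ : Fin 1 => (q : ℂ)) :
      MvPolynomial (Fin 1) ℚ →ₐ[ℚ] ℂ).toRingHom = Mq.map (algebraMap ℚ ℂ) := by
    rw [hMq, Polynomial.map_map]
    congr 1
    exact RingHom.ext fun r => hcoef r
  have hMq0 : Mq ≠ 0 := by
    intro h0
    apply hqL'
    have hlc : (MvPolynomial.aeval (fun _ : Fin 1 => q) L) = 0 := by
      have := congrArg Polynomial.leadingCoeff h0
      rw [Polynomial.leadingCoeff_zero] at this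
      by_contra hne
      rw [hMq, Polynomial.leadingCoeff_map_of_leadingCoeff_ne_zero _ (by exact hne)] at this
      exact hne this
    rw [hcoef, hlc, map_zero]
  intro hzero
  -- then `e^q` would be algebraic
  have halg : IsAlgebraic ℚ (cexp q) := by
    refine ⟨Mq, hMq0, ?_⟩
    rw [Polynomial.aeval_def, ← Polynomial.eval_map, ← hMqC, eval_map_finSuccEquiv]
    exact hzero
  have hqalg : IsAlgebraic ℚ ((q : ℚ) : ℂ) := by
    have h := isAlgebraic_algebraMap (R := ℚ) (A := ℂ) q
    rwa [eq_ratCast] at h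
  exact transcendental_exp_holds hqalg hq halg

/-- **Zeros of a non-zero exponential polynomial are isolated** (identity theorem on `ℂ`). -/
theorem expPoly_eventually_ne {m : MvPolynomial (Fin 2) ℚ} (hm : m ≠ 0) (z₀ : ℂ) :
    ∀ᶠ s in 𝓝[≠] z₀, expPoly m s ≠ 0 := by
  rcases (analyticAt_expPoly m z₀).eventually_eq_zero_or_eventually_ne_zero with h | h
  · exfalso
    obtain ⟨q, -, hq⟩ := exists_rat_expPoly_ne_zero hm
    have hall := AnalyticOnNhd.eqOn_zero_of_preconnected_of_eventuallyEq_zero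
      (f := expPoly m) (U := Set.univ) (fun s _ => analyticAt_expPoly m s)
      isPreconnected_univ (Set.mem_univ z₀) h
    exact hq (hall (Set.mem_univ _))
  · exact h

/-- Hence **bounded sets of zeros of a non-zero exponential polynomial are finite**. -/
theorem expPoly_zeros_finite {m : MvPolynomial (Fin 2) ℚ} (hm : m ≠ 0) (R : ℝ) :
    {s : ℂ | ‖s‖ ≤ R ∧ expPoly m s = 0}.Finite := by
  by_contra hinf
  have hinf' : {s : ℂ | ‖s‖ ≤ R ∧ expPoly m s = 0}.Infinite := hinf
  have hsub : {s : ℂ | ‖s‖ ≤ R ∧ expPoly m s = 0} ⊆ Metric.closedBall (0 : ℂ) R := by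
    intro s hs; simpa using hs.1
  obtain ⟨z₀, -, hacc⟩ := hinf'.exists_accPt_of_subset_isCompact (isCompact_closedBall 0 R) hsub
  rw [accPt_iff_frequently_nhdsNE] at hacc
  have h := expPoly_eventually_ne hm z₀
  obtain ⟨s, hs, hs'⟩ := (hacc.and_eventually h).exists
  exact hs' hs.2

/-- **E-SPECIAL TUPLES, ANY RANK: bounded sets of locus points are finite.**  If every coordinate of
`x ∈ ℂⁿ` is *E-special* — `xᵢ` and `e^{xᵢ}` algebraically dependent, witnessed by `mᵢ ≠ 0` in `ℚ[T, S]`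
with `mᵢ(e^{xᵢ}, xᵢ) = 0` (automatic at rank 2, and in the log sector at every rank) — then the tuples `v`
satisfying every ℚ-relation of `(x, eˣ)` with `‖vᵢ‖ ≤ R` form a finite set: `𝒵_W ⊆ ∏ᵢ Z(mᵢ)` is closed
discrete with no finite accumulation point. -/
theorem locusPts_bounded_finite_of_special {n : ℕ} {x : Fin n → ℂ}
    (hdep : ∀ i, ∃ m : MvPolynomial (Fin 2) ℚ, m ≠ 0 ∧ MvPolynomial.aeval ![cexp (x i), x i] m = 0)
    (R : ℝ) :
    {v : Fin n → ℂ | (∀ i, ‖v i‖ ≤ R) ∧ ∀ p : MvPolynomial (Fin n ⊕ Fin n) ℚ,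
        MvPolynomial.aeval (Sum.elim x (cexp ∘ x)) p = 0 →
        MvPolynomial.aeval (Sum.elim v (cexp ∘ v)) p = 0}.Finite := by
  choose m hm0 hm using hdep
  -- the relation `mᵢ(Yᵢ, Xᵢ)` of `(x, eˣ)` transfers to every `v` on the locus
  have htrans : ∀ i (v : Fin n → ℂ), (∀ p : MvPolynomial (Fin n ⊕ Fin n) ℚ,
      MvPolynomial.aeval (Sum.elim x (cexp ∘ x)) p = 0 →
      MvPolynomial.aeval (Sum.elim v (cexp ∘ v)) p = 0) → expPoly (m i) (v i) = 0 := by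
    intro i v hv
    set r : Fin 2 → Fin n ⊕ Fin n := ![Sum.inr i, Sum.inl i] with hr
    have hre : ∀ w : Fin n → ℂ, MvPolynomial.aeval (Sum.elim w (cexp ∘ w)) (MvPolynomial.rename r (m i)) =
        expPoly (m i) (w i) := by
      intro w
      have e : (Sum.elim w (cexp ∘ w) ∘ r) = ![cexp (w i), w i] := by
        funext j; fin_cases j <;> rfl
      rw [MvPolynomial.aeval_rename, expPoly_def, e]
    have h0 : MvPolynomial.aeval (Sum.elim x (cexp ∘ x)) (MvPolynomial.rename r (m i)) = 0 := by
      rw [hre]; exact hm i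
    have := hv _ h0
    rwa [hre] at this
  have hZ : ∀ i, {s : ℂ | ‖s‖ ≤ R ∧ expPoly (m i) s = 0}.Finite := fun i => expPoly_zeros_finite (hm0 i) R
  refine (Set.Finite.pi hZ).subset ?_
  intro v hv
  rw [Set.mem_univ_pi]
  intro i
  exact ⟨hv.1 i, htrans i v hv.2⟩

/-- **At rank 2 every coordinate is E-special** (`trdeg ℚ(xᵢ, e^{xᵢ}) ≤ trdeg ℚ(x, eˣ) ≤ 1`), so
**BOUNDED SETS OF TUPLES ON THE LOCUS ARE FINITE**: for `x ∈ ℂ²` with `trdeg ℚ(x,eˣ) < 2` (e.g. a rank-2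
first failure — but neither linear independence nor `SchanuelRank` is used) the tuples `v` satisfying
every ℚ-relation of `(x, eˣ)` with norm `≤ R` form a finite set; `𝒵_W ⊆ Z(m₀) × Z(m₁)` is a closed
discrete set with NO finite accumulation point, and the locus mates are finite iff BOUNDED. -/
theorem locusPts_bounded_finite {x : Fin 2 → ℂ}
    (htr : Algebra.trdeg ℚ ↥(IntermediateField.adjoin ℚ (range x ∪ range (cexp ∘ x))) < (2 : Cardinal))
    (R : ℝ) :
    {v : Fin 2 → ℂ | (∀ i, ‖v i‖ ≤ R) ∧ ∀ p : MvPolynomial (Fin 2 ⊕ Fin 2) ℚ,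
        MvPolynomial.aeval (Sum.elim x (cexp ∘ x)) p = 0 →
        MvPolynomial.aeval (Sum.elim v (cexp ∘ v)) p = 0}.Finite := by
  refine locusPts_bounded_finite_of_special (fun i => ?_) R
  exact exists_mvPolynomial_of_trdeg_lt_two htr
    (IntermediateField.subset_adjoin ℚ _ (Or.inr ⟨i, rfl⟩))
    (IntermediateField.subset_adjoin ℚ _ (Or.inl ⟨i, rfl⟩))

end RankTwo

/-- **§18 HEADLINE — AT RANK 2, BOUNDED SETS OF MATES ARE FINITE** (indeed bounded sets of arbitrary
points of `𝒵_W`, ℚ-dependent or not): every coordinate of a point of `𝒵_W` is a zero of a FIXED non-zero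
one-variable exponential polynomial `mᵢ(e^s, s)`, `mᵢ ∈ ℚ[T,S]` (`trdeg ℚ(xᵢ, e^{xᵢ}) ≤ 1`), and such
zero sets are closed discrete in `ℂ` (identity theorem; non-vanishing at a rational point by
Hermite–Lindemann).  So `𝒵_W ⊆ Z(m₀) × Z(m₁)` has NO finite accumulation point at all — this settles
§17b's residual "no accumulation at the origin" at rank 2 and does not even use linear independence or
`SchanuelRank`. -/
theorem IsFirstFailure.locusMates_bounded_finite {x : Fin 2 → ℂ} (hx : IsFirstFailure x) (R : ℝ) :
    {x' : Fin 2 → ℂ | x' ∈ locusMates x ∧ ∀ i, ‖x' i‖ ≤ R}.Finite :=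
  (RankTwo.locusPts_bounded_finite (x := x) (by exact_mod_cast hx.2.1) R).subset
    fun _ h => ⟨h.2, h.1.2⟩

/-- **RANK 2: the mates are finite iff they are BOUNDED.**  The open residue of the crux at its first
open rank (`ExpSectorTwo`, stub `stub_expImageFinite_offLog`, SparsityTwo on first-failure curves) is
therefore exactly a NO-ESCAPE-TO-INFINITY statement: the mates `(s₀, s₁) ∈ Z(m₀) × Z(m₁)` of a rank-2
first failure stay in a bounded region of `ℂ²`. -/
theorem IsFirstFailure.locusMates_finite_iff_bounded {x : Fin 2 → ℂ} (hx : IsFirstFailure x) :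
    (locusMates x).Finite ↔ Bornology.IsBounded (locusMates x) := by
  constructor
  · exact Set.Finite.isBounded
  · intro hb
    obtain ⟨R, hR⟩ := hb.subset_closedBall 0
    refine (hx.locusMates_bounded_finite R).subset fun x' hx' => ⟨hx', fun i => ?_⟩
    have h := hR hx'
    rw [Metric.mem_closedBall, dist_zero_right] at h
    exact (norm_le_pi_norm x' i).trans h

/-- Hence **`CruxRankTwo` follows from BOUNDEDNESS of the mates of rank-2 first failures** (with §8's
free definable isolation). -/
theorem cruxRankTwo_of_bounded
    (h : ∀ x : Fin 2 → ℂ, IsFirstFailure x → Bornology.IsBounded (locusMates x)) : CruxRankTwo :=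
  cruxRankTwo_of_sparsity fun x hx => (hx.locusMates_finite_iff_bounded).2 (h x hx)

/-- … and dually a refutation of the crux at rank 2 needs an UNBOUNDED family of mates: infinitely many
mates force mates of arbitrarily large norm. -/
theorem IsFirstFailure.exists_large_mate_of_infinite {x : Fin 2 → ℂ} (hx : IsFirstFailure x)
    (hinf : (locusMates x).Infinite) (R : ℝ) : ∃ x' ∈ locusMates x, ∃ i, R < ‖x' i‖ := by
  by_contra h
  push Not at h
  apply hinf
  refine (hx.locusMates_bounded_finite R).subset fun x' hx' => ⟨hx', fun i => h x' hx' i⟩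

end RankTwoOpens

end Summit.Schanuel.Schanuel.Cruxes.MinimalCounterexampleInAcl.Disproof

end
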